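import Literature.Analysis.FluidPDE.TorusNSKatoPairInequality
import Literature.Analysis.FluidPDE.TorusNSSobolevHighRange
import Literature.Analysis.FluidPDE.TorusClassicalNSMaximalSolution
import Literature.Analysis.FluidPDE.TorusNSAPosterioriRegularity
import HarnessLib

/-!
# A posteriori existence from an approximate solution in Sobolev norms: the Morosi–Pizzocchero
# control inequality for classical Navier–Stokes solutions on `T³`

Analysis/FluidPDE support file (theorems only; no definitions, no named facts).
Search for candidate a priori estimates; no regularity claim.

Morosi–Pizzocchero (Nonlinear Anal. 75 (2012) 2209–2235, Prop. 4.3; Nonlinear Anal. 113 (2015)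
298–308, Prop. 4.4) prove: if `u_a` is an approximate solution of the (periodic) Navier–Stokes
Cauchy problem with differential error `‖(∂ₜu_a − νΔu_a − 𝒫(u_a,u_a) − f)(t)‖_n ≤ ε_n(t)`,
growth `‖u_a(t)‖_n ≤ 𝒟_n(t)`, `‖u_a(t)‖_{n+1} ≤ 𝒟_{n+1}(t)` and datum error
`‖u_a(0) − u₀‖_n ≤ δ_n` (`n > d/2 + 1`), and `R_n ∈ C([0, T_c))` satisfies the CONTROL INEQUALITY
`d⁺R_n/dt ≥ −νR_n + (G_n𝒟_n + K_n𝒟_{n+1})R_n + G_nR_n² + ε_n`, `R_n(0) ≥ δ_n`, then the maximal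
smooth solution `u` exists beyond `T_c` and `‖u(t) − u_a(t)‖_n ≤ R_n(t)` (`K_n`, `G_n` the
constants of the 'basic' and Kato inequalities for `𝒫(v,w) = 𝔏(v·∇w)`). The exponent of the
resulting existence condition is LINEAR in `∫(𝒟_n + 𝒟_{n+1})` — no `ν^{−3}` as in the `H¹`
robustness radius of `TorusNSAPosterioriRegularity` —, and it is the framework of MP's symbolic
a posteriori certificates (Reynolds expansions for the Behr–Nečas–Wu, Taylor–Green and
Kida–Murakami data at small Reynolds numbers, arXiv:1402.0487).

This file proves the theorem for classical solutions on the unit torus (`card d = 3`, `ν > 0`,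
closed window `[0, T]`, zero external force, homogeneous norms
`‖w‖_s² = ∑_k |k|^{2s}‖ŵ(k)‖²` with `|k|² = freqNormSq k`), with the tree's lattice constants
in place of MP's `K_n, G_n`:

* `NSSobolev.summable_and_abs_tsum_rpow_mul_re_inner_le` — weighted Cauchy–Schwarz
  `|∑|k|^{2s}Re⟪φ̂, ŵ⟫| ≤ ‖φ‖_s‖w‖_s`;
* `NSSobolev.tsum_rpow_mul_norm_le_latticeConst_mul_sqrt` — the Wiener–Sobolev embedding
  `∑|k|^{2r}‖ŵ(k)‖ ≤ C_{r,s}‖w‖_s`, `C_{r,s}² = ∑_{k≠0}|k|^{−2(s−2r)}`, `n₀ < 2(s − 2r)` (mean-zero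
  `w`): `F₀ ≤ C₀‖·‖_s` (`s > n₀/2`), `F₁ ≤ C₁‖·‖_s` (`s > n₀/2 + 1`);
* `NSSobolev.re_inner_mFourierCoeff_timeDerivWithin_sub_two_forces` — the equation of
  `w = u₁ − u₂` (two classical solutions, forces `f₁, f₂`) in Fourier variables, paired with
  `ŵ(k)` (pressure invisible);
* `NSSobolev.hasDerivAt_tsum_rpow_mul_norm_sq_sub_two_forces` — `d/dt ‖w‖_s²` as the sum of the
  dissipation, the two advection pairings and the force pairing (termwise differentiation);
* `NSSobolev.exists_hasDerivAt_tsum_rpow_mul_norm_sq_sub_le` — **MP Lemma 4.2, lattice form**: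
  `d/dt‖w‖_s² ≤ −8π²ν‖w‖²_{s+1} + 4πn s2^s(‖u₂‖_s F₁(w) + F₁(u₂)‖w‖_s)‖w‖_s + 8πn s2^s F₁(w)‖w‖_s²
   + 4πn2^{s−1}(F₀(w)‖u₂‖_{s+1} + F₁(u₂)‖w‖_s)‖w‖_s + 2‖f₁ − f₂‖_s‖w‖_s` (`s ≥ 1`; the Kato pair
  inequality, RSS (3.6) and the transport estimate of `TorusNSKatoPairInequality` /
  `TorusNSSobolevCommutator`, after `(u₁·∇)w = (u₂·∇)w + (w·∇)w`);
* `sqrt_le_of_control_inequality` — the comparison step (Čaplygin–Lakshmikantham): a continuous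
  `X ≥ 0` with `X' ≤ 2√X(−λ√X + γ√X + GX + ε)` on `(0, T)` stays below `R²` for every continuous
  `R` with right derivatives `R' ≥ −λR + γR + GR² + ε` and `R(0) ≥ √X(0)` (perturbation
  `R + δe^{μt}` and the fencing lemma `image_le_of_deriv_right_lt_deriv_boundary'`);
* `Torus.classicalNS_regular_of_sobolev_control` — **MP Prop. 4.4 (i), classical torus form**,
  generic in the embedding constants `C₀, C₁`: for a classical mean-zero solution `(v, q)` with
  force `g` (the approximate solution and its residual, cf.
  `IsSmoothSpaceTimeOn.isClassicalNSSolutionOn_residual`), continuous estimators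
  `‖v‖_s ≤ D₀`, `‖v‖_{s+1} ≤ D₁`, `‖g‖_s ≤ E`, smooth divergence-free mean-zero `u₀`, and `R`
  continuous on `[0, T]` with right derivatives
  `R' ≥ −4π²νR + (4πn s2^sC₁D₀ + 2πn2^{s−1}(C₀D₁ + C₁D₀))R + 4πn s2^sC₁R² + E` on `[0, T)`,
  `R(0) ≥ ‖u₀ − v(0)‖_s`: the classical solution `u` from `u₀` exists on `[0, T] × T³` and
  `‖u(t) − v(t)‖_s ≤ R(t)`;
* `Torus.classicalNS_regular_of_sobolev_control_of_gt` — the same on `T³` for `s > 5/2` with the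
  lattice constants `C₀ = (∑_{k≠0}|k|^{−2s})^{1/2}`, `C₁ = (∑_{k≠0}|k|^{2−2s})^{1/2}`;
* `Torus.classicalNS_regular_of_sobolev_control_residual` — the same for raw data: `v` any
  jointly smooth divergence-free mean-zero field, `q` any smooth scalar, `E ≥ ‖residual‖_s`;
* `Torus.classicalNS_sobolev_control_higher` — **MP Prop. 4.4 (ii)**: for `p ≥ s`, given the
  part-(i) bound `‖u − v‖_s ≤ R_s`, every continuous `R` with right derivatives
  `R' ≥ −4π²νR + (4πn p2^pC₁'D₀ + 2πn2^{p−1}(C₀'D₁ + C₁'D₀) + 4πn p2^pC₁R_s)R + E` (LINEAR) and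
  `R(0) ≥ ‖u(0) − v(0)‖_p` bounds `‖u(t) − v(t)‖_p ≤ R(t)`;
* `Torus.classicalNS_regular_of_sobolev_control_explicit` — constant envelopes `M₀, M₁, ε₀`,
  datum error `δ`: the explicit supersolution `R = (δ + ε₀t)e^{(a+Gρ)t}`,
  `a = (Γ − 4π²ν)⁺`, `ρ = 2(δ + ε₀T)e^{aT}`, turns the theorem into the single checkable
  condition `2GT(δ + ε₀T)e^{aT} ≤ log 2`;
* `Torus.classicalNS_global_of_sobolev_control` — "if `R_n` is global then `u` is global": the
  hypotheses on `[0, ∞)` give a GLOBAL classical solution with `‖u(t) − v(t)‖_s ≤ R(t)`;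
* `Torus.classicalNS_regular_of_sobolev_control_sharp` (§11) — the two Kato-type terms bounded
  through Morosi–Pizzocchero's lattice functional `𝒢_s` (CPAA 2012, Prop. 3.5; the bound `Gsq`
  on its partial sums a hypothesis): `R' ≥ −4π²νR + (2π√Gsq·D₀ + 2πn2^{s−1}(C₀D₁ + C₁D₀))R +
  2π√Gsq·R² + E`;
* `Torus.classicalNS_regular_of_sobolev_control_kernels` (§12) — **MP's own shape**
  `R' ≥ −4π²νR + (G·D₀ + K·D₁)R + G·R² + E`, `G = 2π√Gsq`, `K = 2π√Ksq`, the transport term now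
  bounded through MP's functional `𝒦_s` (Appl. Math. Lett. 26 (2013) 277, Prop. 3.7;
  `NSSobolev.abs_tsum_rpow_mul_re_inner_convect_transport_le_of_kernel_le`) — no embedding
  constant left; `Torus.classicalNS_regular_of_sobolev_control_kernels_explicit` — its closed-form
  certificate `2GT(δ + ε₀T)e^{aT} ≤ log 2`, `a = (G M₀ + K M₁ − 4π²ν)⁺`, with the explicit
  supersolution `R = (δ + ε₀t)e^{(a+Gρ)t}`;
  and `Torus.classicalNS_regular_of_sobolev_control_zeta` — on `T³`, `s > 5/2`,
  both suprema evaluated ELEMENTARILY (Morosi–Pernici–Pizzocchero 2017, Prop. 3.1 / 4.2: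
  `Gsq = s²2^{2s−2}ζ_{2s−2}`, `Ksq = 2^{2s}ζ_{2s}`), i.e. `G = 2π s2^{s−1}C₁`, `K = 2π 2^s C₀`
  with NO hypothesis on a lattice supremum; `Torus.classicalNS_regular_of_sobolev_control_zeta_mpp` —
  the same with `K = 2π(B_sζ_{2s})^{1/2}`, `B_s = 2^{2s+2}(s+1)^{s+1}/(s+2)^{s+2}` (MPP's Lemma 5.3
  constant in closed form, `NSSobolev.sum_wedgeKernel_le_mpp`; `s = 3`: `K ≈ 83`);
  `Torus.classicalNS_regular_of_sobolev_control_zeta_three` — `n = 3` with BOTH suprema bounded by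
  hand (`sup 𝒢₃ ≤ 24ζ₄`, `NSSobolev.sum_gramKernel_le_three`): `G = 2π(24ζ₄)^{1/2} ≈ 125`,
  `K ≈ 83` — the tree's best hypothesis-free constants (MP certified: `43`, `32`).

Size of the constants (orientation only, not used in any proof): for `s = 3` on `T³`, the
Wiener route (§5–§6) has `G = 4πn s2^s C₁ = 288π C₁` with `C₁² = ∑_{k≠0}|k|^{−4} ≈ 16.5`, i.e.
`G ≈ 3.7·10³`, and `γ ≈ 4.0·10³‖v‖_3 + 2.2·10²‖v‖_4` (unit torus, `‖·‖_s² = ∑|k|^{2s}‖·̂‖²`); the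
elementary-zeta route (§12) has `G = 24π C₁ ≈ 3.1·10²`, `γ ≈ 3.1·10²‖v‖_3 + 1.5·10²‖v‖_4`
(`K = 16π C₀`, `C₀² = ∑_{k≠0}|k|^{−6} ≈ 8.40`; `K ≈ 83` with MPP's Lemma 5.3 constant, `…_zeta_mpp`;
`G ≈ 125`, i.e. `γ ≈ 1.25·10²‖v‖_3 + 0.83·10²‖v‖_4`, with the hand constant of `…_zeta_three`);
Morosi–Pizzocchero's optimised `G₃ ≤ 0.438`,
`K₃ ≤ 0.323` (CPAA 2012 / AML 2013, on `(ℝ/2πℤ)³`) read `(2π)^{5/2}G₃ ≈ 43`, `(2π)^{5/2}K₃ ≈ 32`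
in the present normalisation (`v(x) = u(x/2π)`, `v_k = (2π)^{3/2}û(k)`, pairing scaled by
`(2π)^{−2}`), i.e. about `2.9×` resp. `2.6×` below the best §12 values — the theorems below are the
STRUCTURE of the method; MP-quality certificates need the sharp lattice suprema (hypotheses
`hGker`, `hKker` of `…_kernels`).
Stated for the special case we need (classical solutions, `𝕋³`, our constants);
-- TODO(general form): MP's sharp constants `K_n, G_n` (lattice optimisation with rigorous
-- error control, CPAA 11 (2012) 557 and arXiv 1007.4412: `K₃ ≤ 0.323`, `G₃ ≤ 0.438` on
-- `(ℝ/2πℤ)³`), external forcing `f ≠ 0`, half-open control windows `[0, T_c)` with `T_c < ∞`,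
-- and `C¹([0,T), H^∞)` approximate solutions.

## Mathlib / tree search

Reused: `NSSobolev.abs_tsum_rpow_mul_re_inner_convect_pair_le`,
`NSSobolev.abs_tsum_rpow_mul_re_inner_convect_transport_le`, and for §11–§12 the kernel forms
`…_pair_le_of_kernel_le`, `…_transport_le_of_kernel_le`, `NSSobolev.sum_gramKernel_le`,
`NSSobolev.sum_wedgeKernel_le` (`TorusNSKatoPairInequality`),
`NSSobolev.abs_tsum_rpow_mul_re_inner_convect_le` ((3.6), `TorusNSSobolevCommutator`),
`NSSobolev.hasDerivAt_tsum_rpow_mul_norm_sq_of_lt` / `continuousOn_tsum_rpow_mul_norm_sq_of_lt`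
(`TorusNSSobolevHighRange`), `IsClassicalNSSolutionOn.timeDerivWithin_sub_eq_forces`,
`….isSmooth_force_slice` (`NSCoriolisUniqueness`), `NSGevrey.inner_mFourierCoeff_gradient_eq_zero`,
`NSGevrey.mFourierCoeff_complexify_zero_of_hasZeroMean`, `Torus.exists_maximal_classicalNS`,
`Torus.gradNormSq_add_le`, `IsClassicalNSSolutionOn.hasDerivWithinAt_half_gradNormSq`,
`summable_one_add_freqNormSq_rpow_neg`; Mathlib `image_le_of_deriv_right_lt_deriv_boundary'`,
`Real.sum_sqrt_mul_sqrt_le`, `Real.tsum_le_of_sum_le`, `IsCompact.bddAbove_image`,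
`nhdsWithin_Icc_eq_nhdsGE`, `ge_of_tendsto`. Searched
`lean search 'control inequality|a posteriori.*Sobolev|twoBackground.*force|hsSeminorm.*sub'`:
the tree had the `H¹` robustness/a-posteriori family (`TorusNSAPosterioriRegularity`, exponent
with `ν^{−3}`) and the two-background Gevrey balance without force
(`TorusTwoBackgroundGevreyBalance`); no `Ḣ^s` balance of a difference and no control-inequality
comparison.

## References

* C. Morosi, L. Pizzocchero, *Smooth solutions of the Euler and Navier–Stokes equations from the
  a posteriori analysis of approximate solutions*, Nonlinear Anal. 113 (2015) 298–308,
  arXiv:1405.3421: Def. 4.1, Lemma 4.2, Prop. 4.4 (held: paper:arxiv-1405.3421, pp. 7–8).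
  [MorosiPizzocchero2015]
* C. Morosi, L. Pizzocchero, *On approximate solutions of the incompressible Euler and
  Navier–Stokes equations*, Nonlinear Anal. 75 (2012) 2209–2235, Prop. 4.3. [MorosiPizzocchero2012Approx]
* C. Morosi, L. Pizzocchero, *On the constants in a Kato inequality for the Euler and
  Navier–Stokes equations*, Commun. Pure Appl. Anal. 11 (2012) 557–586. [MorosiPizzocchero2012Kato]
* C. Morosi, L. Pizzocchero, *On the constants in a basic inequality for the Euler and
  Navier–Stokes equations*, Appl. Math. Lett. 26 (2013) 277–284 (arXiv:1007.4412), Def. 3.5,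
  Prop. 3.7. [MorosiPizzocchero2013Basic]
* C. Morosi, M. Pernici, L. Pizzocchero, *New results on the constants in some inequalities for
  the Navier–Stokes quadratic nonlinearity*, Appl. Math. Comput. 308 (2017) 54–72
  (arXiv:1511.00533), Prop. 3.1, Prop. 4.2, Cor. 3.4, Cor. 4.5. [MorosiPerniciPizzocchero2017]
* J. C. Robinson, W. Sadowski, R. P. Silva, J. Math. Phys. 53 (2012) 115618, §III–§IV.
  [RobinsonSadowskiSilva2012]
* C. Foias, R. Temam, J. Funct. Anal. 87 (1989) 359–369, §2. [FoiasTemam1989]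
-/

noncomputable section

open MeasureTheory Set Filter UnitAddTorus Function Finset
open scoped Topology BigOperators InnerProductSpace ComplexConjugate

namespace Literature.Analysis.FluidPDE

namespace NSSobolev

open Literature.Analysis.FunctionSpaces Literature.Analysis.FunctionSpaces.Torus NSGevrey

variable {d : Type*} [Fintype d] [DecidableEq d]

/-! ### §1 Lattice Cauchy–Schwarz; the Wiener–Sobolev embeddings `F₀, F₁ ≤ C ‖·‖_{Ḣ^s}` -/

omit [Fintype d] [DecidableEq d] in
/-- Cauchy–Schwarz for nonnegative summable lattice families:
`∑ √p_k √q_k ≤ √(∑ p_k) √(∑ q_k)`. [folklore] -/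
private theorem ci_tsum_sqrt_mul_sqrt_le {ι : Type*} {p q : ι → ℝ} (hp : ∀ i, 0 ≤ p i)
    (hq : ∀ i, 0 ≤ q i) (hps : Summable p) (hqs : Summable q) :
    ∑' i, Real.sqrt (p i) * Real.sqrt (q i) ≤ Real.sqrt (∑' i, p i) * Real.sqrt (∑' i, q i) := by
  refine Real.tsum_le_of_sum_le (fun i => mul_nonneg (Real.sqrt_nonneg _) (Real.sqrt_nonneg _))
    fun K => ?_
  calc ∑ i ∈ K, Real.sqrt (p i) * Real.sqrt (q i)
      ≤ Real.sqrt (∑ i ∈ K, p i) * Real.sqrt (∑ i ∈ K, q i) := Real.sum_sqrt_mul_sqrt_le K hp hq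
    _ ≤ Real.sqrt (∑' i, p i) * Real.sqrt (∑' i, q i) :=
        mul_le_mul (Real.sqrt_le_sqrt (hps.sum_le_tsum K fun i _ => hp i))
          (Real.sqrt_le_sqrt (hqs.sum_le_tsum K fun i _ => hq i)) (Real.sqrt_nonneg _)
          (Real.sqrt_nonneg _)

omit [Fintype d] [DecidableEq d] in
/-- The family `√p_k √q_k` of two nonnegative summable families is summable. [folklore] -/
private theorem ci_summable_sqrt_mul_sqrt {ι : Type*} {p q : ι → ℝ} (hp : ∀ i, 0 ≤ p i)
    (hq : ∀ i, 0 ≤ q i) (hps : Summable p) (hqs : Summable q) :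
    Summable fun i => Real.sqrt (p i) * Real.sqrt (q i) := by
  refine ((hps.add hqs).div_const 2).of_nonneg_of_le
    (fun i => mul_nonneg (Real.sqrt_nonneg _) (Real.sqrt_nonneg _)) fun i => ?_
  have h1 := Real.sq_sqrt (hp i)
  have h2 := Real.sq_sqrt (hq i)
  nlinarith [sq_nonneg (Real.sqrt (p i) - Real.sqrt (q i)), Real.sqrt_nonneg (p i),
    Real.sqrt_nonneg (q i)]

omit [DecidableEq d] in
/-- The weighted pairing of two coefficient families is dominated termwise:
`|x|^{s}|Re⟪a, b⟫| ≤ √(x^s‖a‖²) √(x^s‖b‖²)` (`x ≥ 0`). [folklore] -/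
private theorem ci_abs_rpow_mul_re_inner_le (x s : ℝ) (hx : 0 ≤ x) (a b : EuclideanSpace ℂ d) :
    |x ^ s * (inner ℂ a b).re| ≤ Real.sqrt (x ^ s * ‖a‖ ^ 2) * Real.sqrt (x ^ s * ‖b‖ ^ 2) := by
  have hxs : 0 ≤ x ^ s := Real.rpow_nonneg hx s
  rw [abs_mul, abs_of_nonneg hxs, Real.sqrt_mul' _ (sq_nonneg _), Real.sqrt_mul' _ (sq_nonneg _),
    Real.sqrt_sq (norm_nonneg _), Real.sqrt_sq (norm_nonneg _)]
  have h1 : |(inner ℂ a b).re| ≤ ‖a‖ * ‖b‖ :=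
    (Complex.abs_re_le_norm _).trans (norm_inner_le_norm a b)
  have h2 : Real.sqrt (x ^ s) * Real.sqrt (x ^ s) = x ^ s := Real.mul_self_sqrt hxs
  calc x ^ s * |(inner ℂ a b).re| ≤ x ^ s * (‖a‖ * ‖b‖) := mul_le_mul_of_nonneg_left h1 hxs
    _ = Real.sqrt (x ^ s) * ‖a‖ * (Real.sqrt (x ^ s) * ‖b‖) := by
        rw [show Real.sqrt (x ^ s) * ‖a‖ * (Real.sqrt (x ^ s) * ‖b‖) =
          Real.sqrt (x ^ s) * Real.sqrt (x ^ s) * (‖a‖ * ‖b‖) by ring, h2]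

/-- **Weighted Cauchy–Schwarz for the `Ḣ^s` pairing of two smooth fields** (the "Schwarz
inequality for `⟨ | ⟩_p`" of Morosi–Pizzocchero's Lemma 4.2, (4.8):
`−⟨e(u_a) | w⟩_p ≤ ‖e(u_a)‖_p ‖w‖_p`): for smooth `φ, w` on `T^n` and `s ≥ 0` the family
`|k|^{2s} Re⟪φ̂(k), ŵ(k)⟫` is summable and
`|∑_k |k|^{2s} Re⟪φ̂(k), ŵ(k)⟫| ≤ ‖φ‖_{Ḣ^s} ‖w‖_{Ḣ^s}` (`|k|² = freqNormSq k`).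
[cite: MorosiPizzocchero2015, Lemma 4.2 (4.8) (Schwarz inequality in `H^p`, Fourier form (2.5))] -/
theorem summable_and_abs_tsum_rpow_mul_re_inner_le {φ w : UnitAddTorus d → EuclideanSpace ℝ d}
    (hφ : IsSmooth φ) (hw : IsSmooth w) {s : ℝ} (hs : 0 ≤ s) :
    (Summable fun k : d → ℤ => freqNormSq k ^ s *
        (inner ℂ (mFourierCoeff (EuclideanSpace.complexify ∘ φ) k)
          (mFourierCoeff (EuclideanSpace.complexify ∘ w) k)).re) ∧
      |∑' k : d → ℤ, freqNormSq k ^ s *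
          (inner ℂ (mFourierCoeff (EuclideanSpace.complexify ∘ φ) k)
            (mFourierCoeff (EuclideanSpace.complexify ∘ w) k)).re| ≤
        Real.sqrt (∑' k : d → ℤ, freqNormSq k ^ s *
            ‖mFourierCoeff (EuclideanSpace.complexify ∘ φ) k‖ ^ 2) *
          Real.sqrt (∑' k : d → ℤ, freqNormSq k ^ s *
            ‖mFourierCoeff (EuclideanSpace.complexify ∘ w) k‖ ^ 2) := by
  set f : (d → ℤ) → ℝ := fun k => freqNormSq k ^ s *
    (inner ℂ (mFourierCoeff (EuclideanSpace.complexify ∘ φ) k)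
      (mFourierCoeff (EuclideanSpace.complexify ∘ w) k)).re with hf
  set p : (d → ℤ) → ℝ := fun k => freqNormSq k ^ s *
    ‖mFourierCoeff (EuclideanSpace.complexify ∘ φ) k‖ ^ 2 with hp
  set q : (d → ℤ) → ℝ := fun k => freqNormSq k ^ s *
    ‖mFourierCoeff (EuclideanSpace.complexify ∘ w) k‖ ^ 2 with hq
  have hp0 : ∀ k, 0 ≤ p k := fun k => mul_nonneg (Real.rpow_nonneg (freqNormSq_nonneg k) _) (sq_nonneg _)
  have hq0 : ∀ k, 0 ≤ q k := fun k => mul_nonneg (Real.rpow_nonneg (freqNormSq_nonneg k) _) (sq_nonneg _)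
  have hps : Summable p := hφ.summable_freqNormSq_rpow_mul_norm_sq hs
  have hqs : Summable q := hw.summable_freqNormSq_rpow_mul_norm_sq hs
  have hle : ∀ k, |f k| ≤ Real.sqrt (p k) * Real.sqrt (q k) := fun k =>
    ci_abs_rpow_mul_re_inner_le _ _ (freqNormSq_nonneg k) _ _
  have hmaj := ci_summable_sqrt_mul_sqrt hp0 hq0 hps hqs
  have hsum : Summable f :=
    Summable.of_norm_bounded hmaj fun k => (Real.norm_eq_abs _).le.trans (hle k)
  refine ⟨hsum, ?_⟩
  show |∑' k, f k| ≤ Real.sqrt (∑' k, p k) * Real.sqrt (∑' k, q k)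
  have h1 : |∑' k, f k| ≤ ∑' k, |f k| := by
    have h := norm_tsum_le_tsum_norm hsum.norm
    simpa only [Real.norm_eq_abs] using h
  have h2 : ∑' k, |f k| ≤ ∑' k, Real.sqrt (p k) * Real.sqrt (q k) :=
    hsum.abs.tsum_le_tsum hle hmaj
  exact h1.trans (h2.trans (ci_tsum_sqrt_mul_sqrt_le hp0 hq0 hps hqs))

omit [DecidableEq d] in
/-- The punctured lattice `p`-series `∑_{k≠0} |k|^{-2t}` converges for `2t > n`
(`|k|^{-2t} ≤ 2^t (1+|k|²)^{-t}` off the origin; as in `TorusNSSobolevGrowthRate`). [folklore] -/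
private theorem ci_summable_ite_freqNormSq_rpow_neg {t : ℝ} (ht : (Fintype.card d : ℝ) < 2 * t) :
    Summable fun k : d → ℤ => if k = 0 then (0 : ℝ) else freqNormSq k ^ (-t) := by
  classical
  have ht0 : 0 ≤ t := by
    have : (0 : ℝ) ≤ Fintype.card d := Nat.cast_nonneg _
    linarith
  rcases isEmpty_or_nonempty d with hd | hd
  · refine summable_of_ne_finset_zero (s := ∅) fun k _ => ?_
    rw [if_pos (Subsingleton.elim k 0)]
  have hmaj := (summable_one_add_freqNormSq_rpow_neg (d := d) ht).mul_left ((2 : ℝ) ^ t)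
  refine Summable.of_nonneg_of_le (fun k => ?_) (fun k => ?_) hmaj
  · split_ifs
    · exact le_rfl
    · exact Real.rpow_nonneg (freqNormSq_nonneg k) _
  · split_ifs with hk
    · exact mul_nonneg (Real.rpow_nonneg (by norm_num) _)
        (Real.rpow_nonneg (by linarith [freqNormSq_nonneg k]) _)
    · have hm : 1 ≤ freqNormSq k := one_le_freqNormSq_of_ne_zero hk
      have hm0 : 0 < freqNormSq k := by linarith
      have h2 : (freqNormSq k)⁻¹ ≤ 2 / (1 + freqNormSq k) := by
        rw [inv_eq_one_div, div_le_div_iff₀ hm0 (by linarith)]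
        linarith
      calc freqNormSq k ^ (-t) = (freqNormSq k)⁻¹ ^ t := by
            rw [Real.rpow_neg hm0.le, Real.inv_rpow hm0.le]
        _ ≤ (2 / (1 + freqNormSq k)) ^ t := Real.rpow_le_rpow (inv_nonneg.2 hm0.le) h2 ht0
        _ = 2 ^ t * (1 + freqNormSq k) ^ (-t) := by
            rw [Real.div_rpow (by norm_num) (by linarith), Real.rpow_neg (by linarith),
              div_eq_mul_inv]

/-- **The Wiener–Sobolev embedding on the lattice** (the constants `K_n`, `G_n` of
Morosi–Pizzocchero are finite because `H^n ⊂ F_0, F_1` for `n > d/2`, `n > d/2 + 1`): for a smooth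
mean-zero field `w` on `T^{n₀}`, `r ≥ 0` and `s` with `n₀ < 2(s − 2r)`,
`∑_k |k|^{2r} ‖ŵ(k)‖ ≤ C_{r,s} ‖w‖_{Ḣ^s}`, `C_{r,s}² = ∑_{k ≠ 0} |k|^{-2(s−2r)}`,
`‖w‖²_{Ḣ^s} = ∑_k |k|^{2s}‖ŵ(k)‖²` (Cauchy–Schwarz; `ŵ(0) = 0`). Cases used below: `r = 0`
(`F₀(w) = ∑‖ŵ(k)‖ ≤ C₀‖w‖_{Ḣ^s}`, `s > n₀/2`) and `r = 1/2` (`F₁(w) = ∑|k|‖ŵ(k)‖ ≤ C₁‖w‖_{Ḣ^s}`,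
`s > n₀/2 + 1`). [cite: MorosiPizzocchero2012Kato, §2 (the spaces `H^n` and the inequalities for `n > d/2`, `n > d/2+1`); RobinsonSadowskiSilva2012, §III (the algebra norms `‖·‖_{F_r}`)] -/
theorem tsum_rpow_mul_norm_le_latticeConst_mul_sqrt {w : UnitAddTorus d → EuclideanSpace ℝ d}
    (hw : IsSmooth w) (h0 : HasZeroMean w) {r s : ℝ} (hr : 0 ≤ r)
    (hrs : (Fintype.card d : ℝ) < 2 * (s - 2 * r)) :
    ∑' k : d → ℤ, freqNormSq k ^ r * ‖mFourierCoeff (EuclideanSpace.complexify ∘ w) k‖ ≤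
      Real.sqrt (∑' k : d → ℤ, if k = 0 then (0 : ℝ) else freqNormSq k ^ (-(s - 2 * r))) *
        Real.sqrt (∑' k : d → ℤ, freqNormSq k ^ s *
          ‖mFourierCoeff (EuclideanSpace.complexify ∘ w) k‖ ^ 2) := by
  classical
  have hs0 : 0 ≤ s := by
    have : (0 : ℝ) ≤ Fintype.card d := Nat.cast_nonneg _
    linarith
  set c : (d → ℤ) → EuclideanSpace ℂ d := fun k => mFourierCoeff (EuclideanSpace.complexify ∘ w) k
    with hc
  set p : (d → ℤ) → ℝ := fun k => if k = 0 then (0 : ℝ) else freqNormSq k ^ (-(s - 2 * r)) with hp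
  set q : (d → ℤ) → ℝ := fun k => freqNormSq k ^ s * ‖c k‖ ^ 2 with hq
  have hp0 : ∀ k, 0 ≤ p k := fun k => by
    simp only [hp]
    split_ifs
    · exact le_rfl
    · exact Real.rpow_nonneg (freqNormSq_nonneg k) _
  have hq0 : ∀ k, 0 ≤ q k := fun k => mul_nonneg (Real.rpow_nonneg (freqNormSq_nonneg k) _) (sq_nonneg _)
  have hps : Summable p := ci_summable_ite_freqNormSq_rpow_neg (d := d) (by linarith)
  have hqs : Summable q := hw.summable_freqNormSq_rpow_mul_norm_sq hs0
  have hc0 : c 0 = 0 := mFourierCoeff_complexify_zero_of_hasZeroMean hw.integrable h0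
  have hterm : ∀ k, freqNormSq k ^ r * ‖c k‖ = Real.sqrt (p k) * Real.sqrt (q k) := by
    intro k
    by_cases hk : k = 0
    · simp only [hp, hq, hk, if_true, hc0, norm_zero, mul_zero, Real.sqrt_zero, zero_mul]
    · have hx : 0 < freqNormSq k := lt_of_lt_of_le one_pos (one_le_freqNormSq_of_ne_zero hk)
      simp only [hp, hq, if_neg hk]
      rw [Real.sqrt_mul' _ (sq_nonneg _), Real.sqrt_sq (norm_nonneg _), Real.sqrt_eq_rpow,
        Real.sqrt_eq_rpow, ← Real.rpow_mul hx.le, ← Real.rpow_mul hx.le, ← mul_assoc,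
        ← Real.rpow_add hx]
      congr 1
      congr 1
      ring
  rw [tsum_congr hterm]
  exact ci_tsum_sqrt_mul_sqrt_le hp0 hq0 hps hqs

/-! ### §2 The momentum equation of the difference of two solutions, in Fourier variables -/

section Difference

variable {ν a b : ℝ} {f₁ f₂ u₁ u₂ : ℝ → UnitAddTorus d → EuclideanSpace ℝ d}
  {p₁ p₂ : ℝ → UnitAddTorus d → ℝ}

/-- **The equation of the difference `w = u₁ − u₂` of two classical solutions (forces `f₁, f₂`,
same viscosity) in Fourier variables, paired with the mode** (Morosi–Pizzocchero 2015, proof of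
Lemma 4.2: "`dw/dt = νΔw − 𝒫(u_a,w) − 𝒫(w,u_a) − 𝒫(w,w) − e(u_a)`" paired with `w` in `H^p`;
Foias–Temam modewise form): for `t ∈ [a, b]` and every `k`,
`Re⟪𝓕(∂ₜw)(k), ŵ(k)⟫ = −4π²ν|k|²‖ŵ(k)‖² − (Re⟪𝓕((u₁·∇)w)(k), ŵ(k)⟫ + Re⟪𝓕((w·∇)u₂)(k), ŵ(k)⟫)
  + Re⟪𝓕(f₁ − f₂)(k), ŵ(k)⟫`
(`∂ₜw = νΔw − ((u₁·∇)w + (w·∇)u₂) − ∇(p₁ − p₂) + (f₁ − f₂)`,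
`IsClassicalNSSolutionOn.timeDerivWithin_sub_eq_forces`; the pressure is invisible modewise,
`NSGevrey.inner_mFourierCoeff_gradient_eq_zero`, since `div w = 0`).
[cite: MorosiPizzocchero2015, Lemma 4.2 (proof, the equation for `w`); FoiasTemam1989, §2 (2.4)–(2.6)] -/
theorem re_inner_mFourierCoeff_timeDerivWithin_sub_two_forces
    (h₁ : Torus.IsClassicalNSSolutionOn (Icc a b) ν f₁ u₁ p₁)
    (h₂ : Torus.IsClassicalNSSolutionOn (Icc a b) ν f₂ u₂ p₂) (hab : a < b) {t : ℝ} (ht : t ∈ Icc a b)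
    (k : d → ℤ) :
    (inner ℂ (mFourierCoeff (EuclideanSpace.complexify ∘
        Torus.timeDerivWithin (Icc a b) (fun s y => u₁ s y - u₂ s y) t) k)
      (mFourierCoeff (EuclideanSpace.complexify ∘ (fun y => u₁ t y - u₂ t y)) k)).re =
      -(ν * (4 * Real.pi ^ 2 * freqNormSq k)) *
          ‖mFourierCoeff (EuclideanSpace.complexify ∘ (fun y => u₁ t y - u₂ t y)) k‖ ^ 2 -
        ((inner ℂ (mFourierCoeff (EuclideanSpace.complexify ∘
              Torus.convect (u₁ t) (fun y => u₁ t y - u₂ t y)) k)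
            (mFourierCoeff (EuclideanSpace.complexify ∘ (fun y => u₁ t y - u₂ t y)) k)).re +
          (inner ℂ (mFourierCoeff (EuclideanSpace.complexify ∘
              Torus.convect (fun y => u₁ t y - u₂ t y) (u₂ t)) k)
            (mFourierCoeff (EuclideanSpace.complexify ∘ (fun y => u₁ t y - u₂ t y)) k)).re) +
        (inner ℂ (mFourierCoeff (EuclideanSpace.complexify ∘ (fun y => f₁ t y - f₂ t y)) k)
          (mFourierCoeff (EuclideanSpace.complexify ∘ (fun y => u₁ t y - u₂ t y)) k)).re := by
  have hu₁t : IsSmooth (u₁ t) := h₁.smooth_velocity.isSmooth_slice ht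
  have hu₂t : IsSmooth (u₂ t) := h₂.smooth_velocity.isSmooth_slice ht
  have hwt : IsSmooth (fun y => u₁ t y - u₂ t y) := hu₁t.sub hu₂t
  have hqt : IsSmooth (fun y => p₁ t y - p₂ t y) :=
    (h₁.smooth_pressure.isSmooth_slice ht).sub (h₂.smooth_pressure.isSmooth_slice ht)
  have hft : IsSmooth (fun y => f₁ t y - f₂ t y) :=
    (h₁.isSmooth_force_slice hab ht).sub (h₂.isSmooth_force_slice hab ht)
  have hc1 : IsSmooth (Torus.convect (u₁ t) (fun y => u₁ t y - u₂ t y)) := hu₁t.convect hwt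
  have hc2 : IsSmooth (Torus.convect (fun y => u₁ t y - u₂ t y) (u₂ t)) := hwt.convect hu₂t
  have hdivw : IsDivFree (fun y => u₁ t y - u₂ t y) := by
    intro x
    have hw' : (fun y => u₁ t y - u₂ t y) = u₁ t - u₂ t := rfl
    rw [hw', Torus.divergence_sub (hu₁t.isContDiff (by simp)) (hu₂t.isContDiff (by simp)),
      h₁.divFree t ht x, h₂.divFree t ht x, sub_zero]
  have hlap : ∀ x, Torus.laplacian (u₁ t) x - Torus.laplacian (u₂ t) x =
      Torus.laplacian (fun y => u₁ t y - u₂ t y) x := by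
    intro x
    have hw' : (fun y => u₁ t y - u₂ t y) = u₁ t - u₂ t := rfl
    rw [hw', Torus.laplacian_sub hu₁t hu₂t, Pi.sub_apply]
  have hpoint : ∀ x, Torus.timeDerivWithin (Icc a b) (fun s y => u₁ s y - u₂ s y) t x =
      ν • Torus.laplacian (fun y => u₁ t y - u₂ t y) x -
        Torus.convect (u₁ t) (fun y => u₁ t y - u₂ t y) x -
        Torus.convect (fun y => u₁ t y - u₂ t y) (u₂ t) x -
        Torus.gradient (fun y => p₁ t y - p₂ t y) x + (f₁ t x - f₂ t x) := by
    intro x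
    rw [h₁.timeDerivWithin_sub_eq_forces h₂ hab ht x, ← hlap x]
    abel
  have heq : (EuclideanSpace.complexify ∘ Torus.timeDerivWithin (Icc a b) (fun s y => u₁ s y - u₂ s y) t) =
      ((ν : ℂ) • (EuclideanSpace.complexify ∘ Torus.laplacian (fun y => u₁ t y - u₂ t y)) -
        EuclideanSpace.complexify ∘ Torus.convect (u₁ t) (fun y => u₁ t y - u₂ t y) -
        EuclideanSpace.complexify ∘ Torus.convect (fun y => u₁ t y - u₂ t y) (u₂ t) -
        EuclideanSpace.complexify ∘ Torus.gradient (fun y => p₁ t y - p₂ t y)) +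
        EuclideanSpace.complexify ∘ (fun y => f₁ t y - f₂ t y) := by
    funext x
    simp only [Pi.add_apply, Pi.sub_apply, Pi.smul_apply, Function.comp_apply, hpoint x, map_sub,
      map_add, LinearIsometry.map_smul, Complex.coe_smul]
  have hi1 : Integrable (EuclideanSpace.complexify ∘ Torus.laplacian (fun y => u₁ t y - u₂ t y)) volume :=
    integrable_complexify_comp hwt.laplacian.integrable
  have hi2 : Integrable (EuclideanSpace.complexify ∘ Torus.convect (u₁ t) (fun y => u₁ t y - u₂ t y))
      volume := integrable_complexify_comp hc1.integrable
  have hi3 : Integrable (EuclideanSpace.complexify ∘ Torus.convect (fun y => u₁ t y - u₂ t y) (u₂ t))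
      volume := integrable_complexify_comp hc2.integrable
  have hi4 : Integrable (EuclideanSpace.complexify ∘ Torus.gradient (fun y => p₁ t y - p₂ t y)) volume :=
    integrable_complexify_comp hqt.gradient.integrable
  have hi5 : Integrable (EuclideanSpace.complexify ∘ (fun y => f₁ t y - f₂ t y)) volume :=
    integrable_complexify_comp hft.integrable
  rw [heq, mFourierCoeff_add ((((hi1.smul (ν : ℂ)).sub hi2).sub hi3).sub hi4) hi5,
    mFourierCoeff_sub (((hi1.smul (ν : ℂ)).sub hi2).sub hi3) hi4,
    mFourierCoeff_sub ((hi1.smul (ν : ℂ)).sub hi2) hi3, mFourierCoeff_sub (hi1.smul (ν : ℂ)) hi2,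
    mFourierCoeff_const_smul, mFourierCoeff_complexify_laplacian hwt]
  simp only [inner_add_left, inner_sub_left, inner_smul_left, inner_neg_left, Complex.conj_ofReal,
    inner_mFourierCoeff_gradient_eq_zero hqt hwt hdivw, sub_zero, Complex.add_re, Complex.sub_re]
  set v : EuclideanSpace ℂ d := mFourierCoeff (EuclideanSpace.complexify ∘ (fun y => u₁ t y - u₂ t y)) k
    with hv
  have hself : (inner ℂ v v).re = ‖v‖ ^ 2 := by
    have := inner_self_eq_norm_sq (𝕜 := ℂ) v
    rwa [RCLike.re_to_complex] at this
  have hre : ((ν : ℂ) * -(((4 * Real.pi ^ 2 * freqNormSq k : ℝ) : ℂ) * inner ℂ v v)).re =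
      -(ν * (4 * Real.pi ^ 2 * freqNormSq k)) * ‖v‖ ^ 2 := by
    rw [← hself, show (ν : ℂ) * -(((4 * Real.pi ^ 2 * freqNormSq k : ℝ) : ℂ) * inner ℂ v v) =
      ((-(ν * (4 * Real.pi ^ 2 * freqNormSq k)) : ℝ) : ℂ) * inner ℂ v v by push_cast; ring,
      Complex.re_ofReal_mul]
  rw [hre]
  ring

/-! ### §3 The `Ḣ^s` balance of the difference of two solutions -/

/-- **The `Ḣ^s` energy identity for the difference of two classical solutions, two forces**
(Morosi–Pizzocchero 2015, Lemma 4.2, the identity behind (4.6): `½ d/dt‖w‖_p² = ⟨dw/dt | w⟩_p`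
expanded with the equation for `w`): for classical solutions `(u₁, p₁)`, `(u₂, p₂)` on
`[a, b] × T^{n₀}` with forces `f₁, f₂` (same `ν`), `s > 0` and an interior time `t`, the sum
`X_w(τ) = ∑_k |k|^{2s}‖ŵ(τ, k)‖²`, `w = u₁ − u₂`, is differentiable at `t` with derivative
`−8π²ν ∑|k|^{2s+2}‖ŵ‖² − 2∑|k|^{2s}Re⟪𝓕((u₁·∇)w), ŵ⟫ − 2∑|k|^{2s}Re⟪𝓕((w·∇)u₂), ŵ⟫
  + 2∑|k|^{2s}Re⟪𝓕(f₁ − f₂), ŵ⟫`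
(termwise differentiation `NSSobolev.hasDerivAt_tsum_rpow_mul_norm_sq_of_lt` and §2; each of the
four families is summable, §1). [cite: MorosiPizzocchero2015, Lemma 4.2 (4.6)–(4.7); RobinsonSadowskiSilva2012, §IV (energy method in `Ḣ^s`)] -/
theorem hasDerivAt_tsum_rpow_mul_norm_sq_sub_two_forces
    (h₁ : Torus.IsClassicalNSSolutionOn (Icc a b) ν f₁ u₁ p₁)
    (h₂ : Torus.IsClassicalNSSolutionOn (Icc a b) ν f₂ u₂ p₂) (hab : a < b) {s : ℝ} (hs : 0 < s)
    {t : ℝ} (ht : t ∈ Ioo a b) :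
    HasDerivAt (fun τ => ∑' k : d → ℤ, freqNormSq k ^ s *
        ‖mFourierCoeff (EuclideanSpace.complexify ∘ (fun y => u₁ τ y - u₂ τ y)) k‖ ^ 2)
      (-(8 * Real.pi ^ 2 * ν) * (∑' k : d → ℤ, freqNormSq k ^ (s + 1) *
            ‖mFourierCoeff (EuclideanSpace.complexify ∘ (fun y => u₁ t y - u₂ t y)) k‖ ^ 2) -
          2 * (∑' k : d → ℤ, freqNormSq k ^ s *
            (inner ℂ (mFourierCoeff (EuclideanSpace.complexify ∘
                Torus.convect (u₁ t) (fun y => u₁ t y - u₂ t y)) k)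
              (mFourierCoeff (EuclideanSpace.complexify ∘ (fun y => u₁ t y - u₂ t y)) k)).re) -
          2 * (∑' k : d → ℤ, freqNormSq k ^ s *
            (inner ℂ (mFourierCoeff (EuclideanSpace.complexify ∘
                Torus.convect (fun y => u₁ t y - u₂ t y) (u₂ t)) k)
              (mFourierCoeff (EuclideanSpace.complexify ∘ (fun y => u₁ t y - u₂ t y)) k)).re) +
          2 * (∑' k : d → ℤ, freqNormSq k ^ s *
            (inner ℂ (mFourierCoeff (EuclideanSpace.complexify ∘ (fun y => f₁ t y - f₂ t y)) k)
              (mFourierCoeff (EuclideanSpace.complexify ∘ (fun y => u₁ t y - u₂ t y)) k)).re)) t := by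
  classical
  have htS : t ∈ Icc a b := Ioo_subset_Icc_self ht
  have hw : Torus.IsSmoothSpaceTimeOn (Icc a b) (fun τ y => u₁ τ y - u₂ τ y) :=
    h₁.smooth_velocity.sub h₂.smooth_velocity
  have hu₁t : IsSmooth (u₁ t) := h₁.smooth_velocity.isSmooth_slice htS
  have hu₂t : IsSmooth (u₂ t) := h₂.smooth_velocity.isSmooth_slice htS
  have hwt : IsSmooth (fun y => u₁ t y - u₂ t y) := hu₁t.sub hu₂t
  have hft : IsSmooth (fun y => f₁ t y - f₂ t y) :=
    (h₁.isSmooth_force_slice hab htS).sub (h₂.isSmooth_force_slice hab htS)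
  have hc1 : IsSmooth (Torus.convect (u₁ t) (fun y => u₁ t y - u₂ t y)) := hu₁t.convect hwt
  have hc2 : IsSmooth (Torus.convect (fun y => u₁ t y - u₂ t y) (u₂ t)) := hwt.convect hu₂t
  obtain ⟨n, hn⟩ := exists_nat_gt (s + (Fintype.card d : ℝ))
  have hD := hasDerivAt_tsum_rpow_mul_norm_sq_of_lt n hab hw hs
    (by nlinarith [Nat.cast_nonneg (α := ℝ) (Fintype.card d), hs]) ht
  refine hD.congr_deriv ?_
  -- notation
  set c : (d → ℤ) → EuclideanSpace ℂ d :=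
    fun k => mFourierCoeff (EuclideanSpace.complexify ∘ (fun y => u₁ t y - u₂ t y)) k with hc
  set Q₁ : (d → ℤ) → ℝ := fun k => freqNormSq k ^ s *
    (inner ℂ (mFourierCoeff (EuclideanSpace.complexify ∘
      Torus.convect (u₁ t) (fun y => u₁ t y - u₂ t y)) k) (c k)).re with hQ₁
  set Q₂ : (d → ℤ) → ℝ := fun k => freqNormSq k ^ s *
    (inner ℂ (mFourierCoeff (EuclideanSpace.complexify ∘
      Torus.convect (fun y => u₁ t y - u₂ t y) (u₂ t)) k) (c k)).re with hQ₂
  set Q₃ : (d → ℤ) → ℝ := fun k => freqNormSq k ^ s *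
    (inner ℂ (mFourierCoeff (EuclideanSpace.complexify ∘ (fun y => f₁ t y - f₂ t y)) k) (c k)).re
    with hQ₃
  have hsumZ : Summable fun k => freqNormSq k ^ (s + 1) * ‖c k‖ ^ 2 :=
    hwt.summable_freqNormSq_rpow_mul_norm_sq (by linarith)
  have hQ₁s : Summable Q₁ := (summable_and_abs_tsum_rpow_mul_re_inner_le hc1 hwt hs.le).1
  have hQ₂s : Summable Q₂ := (summable_and_abs_tsum_rpow_mul_re_inner_le hc2 hwt hs.le).1
  have hQ₃s : Summable Q₃ := (summable_and_abs_tsum_rpow_mul_re_inner_le hft hwt hs.le).1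
  -- the modewise identity, weighted
  -- (the termwise-differentiation lemma is stated with the generic `FluidPDE.timeDerivWithin`,
  -- §2 with `Torus.timeDerivWithin`; the two agree by `rfl`)
  have hid : ∀ k, (inner ℂ (mFourierCoeff (EuclideanSpace.complexify ∘
      Literature.Analysis.FluidPDE.timeDerivWithin (Icc a b) (fun τ y => u₁ τ y - u₂ τ y) t) k)
        (c k)).re =
      -(ν * (4 * Real.pi ^ 2 * freqNormSq k)) * ‖c k‖ ^ 2 -
        ((inner ℂ (mFourierCoeff (EuclideanSpace.complexify ∘
              Torus.convect (u₁ t) (fun y => u₁ t y - u₂ t y)) k) (c k)).re +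
          (inner ℂ (mFourierCoeff (EuclideanSpace.complexify ∘
              Torus.convect (fun y => u₁ t y - u₂ t y) (u₂ t)) k) (c k)).re) +
        (inner ℂ (mFourierCoeff (EuclideanSpace.complexify ∘ (fun y => f₁ t y - f₂ t y)) k)
          (c k)).re :=
    fun k => re_inner_mFourierCoeff_timeDerivWithin_sub_two_forces h₁ h₂ hab htS k
  have hterm : ∀ k, freqNormSq k ^ s * (2 * (inner ℂ (mFourierCoeff (EuclideanSpace.complexify ∘
      Literature.Analysis.FluidPDE.timeDerivWithin (Icc a b) (fun τ y => u₁ τ y - u₂ τ y) t) k)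
        (c k)).re) =
      -(8 * Real.pi ^ 2 * ν) * (freqNormSq k ^ (s + 1) * ‖c k‖ ^ 2) - 2 * Q₁ k - 2 * Q₂ k +
        2 * Q₃ k := by
    intro k
    rw [hid k]
    simp only [hQ₁, hQ₂, hQ₃]
    have e : freqNormSq k ^ (s + 1) = freqNormSq k ^ s * freqNormSq k := by
      rw [Real.rpow_add' (freqNormSq_nonneg k) (by linarith : s + 1 ≠ 0), Real.rpow_one]
    rw [e]
    ring
  rw [tsum_congr hterm, ((((hsumZ.mul_left _).sub (hQ₁s.mul_left 2)).sub (hQ₂s.mul_left 2)).tsum_add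
      (hQ₃s.mul_left 2)), (((hsumZ.mul_left _).sub (hQ₁s.mul_left 2)).tsum_sub (hQ₂s.mul_left 2)),
    ((hsumZ.mul_left _).tsum_sub (hQ₁s.mul_left 2)), tsum_mul_left, tsum_mul_left, tsum_mul_left,
    tsum_mul_left]

omit [DecidableEq d] in
/-- The Fourier coefficients of `−g` are those of `g` negated. [folklore] -/
private theorem ci_mFourierCoeff_complexify_neg (g : UnitAddTorus d → EuclideanSpace ℝ d)
    (k : d → ℤ) :
    mFourierCoeff (EuclideanSpace.complexify ∘ (fun y => -g y)) k =
      -mFourierCoeff (EuclideanSpace.complexify ∘ g) k := by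
  rw [mFourierCoeff_eq_integral_volume, mFourierCoeff_eq_integral_volume, ← integral_neg]
  refine integral_congr_ae (Filter.Eventually.of_forall fun x => ?_)
  simp only [Function.comp_apply, map_neg, smul_neg]

omit [DecidableEq d] in
/-- `X_s ≤ X_{s+1}` for the lattice Sobolev sums (`|k|^{2s} ≤ |k|^{2s+2}` off the origin, the
origin carrying the weight `0` for `s > 0`). [folklore] -/
private theorem ci_tsum_rpow_le_tsum_rpow_succ {c : (d → ℤ) → EuclideanSpace ℂ d} {s : ℝ}
    (hs : 0 < s) (hZ : Summable fun k => freqNormSq k ^ (s + 1) * ‖c k‖ ^ 2) :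
    ∑' k, freqNormSq k ^ s * ‖c k‖ ^ 2 ≤ ∑' k, freqNormSq k ^ (s + 1) * ‖c k‖ ^ 2 := by
  have hle : ∀ k, freqNormSq k ^ s * ‖c k‖ ^ 2 ≤ freqNormSq k ^ (s + 1) * ‖c k‖ ^ 2 := by
    intro k
    refine mul_le_mul_of_nonneg_right ?_ (sq_nonneg _)
    by_cases hk : k = 0
    · rw [hk, freqNormSq_zero, Real.zero_rpow hs.ne', Real.zero_rpow (by linarith)]
    · exact Real.rpow_le_rpow_of_exponent_le (one_le_freqNormSq_of_ne_zero hk) (by linarith)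
  exact (hZ.of_nonneg_of_le (fun k => mul_nonneg (Real.rpow_nonneg (freqNormSq_nonneg k) _)
    (sq_nonneg _)) hle).tsum_le_tsum hle hZ

/-- **The `Ḣ^s` differential inequality for the difference of two classical solutions**
(Morosi–Pizzocchero 2015, Lemma 4.2, (4.5)–(4.8): the terms `⟨𝒫(u_a,w)|w⟩_n`, `⟨𝒫(w,u_a)|w⟩_n`,
`⟨𝒫(w,w)|w⟩_n`, `⟨e|w⟩_n` bounded by the Kato inequality, the basic inequality, the Kato
inequality and Schwarz), lattice form with the tree's constants: for classical solutions
`(u₁, p₁)` (force `f₁`), `(u₂, p₂)` (force `f₂`) on `[a, b] × T^{n₀}` with `div u₂ = 0` used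
through the solution notion, `s ≥ 1`, an interior `t`, and `w = u₁ − u₂`, the derivative `D` of
`X_w = ∑|k|^{2s}‖ŵ‖²` at `t` satisfies
`D ≤ −8π²ν Z_w + 4πn s2^s (X_{u₂}^{1/2} F₁(w) + F₁(u₂) X_w^{1/2}) X_w^{1/2} + 8πn s2^s F₁(w) X_w
   + 4πn 2^{s−1} (F₀(w) Z_{u₂}^{1/2} + F₁(u₂) X_w^{1/2}) X_w^{1/2} + 2 X_h^{1/2} X_w^{1/2}`,
`Z = ∑|k|^{2s+2}‖·̂‖²`, `F₀ = ∑‖·̂‖`, `F₁ = ∑|k|‖·̂‖`, `h = f₁ − f₂` (the advection by `u₁ = u₂ + w`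
is split, `(u₁·∇)w = (u₂·∇)w + (w·∇)w`: `NSSobolev.abs_tsum_rpow_mul_re_inner_convect_pair_le`,
`NSSobolev.abs_tsum_rpow_mul_re_inner_convect_le` (3.6),
`NSSobolev.abs_tsum_rpow_mul_re_inner_convect_transport_le`, §1).
[cite: MorosiPizzocchero2015, Lemma 4.2 (4.4)–(4.8); MorosiPizzocchero2012Kato, Abstract; RobinsonSadowskiSilva2012, §III (3.6)] -/
theorem exists_hasDerivAt_tsum_rpow_mul_norm_sq_sub_le
    (h₁ : Torus.IsClassicalNSSolutionOn (Icc a b) ν f₁ u₁ p₁)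
    (h₂ : Torus.IsClassicalNSSolutionOn (Icc a b) ν f₂ u₂ p₂) (hab : a < b) {s : ℝ} (hs : 1 ≤ s)
    {t : ℝ} (ht : t ∈ Ioo a b) :
    ∃ D : ℝ, HasDerivAt (fun τ => ∑' k : d → ℤ, freqNormSq k ^ s *
        ‖mFourierCoeff (EuclideanSpace.complexify ∘ (fun y => u₁ τ y - u₂ τ y)) k‖ ^ 2) D t ∧
      D ≤ -(8 * Real.pi ^ 2 * ν) * (∑' k : d → ℤ, freqNormSq k ^ (s + 1) *
            ‖mFourierCoeff (EuclideanSpace.complexify ∘ (fun y => u₁ t y - u₂ t y)) k‖ ^ 2) +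
        4 * Real.pi * (Fintype.card d : ℝ) * (s * (2 : ℝ) ^ s) *
          (Real.sqrt (∑' k : d → ℤ, freqNormSq k ^ s *
              ‖mFourierCoeff (EuclideanSpace.complexify ∘ u₂ t) k‖ ^ 2) *
            (∑' k : d → ℤ, Real.sqrt (freqNormSq k) *
              ‖mFourierCoeff (EuclideanSpace.complexify ∘ (fun y => u₁ t y - u₂ t y)) k‖) +
            (∑' k : d → ℤ, Real.sqrt (freqNormSq k) *
              ‖mFourierCoeff (EuclideanSpace.complexify ∘ u₂ t) k‖) *
            Real.sqrt (∑' k : d → ℤ, freqNormSq k ^ s *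
              ‖mFourierCoeff (EuclideanSpace.complexify ∘ (fun y => u₁ t y - u₂ t y)) k‖ ^ 2)) *
          Real.sqrt (∑' k : d → ℤ, freqNormSq k ^ s *
              ‖mFourierCoeff (EuclideanSpace.complexify ∘ (fun y => u₁ t y - u₂ t y)) k‖ ^ 2) +
        8 * Real.pi * (Fintype.card d : ℝ) * (s * (2 : ℝ) ^ s) *
          (∑' k : d → ℤ, Real.sqrt (freqNormSq k) *
              ‖mFourierCoeff (EuclideanSpace.complexify ∘ (fun y => u₁ t y - u₂ t y)) k‖) *
          (∑' k : d → ℤ, freqNormSq k ^ s *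
              ‖mFourierCoeff (EuclideanSpace.complexify ∘ (fun y => u₁ t y - u₂ t y)) k‖ ^ 2) +
        4 * Real.pi * (Fintype.card d : ℝ) * (2 : ℝ) ^ (s - 1) *
          ((∑' k : d → ℤ, ‖mFourierCoeff (EuclideanSpace.complexify ∘ (fun y => u₁ t y - u₂ t y)) k‖) *
            Real.sqrt (∑' k : d → ℤ, freqNormSq k ^ (s + 1) *
              ‖mFourierCoeff (EuclideanSpace.complexify ∘ u₂ t) k‖ ^ 2) +
            (∑' k : d → ℤ, Real.sqrt (freqNormSq k) *
              ‖mFourierCoeff (EuclideanSpace.complexify ∘ u₂ t) k‖) *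
            Real.sqrt (∑' k : d → ℤ, freqNormSq k ^ s *
              ‖mFourierCoeff (EuclideanSpace.complexify ∘ (fun y => u₁ t y - u₂ t y)) k‖ ^ 2)) *
          Real.sqrt (∑' k : d → ℤ, freqNormSq k ^ s *
              ‖mFourierCoeff (EuclideanSpace.complexify ∘ (fun y => u₁ t y - u₂ t y)) k‖ ^ 2) +
        2 * Real.sqrt (∑' k : d → ℤ, freqNormSq k ^ s *
              ‖mFourierCoeff (EuclideanSpace.complexify ∘ (fun y => f₁ t y - f₂ t y)) k‖ ^ 2) *
          Real.sqrt (∑' k : d → ℤ, freqNormSq k ^ s *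
              ‖mFourierCoeff (EuclideanSpace.complexify ∘ (fun y => u₁ t y - u₂ t y)) k‖ ^ 2) := by
  classical
  have hs0 : (0 : ℝ) < s := by linarith
  have htS : t ∈ Icc a b := Ioo_subset_Icc_self ht
  have hu₁t : IsSmooth (u₁ t) := h₁.smooth_velocity.isSmooth_slice htS
  have hu₂t : IsSmooth (u₂ t) := h₂.smooth_velocity.isSmooth_slice htS
  have hwt : IsSmooth (fun y => u₁ t y - u₂ t y) := hu₁t.sub hu₂t
  have hft : IsSmooth (fun y => f₁ t y - f₂ t y) :=
    (h₁.isSmooth_force_slice hab htS).sub (h₂.isSmooth_force_slice hab htS)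
  have hc1 : IsSmooth (Torus.convect (u₁ t) (fun y => u₁ t y - u₂ t y)) := hu₁t.convect hwt
  have hc2 : IsSmooth (Torus.convect (fun y => u₁ t y - u₂ t y) (u₂ t)) := hwt.convect hu₂t
  have hc3 : IsSmooth (Torus.convect (u₂ t) (fun y => u₁ t y - u₂ t y)) := hu₂t.convect hwt
  have hc4 : IsSmooth (Torus.convect (fun y => u₁ t y - u₂ t y) (fun y => u₁ t y - u₂ t y)) :=
    hwt.convect hwt
  have hdivw : IsDivFree (fun y => u₁ t y - u₂ t y) := by
    intro x
    have hw' : (fun y => u₁ t y - u₂ t y) = u₁ t - u₂ t := rfl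
    rw [hw', Torus.divergence_sub (hu₁t.isContDiff (by simp)) (hu₂t.isContDiff (by simp)),
      h₁.divFree t htS x, h₂.divFree t htS x, sub_zero]
  refine ⟨_, hasDerivAt_tsum_rpow_mul_norm_sq_sub_two_forces h₁ h₂ hab hs0 ht, ?_⟩
  -- notation
  set c : (d → ℤ) → EuclideanSpace ℂ d :=
    fun k => mFourierCoeff (EuclideanSpace.complexify ∘ (fun y => u₁ t y - u₂ t y)) k with hc
  set cV : (d → ℤ) → EuclideanSpace ℂ d :=
    fun k => mFourierCoeff (EuclideanSpace.complexify ∘ u₂ t) k with hcV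
  set X : ℝ := ∑' k, freqNormSq k ^ s * ‖c k‖ ^ 2 with hX
  set Z : ℝ := ∑' k, freqNormSq k ^ (s + 1) * ‖c k‖ ^ 2 with hZ
  set XV : ℝ := ∑' k, freqNormSq k ^ s * ‖cV k‖ ^ 2 with hXV
  set ZV : ℝ := ∑' k, freqNormSq k ^ (s + 1) * ‖cV k‖ ^ 2 with hZV
  set F₀ : ℝ := ∑' k, ‖c k‖ with hF₀
  set F₁ : ℝ := ∑' k, Real.sqrt (freqNormSq k) * ‖c k‖ with hF₁
  set F₁V : ℝ := ∑' k, Real.sqrt (freqNormSq k) * ‖cV k‖ with hF₁V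
  set Xh : ℝ := ∑' k, freqNormSq k ^ s *
    ‖mFourierCoeff (EuclideanSpace.complexify ∘ (fun y => f₁ t y - f₂ t y)) k‖ ^ 2 with hXh
  set Q₁ : (d → ℤ) → ℝ := fun k => freqNormSq k ^ s *
    (inner ℂ (mFourierCoeff (EuclideanSpace.complexify ∘
      Torus.convect (u₁ t) (fun y => u₁ t y - u₂ t y)) k) (c k)).re with hQ₁
  set Q₂ : (d → ℤ) → ℝ := fun k => freqNormSq k ^ s *
    (inner ℂ (mFourierCoeff (EuclideanSpace.complexify ∘
      Torus.convect (fun y => u₁ t y - u₂ t y) (u₂ t)) k) (c k)).re with hQ₂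
  set Q₃ : (d → ℤ) → ℝ := fun k => freqNormSq k ^ s *
    (inner ℂ (mFourierCoeff (EuclideanSpace.complexify ∘ (fun y => f₁ t y - f₂ t y)) k) (c k)).re
    with hQ₃
  set Qa : (d → ℤ) → ℝ := fun k => freqNormSq k ^ s *
    (inner ℂ (mFourierCoeff (EuclideanSpace.complexify ∘
      Torus.convect (u₂ t) (fun y => u₁ t y - u₂ t y)) k) (c k)).re with hQa
  set Qb : (d → ℤ) → ℝ := fun k => freqNormSq k ^ s *
    (inner ℂ (mFourierCoeff (EuclideanSpace.complexify ∘
      Torus.convect (fun y => u₁ t y - u₂ t y) (fun y => u₁ t y - u₂ t y)) k) (c k)).re with hQb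
  show -(8 * Real.pi ^ 2 * ν) * Z - 2 * (∑' k, Q₁ k) - 2 * (∑' k, Q₂ k) + 2 * (∑' k, Q₃ k) ≤
    -(8 * Real.pi ^ 2 * ν) * Z +
      4 * Real.pi * (Fintype.card d : ℝ) * (s * (2 : ℝ) ^ s) * (Real.sqrt XV * F₁ + F₁V * Real.sqrt X) *
        Real.sqrt X +
      8 * Real.pi * (Fintype.card d : ℝ) * (s * (2 : ℝ) ^ s) * F₁ * X +
      4 * Real.pi * (Fintype.card d : ℝ) * (2 : ℝ) ^ (s - 1) * (F₀ * Real.sqrt ZV + F₁V * Real.sqrt X) *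
        Real.sqrt X +
      2 * Real.sqrt Xh * Real.sqrt X
  -- ### the advection split `(u₁·∇)w = (u₂·∇)w + (w·∇)w`
  have hQas : Summable Qa := (summable_and_abs_tsum_rpow_mul_re_inner_le hc3 hwt hs0.le).1
  have hQbs : Summable Qb := (summable_and_abs_tsum_rpow_mul_re_inner_le hc4 hwt hs0.le).1
  have hsplit_fun : Torus.convect (u₁ t) (fun y => u₁ t y - u₂ t y) =
      fun x => Torus.convect (u₂ t) (fun y => u₁ t y - u₂ t y) x +
        Torus.convect (fun y => u₁ t y - u₂ t y) (fun y => u₁ t y - u₂ t y) x := by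
    funext x
    have hu : u₁ t = fun y => u₂ t y + (u₁ t y - u₂ t y) := by
      funext y; simp
    conv_lhs => rw [hu]
    simp [Torus.convect]
  have hQ₁eq : ∀ k, Q₁ k = Qa k + Qb k := by
    intro k
    simp only [hQ₁, hQa, hQb]
    rw [hsplit_fun]
    have hi3 : Integrable (EuclideanSpace.complexify ∘
        Torus.convect (u₂ t) (fun y => u₁ t y - u₂ t y)) volume :=
      integrable_complexify_comp hc3.integrable
    have hi4 : Integrable (EuclideanSpace.complexify ∘
        Torus.convect (fun y => u₁ t y - u₂ t y) (fun y => u₁ t y - u₂ t y)) volume :=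
      integrable_complexify_comp hc4.integrable
    have hcomp : (EuclideanSpace.complexify ∘ fun x =>
        Torus.convect (u₂ t) (fun y => u₁ t y - u₂ t y) x +
          Torus.convect (fun y => u₁ t y - u₂ t y) (fun y => u₁ t y - u₂ t y) x) =
        (EuclideanSpace.complexify ∘ Torus.convect (u₂ t) (fun y => u₁ t y - u₂ t y)) +
          (EuclideanSpace.complexify ∘
            Torus.convect (fun y => u₁ t y - u₂ t y) (fun y => u₁ t y - u₂ t y)) := by
      funext x
      simp only [Function.comp_apply, Pi.add_apply, map_add]
    rw [hcomp, mFourierCoeff_add hi3 hi4, inner_add_left, Complex.add_re, mul_add]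
  have hQ₁sum : ∑' k, Q₁ k = ∑' k, Qa k + ∑' k, Qb k := by
    rw [tsum_congr hQ₁eq, hQas.tsum_add hQbs]
  -- ### the four estimates
  have hKato : |∑' k, Qa k| ≤ 2 * Real.pi * (Fintype.card d : ℝ) * (s * (2 : ℝ) ^ s) *
      (Real.sqrt XV * F₁ + F₁V * Real.sqrt X) * Real.sqrt X :=
    abs_tsum_rpow_mul_re_inner_convect_pair_le hu₂t (h₂.divFree t htS) hwt hs
  have h36 : |∑' k, Qb k| ≤ 4 * Real.pi * (Fintype.card d : ℝ) * (s * (2 : ℝ) ^ s) * X * F₁ :=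
    abs_tsum_rpow_mul_re_inner_convect_le hwt hdivw hs
  have hTr : |∑' k, Q₂ k| ≤ 2 * Real.pi * (Fintype.card d : ℝ) * (2 : ℝ) ^ (s - 1) *
      (F₀ * Real.sqrt ZV + F₁V * Real.sqrt X) * Real.sqrt X :=
    abs_tsum_rpow_mul_re_inner_convect_transport_le hwt hu₂t hs
  have hFo : |∑' k, Q₃ k| ≤ Real.sqrt Xh * Real.sqrt X :=
    (summable_and_abs_tsum_rpow_mul_re_inner_le hft hwt hs0.le).2
  rw [hQ₁sum]
  have e1 := neg_abs_le (∑' k, Qa k)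
  have e2 := neg_abs_le (∑' k, Qb k)
  have e3 := neg_abs_le (∑' k, Q₂ k)
  have e4 := le_abs_self (∑' k, Q₃ k)
  nlinarith [hKato, h36, hTr, hFo, e1, e2, e3, e4]

end Difference

end NSSobolev

/-! ### §4 Comparison: a supersolution of the control inequality dominates `‖w‖_{Ḣ^s}` -/

set_option maxHeartbeats 400000 in
-- (one long but elementary real-variable argument; two fencing applications and a limit)
/-- **The comparison step of Morosi–Pizzocchero's control inequality** ("the inequalities (4.11),
(4.12) for `‖u − u_a‖_n` have the same structure as the control inequalities (4.9), (4.10) for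
`R_n`, with the reverse order relations; now, a standard comparison theorem à la
Čaplygin–Lakshmikantham gives `‖u(t) − u_a(t)‖_n ≤ R_n(t)`", proof of Prop. 4.4(i)), in the form
used here: `X ≥ 0` is continuous on `[0, T]`, differentiable on `(0, T)` with
`X' ≤ 2√X(−λ√X + γ√X + G X + ε)` (`G ≥ 0`, `ε ≥ 0`, `γ` bounded above), and `R` is continuous
on `[0, T]` with right derivatives `R' ≥ −λR + γR + GR² + ε` on `[0, T)` and `R(0) ≥ √X(0)`.
Then `√X ≤ R` on `[0, T]`. Proof: `R_δ = R + δe^{μt}` (`μ` large, `δ` small) is positive and a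
STRICT supersolution, so the fencing lemma `image_le_of_deriv_right_lt_deriv_boundary'` gives
`X ≤ R_δ²` (on `[a', T]` for small `a' > 0`, where `X < R_δ²` near `0`); let `δ → 0⁺`.
[cite: MorosiPizzocchero2015, Prop. 4.4 (i) (proof, comparison step)] -/
theorem sqrt_le_of_control_inequality {X X' R R' γ ε : ℝ → ℝ} {T lam G : ℝ} (hT : 0 < T)
    (hG : 0 ≤ G) (hXc : ContinuousOn X (Icc 0 T)) (hXd : ∀ t ∈ Ioo 0 T, HasDerivAt X (X' t) t)
    (hX0 : ∀ t ∈ Icc 0 T, 0 ≤ X t)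
    (hXle : ∀ t ∈ Ioo 0 T, X' t ≤ 2 * Real.sqrt (X t) *
      (-lam * Real.sqrt (X t) + γ t * Real.sqrt (X t) + G * X t + ε t))
    (hRc : ContinuousOn R (Icc 0 T)) (hRd : ∀ t ∈ Ico 0 T, HasDerivWithinAt R (R' t) (Ici t) t)
    (hRge : ∀ t ∈ Ico 0 T, -lam * R t + γ t * R t + G * R t ^ 2 + ε t ≤ R' t)
    (hε : ∀ t ∈ Ico 0 T, 0 ≤ ε t) (hγ : ∃ Γ, ∀ t ∈ Ico 0 T, γ t ≤ Γ)
    (h0 : Real.sqrt (X 0) ≤ R 0) :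
    ∀ t ∈ Icc 0 T, Real.sqrt (X t) ≤ R t := by
  obtain ⟨Γ, hΓ⟩ := hγ
  -- `R` is bounded above on `[0, T]`
  obtain ⟨M, hM⟩ : ∃ M, ∀ t ∈ Icc 0 T, R t ≤ M := by
    obtain ⟨M, hM⟩ := isCompact_Icc.bddAbove_image hRc
    exact ⟨M, fun t ht => hM (mem_image_of_mem R ht)⟩
  set μ : ℝ := |lam| + |Γ| + 2 * G * |M| + G + 1 with hμ
  have hμ0 : 0 < μ := by rw [hμ]; positivity
  have hkey : ∀ x ∈ Ico 0 T, ∀ θ : ℝ, 0 ≤ θ → θ ≤ 1 → -lam + γ x + G * (2 * R x + θ) < μ := by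
    intro x hx θ hθ0 hθ1
    have h1 : -lam ≤ |lam| := neg_le_abs lam
    have h2 : γ x ≤ |Γ| := (hΓ x hx).trans (le_abs_self Γ)
    have h3 : G * (2 * R x) ≤ 2 * G * |M| := by
      have : R x ≤ |M| := (hM x (Ico_subset_Icc_self hx)).trans (le_abs_self M)
      nlinarith
    have h4 : G * θ ≤ G := by nlinarith
    rw [hμ]
    nlinarith
  have hexp_d : ∀ x : ℝ, HasDerivAt (fun y => Real.exp (μ * y)) (μ * Real.exp (μ * x)) x := by
    intro x
    have h := (hasDerivAt_id x).const_mul μ |>.exp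
    simp only [mul_one, id] at h
    convert h using 1
    ring
  -- ### Claim A: every `R + δe^{μt}`, `δ > 0`, is nonnegative on `[0, T]`
  have hA : ∀ δ : ℝ, 0 < δ → ∀ t ∈ Icc 0 T, 0 ≤ R t + δ * Real.exp (μ * t) := by
    intro δ hδ
    have hfc : ContinuousOn (fun t => -(R t + δ * Real.exp (μ * t))) (Icc 0 T) :=
      (hRc.add (continuousOn_const.mul
        ((Real.continuous_exp.comp (continuous_const.mul continuous_id)).continuousOn))).neg
    have hf' : ∀ x ∈ Ico 0 T, HasDerivWithinAt (fun t => -(R t + δ * Real.exp (μ * t)))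
        (-(R' x + δ * (μ * Real.exp (μ * x)))) (Ici x) x := fun x hx =>
      ((hRd x hx).add ((hexp_d x).hasDerivWithinAt.const_mul δ)).neg
    have hfence := image_le_of_deriv_right_lt_deriv_boundary' hfc hf'
      (B := fun _ => (0 : ℝ)) (B' := fun _ => (0 : ℝ)) ?_ continuousOn_const
      (fun x _ => hasDerivWithinAt_const x (Ici x) (0 : ℝ)) ?_
    · intro t ht
      have h : -(R t + δ * Real.exp (μ * t)) ≤ 0 := hfence ht
      linarith
    · -- `f 0 ≤ 0`
      have hR0 : 0 ≤ R 0 := (Real.sqrt_nonneg _).trans h0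
      show -(R 0 + δ * Real.exp (μ * 0)) ≤ 0
      rw [mul_zero, Real.exp_zero, mul_one]
      linarith
    · -- strictness at a contact: `R x = -δe^{μx}` forces `R'(x) + δμe^{μx} > 0`
      intro x hx hfx
      have hfx' : -(R x + δ * Real.exp (μ * x)) = 0 := hfx
      have hRx : R x = -(δ * Real.exp (μ * x)) := by linarith
      have he0 : 0 < δ * Real.exp (μ * x) := mul_pos hδ (Real.exp_pos _)
      have h1 := hRge x hx
      have h2 : γ x ≤ |Γ| := (hΓ x hx).trans (le_abs_self Γ)
      have h3 : -|lam| ≤ lam := neg_abs_le lam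
      have h4 : 0 ≤ G * R x ^ 2 := mul_nonneg hG (sq_nonneg _)
      have h5 := hε x hx
      have h6 : (μ + lam - γ x) * (δ * Real.exp (μ * x)) ≥ 1 * (δ * Real.exp (μ * x)) := by
        apply mul_le_mul_of_nonneg_right _ he0.le
        rw [hμ]
        nlinarith [abs_nonneg M]
      show -(R' x + δ * (μ * Real.exp (μ * x))) < 0
      rw [hRx] at h1
      nlinarith
  have hexp_c : Continuous fun y : ℝ => Real.exp (μ * y) :=
    Real.continuous_exp.comp (continuous_const.mul continuous_id)
  -- ### Claim B: for `0 < δ ≤ e^{-μT}`, `X ≤ (R + δe^{μt})²` on `[0, T]`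
  have hB : ∀ δ : ℝ, 0 < δ → δ * Real.exp (μ * T) ≤ 1 →
      ∀ t ∈ Icc 0 T, X t ≤ (R t + δ * Real.exp (μ * t)) ^ 2 := by
    intro δ hδ hδ1 t ht
    set Rδ : ℝ → ℝ := fun x => R x + δ * Real.exp (μ * x) with hRδ
    have hRδpos : ∀ x ∈ Icc 0 T, 0 < Rδ x := by
      intro x hx
      have h := hA (δ / 2) (by positivity) x hx
      have he : 0 < δ / 2 * Real.exp (μ * x) := by positivity
      show 0 < R x + δ * Real.exp (μ * x)
      linarith
    have hRδc : ContinuousOn Rδ (Icc 0 T) := hRc.add (continuousOn_const.mul hexp_c.continuousOn)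
    have hRδd : ∀ x ∈ Ico 0 T,
        HasDerivWithinAt Rδ (R' x + δ * (μ * Real.exp (μ * x))) (Ici x) x := fun x hx =>
      (hRd x hx).add ((hexp_d x).hasDerivWithinAt.const_mul δ)
    -- `Rδ` is a strict supersolution
    have hstrict : ∀ x ∈ Ico 0 T, -lam * Rδ x + γ x * Rδ x + G * Rδ x ^ 2 + ε x <
        R' x + δ * (μ * Real.exp (μ * x)) := by
      intro x hx
      set θ : ℝ := δ * Real.exp (μ * x) with hθ
      have hθ0 : 0 < θ := by positivity
      have hθ1 : θ ≤ 1 := by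
        refine le_trans ?_ hδ1
        exact mul_le_mul_of_nonneg_left (Real.exp_le_exp.2
          (mul_le_mul_of_nonneg_left hx.2.le hμ0.le)) hδ.le
      have hk := hkey x hx θ hθ0.le hθ1
      have h1 := hRge x hx
      have e : -lam * Rδ x + γ x * Rδ x + G * Rδ x ^ 2 + ε x =
          (-lam * R x + γ x * R x + G * R x ^ 2 + ε x) +
            θ * (-lam + γ x + G * (2 * R x + θ)) := by
        simp only [hRδ, hθ]
        ring
      rw [e, show δ * (μ * Real.exp (μ * x)) = θ * μ by rw [hθ]; ring]
      nlinarith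
    rcases eq_or_lt_of_le ht.1 with h0t | h0t
    · -- `t = 0`
      rw [← h0t]
      have h1 : Real.sqrt (X 0) ≤ R 0 + δ * Real.exp (μ * 0) := by
        rw [mul_zero, Real.exp_zero, mul_one]; linarith
      calc X 0 = Real.sqrt (X 0) ^ 2 := (Real.sq_sqrt (hX0 0 (left_mem_Icc.2 hT.le))).symm
        _ ≤ (R 0 + δ * Real.exp (μ * 0)) ^ 2 :=
            pow_le_pow_left₀ (Real.sqrt_nonneg _) h1 2
    · -- `X < Rδ²` near `0`, within `[0, T]`
      have h0I : (0 : ℝ) ∈ Icc 0 T := left_mem_Icc.2 hT.le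
      have hg0 : 0 < Rδ 0 * Rδ 0 - X 0 := by
        have h1 : Real.sqrt (X 0) < Rδ 0 := by
          show Real.sqrt (X 0) < R 0 + δ * Real.exp (μ * 0)
          rw [mul_zero, Real.exp_zero, mul_one]; linarith
        have h2 : X 0 < Rδ 0 * Rδ 0 := by
          have := Real.sqrt_nonneg (X 0)
          calc X 0 = Real.sqrt (X 0) * Real.sqrt (X 0) := (Real.mul_self_sqrt (hX0 0 h0I)).symm
            _ < Rδ 0 * Rδ 0 := mul_self_lt_mul_self this h1
        linarith
      have hgc : ContinuousWithinAt (fun x => Rδ x * Rδ x - X x) (Icc 0 T) 0 :=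
        ((hRδc.mul hRδc).sub hXc).continuousWithinAt h0I
      have hev : ∀ᶠ x in 𝓝[Icc 0 T] 0, 0 < Rδ x * Rδ x - X x :=
        hgc.eventually (Ioi_mem_nhds hg0)
      rw [nhdsWithin_Icc_eq_nhdsGE hT] at hev
      obtain ⟨a₁, ha₁, hsub⟩ := mem_nhdsGE_iff_exists_Ico_subset.1 hev
      have ha₁0 : 0 < a₁ := ha₁
      set a' : ℝ := min a₁ t / 2 with ha'
      have ha'0 : 0 < a' := by rw [ha']; exact half_pos (lt_min ha₁0 h0t)
      have ha'1 : a' < a₁ := by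
        rw [ha']; linarith [min_le_left a₁ t, lt_min ha₁0 h0t]
      have ha't : a' < t := by
        rw [ha']; linarith [min_le_right a₁ t, lt_min ha₁0 h0t]
      have ha'T : a' ≤ T := ha't.le.trans ht.2
      have hXa' : X a' ≤ Rδ a' * Rδ a' := by
        have h := hsub ⟨ha'0.le, ha'1⟩
        simp only [mem_setOf_eq] at h
        linarith
      -- the fencing lemma on `[a', T]`
      have hfence := image_le_of_deriv_right_lt_deriv_boundary' (f := X) (f' := X') (a := a') (b := T)
        (hXc.mono (Icc_subset_Icc ha'0.le le_rfl))
        (fun x hx => (hXd x ⟨ha'0.trans_le hx.1, hx.2⟩).hasDerivWithinAt)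
        (B := fun x => Rδ x * Rδ x)
        (B' := fun x => (R' x + δ * (μ * Real.exp (μ * x))) * Rδ x +
          Rδ x * (R' x + δ * (μ * Real.exp (μ * x)))) hXa'
        ((hRδc.mul hRδc).mono (Icc_subset_Icc ha'0.le le_rfl))
        (fun x hx => (hRδd x ⟨ha'0.le.trans hx.1, hx.2⟩).mul (hRδd x ⟨ha'0.le.trans hx.1, hx.2⟩)) ?_
      · have h := hfence ⟨ha't.le, ht.2⟩
        calc X t ≤ Rδ t * Rδ t := h
          _ = (R t + δ * Real.exp (μ * t)) ^ 2 := by rw [hRδ]; ring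
      · intro x hx hcontact
        have hxI : x ∈ Icc 0 T := ⟨ha'0.le.trans hx.1, hx.2.le⟩
        have hxo : x ∈ Ioo 0 T := ⟨ha'0.trans_le hx.1, hx.2⟩
        have hxc : x ∈ Ico 0 T := ⟨ha'0.le.trans hx.1, hx.2⟩
        have hpos := hRδpos x hxI
        have hsq : Real.sqrt (X x) = Rδ x := by
          rw [hcontact]; exact Real.sqrt_mul_self hpos.le
        have h1 := hXle x hxo
        rw [hsq, hcontact] at h1
        have h2 := hstrict x hxc
        have h3 : 2 * Rδ x * (-lam * Rδ x + γ x * Rδ x + G * (Rδ x * Rδ x) + ε x) <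
            2 * Rδ x * (R' x + δ * (μ * Real.exp (μ * x))) := by
          refine mul_lt_mul_of_pos_left ?_ (by positivity)
          rw [← sq]; exact h2
        calc X' x ≤ 2 * Rδ x * (-lam * Rδ x + γ x * Rδ x + G * (Rδ x * Rδ x) + ε x) := h1
          _ < 2 * Rδ x * (R' x + δ * (μ * Real.exp (μ * x))) := h3
          _ = (R' x + δ * (μ * Real.exp (μ * x))) * Rδ x +
                Rδ x * (R' x + δ * (μ * Real.exp (μ * x))) := by ring
  -- ### let `δ → 0⁺`
  intro t ht
  have hev : ∀ᶠ δ in 𝓝[>] (0 : ℝ), 0 < δ ∧ δ * Real.exp (μ * T) ≤ 1 := by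
    have hopen : {δ : ℝ | δ < Real.exp (-(μ * T))} ∈ 𝓝 (0 : ℝ) :=
      (isOpen_gt' _).mem_nhds (by simpa using Real.exp_pos (-(μ * T)))
    filter_upwards [mem_nhdsWithin_of_mem_nhds hopen, self_mem_nhdsWithin] with δ h1 h2
    refine ⟨h2, ?_⟩
    have h3 : δ * Real.exp (μ * T) < Real.exp (-(μ * T)) * Real.exp (μ * T) :=
      mul_lt_mul_of_pos_right h1 (Real.exp_pos _)
    rw [← Real.exp_add, neg_add_cancel, Real.exp_zero] at h3
    exact h3.le
  have hlin : Tendsto (fun δ : ℝ => R t + δ * Real.exp (μ * t)) (𝓝 0) (𝓝 (R t)) := by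
    have h := (tendsto_const_nhds (x := R t) (f := (𝓝 (0 : ℝ)))).add
      ((tendsto_id (x := 𝓝 (0 : ℝ))).mul (tendsto_const_nhds (x := Real.exp (μ * t))))
    rw [zero_mul, add_zero] at h
    exact h
  have hRt : 0 ≤ R t := by
    have htend : Tendsto (fun δ : ℝ => R t + δ * Real.exp (μ * t)) (𝓝[>] 0) (𝓝 (R t)) :=
      hlin.mono_left nhdsWithin_le_nhds
    refine ge_of_tendsto htend ?_
    filter_upwards [hev] with δ hδ
    exact hA δ hδ.1 t ht
  have hXt : X t ≤ R t ^ 2 := by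
    have htend : Tendsto (fun δ : ℝ => (R t + δ * Real.exp (μ * t)) ^ 2) (𝓝[>] 0)
        (𝓝 (R t ^ 2)) := (hlin.pow 2).mono_left nhdsWithin_le_nhds
    refine ge_of_tendsto htend ?_
    filter_upwards [hev] with δ hδ
    exact hB δ hδ.1 hδ.2 t ht
  calc Real.sqrt (X t) ≤ Real.sqrt (R t ^ 2) := Real.sqrt_le_sqrt hXt
    _ = R t := Real.sqrt_sq hRt

/-! ### §5 Existence and control of the exact solution from an approximate one, in `Ḣ^s` -/

section Main

open Literature.Analysis.FunctionSpaces Literature.Analysis.FunctionSpaces.Torus NSSobolev NSGevrey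

variable {d : Type*} [Fintype d] [DecidableEq d]

/-- `‖∇u‖₂² ≤ 4π² ∑|k|^{2s}‖û(k)‖²` for smooth `u` and `s ≥ 1` (`|k|² ≤ |k|^{2s}` off the zero
mode; as in `TorusNSSobolevHighRange`). [folklore] -/
private theorem ci_gradNormSq_le_tsum_rpow {u : UnitAddTorus d → EuclideanSpace ℝ d}
    (hu : Torus.IsSmooth u) {s : ℝ} (hs : 1 ≤ s) :
    Torus.gradNormSq u ≤ 4 * Real.pi ^ 2 * ∑' k : d → ℤ, freqNormSq k ^ s *
      ‖mFourierCoeff (EuclideanSpace.complexify ∘ u) k‖ ^ 2 := by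
  classical
  have hG := hasSum_freqNormSq_mul_norm_sq_mFourierCoeff hu
  have hXs := hu.summable_freqNormSq_rpow_mul_norm_sq (by linarith : (0 : ℝ) ≤ s)
  rw [← hG.tsum_eq, ← tsum_mul_left]
  refine Summable.tsum_le_tsum (fun k => ?_) hG.summable (hXs.mul_left _)
  rw [← mul_assoc]
  refine mul_le_mul_of_nonneg_right (mul_le_mul_of_nonneg_left ?_ (by positivity)) (sq_nonneg _)
  by_cases hk : k = 0
  · rw [hk, freqNormSq_zero, Real.zero_rpow (by linarith)]
  · calc freqNormSq k = freqNormSq k ^ (1 : ℝ) := (Real.rpow_one _).symm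
      _ ≤ freqNormSq k ^ s :=
          Real.rpow_le_rpow_of_exponent_le (one_le_freqNormSq_of_ne_zero hk) hs

/-- **A posteriori existence and control in `Ḣ^s` from an approximate solution: the
Morosi–Pizzocchero control inequality (Nonlinear Anal. 113 (2015), Prop. 4.4 (i)), classical
torus form with the tree's constants.** MP Prop. 4.4: "Consider a real `n > d/2 + 1`, and assume
there is a function `R_n ∈ C([0,T_c), ℝ)` fulfilling the control inequalities
`d⁺R_n/dt ≥ −νR_n + (G_n𝒟_n + K_n𝒟_{n+1})R_n + G_nR_n² + ε_n`, `R_n(0) ≥ δ_n`. Then (i) the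
maximal solution `u` of the NS Cauchy problem and its time of existence `T` are such that
`T ≥ T_c`, `‖u(t) − u_a(t)‖_n ≤ R_n(t)` for `t ∈ [0,T_c)`" — `u_a` an approximate solution with
differential error `e(u_a) = du_a/dt − νΔu_a − 𝒫(u_a,u_a) − f`, `‖e(u_a)(t)‖_n ≤ ε_n(t)`,
`‖u_a(t)‖_n ≤ 𝒟_n(t)`, `‖u_a(t)‖_{n+1} ≤ 𝒟_{n+1}(t)`, `‖u_a(0) − u₀‖_n ≤ δ_n` (Def. 4.1).
Here, on the unit torus `T^d` with `card d = 3`, `ν > 0`, a closed window `[0, T]`, zero external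
force and `‖·‖_s = (∑|k|^{2s}‖·̂(k)‖²)^{1/2}` (`|k|² = freqNormSq k`): the approximate solution
is a classical mean-zero solution `(v, q)` of the equations WITH force `g` (its residual; cf.
`IsSmoothSpaceTimeOn.isClassicalNSSolutionOn_residual`), with continuous estimators
`‖v(t)‖_s ≤ D₀(t)`, `‖v(t)‖_{s+1} ≤ D₁(t)` and `‖g(t)‖_s ≤ E(t)`; `s ≥ 1` and `C₀, C₁ ≥ 0` are
constants of the embeddings `∑‖ŵ(k)‖ ≤ C₀‖w‖_s`, `∑|k|‖ŵ(k)‖ ≤ C₁‖w‖_s` on smooth mean-zero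
fields (available for `s > d/2 + 1`, `NSSobolev.tsum_rpow_mul_norm_le_latticeConst_mul_sqrt`);
the control function `R` is continuous on `[0, T]` with right derivatives
`R' ≥ −4π²ν R + γ R + G R² + E` on `[0, T)`, where
`γ = 4πn s2^s C₁ D₀ + 2πn 2^{s−1}(C₀D₁ + C₁D₀)`, `G = 4πn s2^s C₁` (`n = card d`), and
`R(0) ≥ ‖u₀ − v(0)‖_s`. Conclusion: the classical mean-zero solution `u` of the unforced
equations from `u₀` exists on `[0, T] × T^d` and `‖u(t) − v(t)‖_s ≤ R(t)` on `[0, T]`. Proof as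
printed: Lemma 4.2 (§3) + comparison (§4) along the maximal solution
(`Torus.exists_maximal_classicalNS`), whose `‖∇u‖₂² ≤ 2‖∇v‖₂² + 8π²R²` cannot blow up before
`T`. [cite: MorosiPizzocchero2015, Prop. 4.4 (i) with Def. 4.1 and Lemma 4.2; MorosiPizzocchero2012Approx, Prop. 4.3 (the `H^n`-framework)] -/
theorem Torus.classicalNS_regular_of_sobolev_control (hd : Fintype.card d = 3) {ν : ℝ}
    (hν : 0 < ν) {T : ℝ} (hT : 0 < T) {s : ℝ} (hs : 1 ≤ s) {C₀ C₁ : ℝ} (hC₀0 : 0 ≤ C₀)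
    (hC₁0 : 0 ≤ C₁)
    (hC₀ : ∀ w : UnitAddTorus d → EuclideanSpace ℝ d, Torus.IsSmooth w → Torus.HasZeroMean w →
      ∑' k : d → ℤ, ‖mFourierCoeff (EuclideanSpace.complexify ∘ w) k‖ ≤
        C₀ * Real.sqrt (∑' k : d → ℤ, freqNormSq k ^ s *
          ‖mFourierCoeff (EuclideanSpace.complexify ∘ w) k‖ ^ 2))
    (hC₁ : ∀ w : UnitAddTorus d → EuclideanSpace ℝ d, Torus.IsSmooth w → Torus.HasZeroMean w →
      ∑' k : d → ℤ, Real.sqrt (freqNormSq k) * ‖mFourierCoeff (EuclideanSpace.complexify ∘ w) k‖ ≤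
        C₁ * Real.sqrt (∑' k : d → ℤ, freqNormSq k ^ s *
          ‖mFourierCoeff (EuclideanSpace.complexify ∘ w) k‖ ^ 2))
    {v g : ℝ → UnitAddTorus d → EuclideanSpace ℝ d} {q : ℝ → UnitAddTorus d → ℝ}
    (hv : Torus.IsClassicalNSSolutionOn (Icc 0 T) ν g v q)
    (hmv : ∀ t ∈ Icc 0 T, Torus.HasZeroMean (v t))
    {D₀ D₁ E : ℝ → ℝ} (hD₀c : ContinuousOn D₀ (Icc 0 T)) (hD₁c : ContinuousOn D₁ (Icc 0 T))
    (hD₀ : ∀ t ∈ Icc 0 T, Real.sqrt (∑' k : d → ℤ, freqNormSq k ^ s *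
      ‖mFourierCoeff (EuclideanSpace.complexify ∘ v t) k‖ ^ 2) ≤ D₀ t)
    (hD₁ : ∀ t ∈ Icc 0 T, Real.sqrt (∑' k : d → ℤ, freqNormSq k ^ (s + 1) *
      ‖mFourierCoeff (EuclideanSpace.complexify ∘ v t) k‖ ^ 2) ≤ D₁ t)
    (hE : ∀ t ∈ Icc 0 T, Real.sqrt (∑' k : d → ℤ, freqNormSq k ^ s *
      ‖mFourierCoeff (EuclideanSpace.complexify ∘ g t) k‖ ^ 2) ≤ E t)
    {u₀ : UnitAddTorus d → EuclideanSpace ℝ d} (hu₀ : Torus.IsSmooth u₀)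
    (hdiv : Torus.IsDivFree u₀) (hmean : Torus.HasZeroMean u₀)
    {R R' : ℝ → ℝ} (hRc : ContinuousOn R (Icc 0 T))
    (hRd : ∀ t ∈ Ico 0 T, HasDerivWithinAt R (R' t) (Ici t) t)
    (hRge : ∀ t ∈ Ico 0 T,
      -(4 * Real.pi ^ 2 * ν) * R t +
        (4 * Real.pi * (Fintype.card d : ℝ) * (s * (2 : ℝ) ^ s) * C₁ * D₀ t +
          2 * Real.pi * (Fintype.card d : ℝ) * (2 : ℝ) ^ (s - 1) * (C₀ * D₁ t + C₁ * D₀ t)) * R t +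
        4 * Real.pi * (Fintype.card d : ℝ) * (s * (2 : ℝ) ^ s) * C₁ * R t ^ 2 + E t ≤ R' t)
    (hR0 : Real.sqrt (∑' k : d → ℤ, freqNormSq k ^ s *
      ‖mFourierCoeff (EuclideanSpace.complexify ∘ (fun y => u₀ y - v 0 y)) k‖ ^ 2) ≤ R 0) :
    ∃ (u : ℝ → UnitAddTorus d → EuclideanSpace ℝ d) (p : ℝ → UnitAddTorus d → ℝ),
      Torus.IsClassicalNSSolutionOn (Icc 0 T) ν 0 u p ∧ u 0 = u₀ ∧
      (∀ t ∈ Icc 0 T, Torus.HasZeroMean (u t)) ∧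
      ∀ t ∈ Icc 0 T, Real.sqrt (∑' k : d → ℤ, freqNormSq k ^ s *
        ‖mFourierCoeff (EuclideanSpace.complexify ∘ (fun y => u t y - v t y)) k‖ ^ 2) ≤ R t := by
  classical
  have hs0 : (0 : ℝ) < s := by linarith
  set nn : ℝ := (Fintype.card d : ℝ) with hnn
  set G : ℝ := 4 * Real.pi * nn * (s * (2 : ℝ) ^ s) * C₁ with hG
  have hG0 : 0 ≤ G := by rw [hG]; positivity
  set γ : ℝ → ℝ := fun t => 4 * Real.pi * nn * (s * (2 : ℝ) ^ s) * C₁ * D₀ t +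
    2 * Real.pi * nn * (2 : ℝ) ^ (s - 1) * (C₀ * D₁ t + C₁ * D₀ t) with hγ
  have h0T : (0 : ℝ) ∈ Icc 0 T := left_mem_Icc.2 hT.le
  -- bounds for the estimators on `[0, T]`
  have hD₀nn : ∀ t ∈ Icc 0 T, 0 ≤ D₀ t := fun t ht => (Real.sqrt_nonneg _).trans (hD₀ t ht)
  have hD₁nn : ∀ t ∈ Icc 0 T, 0 ≤ D₁ t := fun t ht => (Real.sqrt_nonneg _).trans (hD₁ t ht)
  have hEnn : ∀ t ∈ Icc 0 T, 0 ≤ E t := fun t ht => (Real.sqrt_nonneg _).trans (hE t ht)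
  obtain ⟨Γ, hΓ⟩ : ∃ Γ, ∀ t ∈ Icc 0 T, γ t ≤ Γ := by
    have hγc : ContinuousOn γ (Icc 0 T) :=
      (continuousOn_const.mul hD₀c).add (continuousOn_const.mul
        ((continuousOn_const.mul hD₁c).add (continuousOn_const.mul hD₀c)))
    obtain ⟨M, hM⟩ := isCompact_Icc.bddAbove_image hγc
    exact ⟨M, fun t ht => hM (mem_image_of_mem γ ht)⟩
  obtain ⟨MR, hMR⟩ : ∃ M, ∀ t ∈ Icc 0 T, R t ≤ M := by
    obtain ⟨M, hM⟩ := isCompact_Icc.bddAbove_image hRc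
    exact ⟨M, fun t ht => hM (mem_image_of_mem R ht)⟩
  -- ### the window step: the comparison along any classical solution from `u₀` on `[0, t]`
  have hwindow : ∀ {t : ℝ}, 0 < t → t ≤ T →
      ∀ {u : ℝ → UnitAddTorus d → EuclideanSpace ℝ d} {p : ℝ → UnitAddTorus d → ℝ},
      Torus.IsClassicalNSSolutionOn (Icc 0 t) ν 0 u p → (∀ r ∈ Icc 0 t, Torus.HasZeroMean (u r)) →
      u 0 = u₀ → ∀ r ∈ Icc 0 t, Real.sqrt (∑' k : d → ℤ, freqNormSq k ^ s *
        ‖mFourierCoeff (EuclideanSpace.complexify ∘ (fun y => u r y - v r y)) k‖ ^ 2) ≤ R r := by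
    intro t ht0 htT u p hu hmu hu0
    have hsub : Icc 0 t ⊆ Icc 0 T := Icc_subset_Icc_right htT
    have hvt : Torus.IsClassicalNSSolutionOn (Icc 0 t) ν g v q := hv.mono hsub (uniqueDiffOn_Icc ht0)
    have hw : Torus.IsSmoothSpaceTimeOn (Icc 0 t) (fun τ y => u τ y - v τ y) :=
      hu.smooth_velocity.sub hvt.smooth_velocity
    set X : ℝ → ℝ := fun r => ∑' k : d → ℤ, freqNormSq k ^ s *
      ‖mFourierCoeff (EuclideanSpace.complexify ∘ (fun y => u r y - v r y)) k‖ ^ 2 with hX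
    have hX0 : ∀ r ∈ Icc 0 t, 0 ≤ X r := fun r _ =>
      tsum_nonneg fun k => mul_nonneg (Real.rpow_nonneg (freqNormSq_nonneg k) _) (sq_nonneg _)
    obtain ⟨n, hn⟩ := exists_nat_gt (s + (Fintype.card d : ℝ))
    have hXc : ContinuousOn X (Icc 0 t) :=
      continuousOn_tsum_rpow_mul_norm_sq_of_lt n ht0 hw hs0
        (by nlinarith [Nat.cast_nonneg (α := ℝ) (Fintype.card d), hs0])
    have hXd : ∀ r ∈ Ioo 0 t, HasDerivAt X (deriv X r) r := by
      intro r hr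
      obtain ⟨D, hD, -⟩ := exists_hasDerivAt_tsum_rpow_mul_norm_sq_sub_le hu hvt ht0 hs hr
      exact hD.differentiableAt.hasDerivAt
    have hXle : ∀ r ∈ Ioo 0 t, deriv X r ≤ 2 * Real.sqrt (X r) *
        (-(4 * Real.pi ^ 2 * ν) * Real.sqrt (X r) + γ r * Real.sqrt (X r) + G * X r + E r) := by
      intro r hr
      have hrI : r ∈ Icc 0 T := hsub (Ioo_subset_Icc_self hr)
      have hrt : r ∈ Icc 0 t := Ioo_subset_Icc_self hr
      obtain ⟨D, hD, hDle⟩ := exists_hasDerivAt_tsum_rpow_mul_norm_sq_sub_le hu hvt ht0 hs hr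
      rw [hD.deriv]
      -- the slices
      have hur : Torus.IsSmooth (u r) := hu.smooth_velocity.isSmooth_slice hrt
      have hvr : Torus.IsSmooth (v r) := hv.smooth_velocity.isSmooth_slice hrI
      have hwr : Torus.IsSmooth (fun y => u r y - v r y) := hur.sub hvr
      have hmw : Torus.HasZeroMean (fun y => u r y - v r y) := by
        have h1 := hmu r hrt
        have h2 := hmv r hrI
        unfold Torus.HasZeroMean at h1 h2 ⊢
        rw [integral_sub hur.integrable hvr.integrable, h1, h2, sub_zero]
      -- notation
      set c : (d → ℤ) → EuclideanSpace ℂ d :=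
        fun k => mFourierCoeff (EuclideanSpace.complexify ∘ (fun y => u r y - v r y)) k with hc
      set cV : (d → ℤ) → EuclideanSpace ℂ d :=
        fun k => mFourierCoeff (EuclideanSpace.complexify ∘ v r) k with hcV
      have hXr : X r = ∑' k, freqNormSq k ^ s * ‖c k‖ ^ 2 := rfl
      set Z : ℝ := ∑' k, freqNormSq k ^ (s + 1) * ‖c k‖ ^ 2 with hZ
      set XV : ℝ := ∑' k, freqNormSq k ^ s * ‖cV k‖ ^ 2 with hXV
      set ZV : ℝ := ∑' k, freqNormSq k ^ (s + 1) * ‖cV k‖ ^ 2 with hZV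
      set F₀ : ℝ := ∑' k, ‖c k‖ with hF₀
      set F₁ : ℝ := ∑' k, Real.sqrt (freqNormSq k) * ‖c k‖ with hF₁
      set F₁V : ℝ := ∑' k, Real.sqrt (freqNormSq k) * ‖cV k‖ with hF₁V
      set Xh : ℝ := ∑' k, freqNormSq k ^ s *
        ‖mFourierCoeff (EuclideanSpace.complexify ∘
          (fun y => (0 : ℝ → UnitAddTorus d → EuclideanSpace ℝ d) r y - g r y)) k‖ ^ 2 with hXh
      set x : ℝ := Real.sqrt (X r) with hx
      have hx0 : 0 ≤ x := Real.sqrt_nonneg _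
      have hXx : X r = x ^ 2 := (Real.sq_sqrt (hX0 r hrt)).symm
      -- the embeddings and the estimators at `r`
      have hF₁le : F₁ ≤ C₁ * x := hC₁ _ hwr hmw
      have hF₀le : F₀ ≤ C₀ * x := hC₀ _ hwr hmw
      have hXVle : Real.sqrt XV ≤ D₀ r := hD₀ r hrI
      have hZVle : Real.sqrt ZV ≤ D₁ r := hD₁ r hrI
      have hF₁Vle : F₁V ≤ C₁ * D₀ r :=
        (hC₁ _ hvr (hmv r hrI)).trans (mul_le_mul_of_nonneg_left hXVle hC₁0)
      have hXhE : Real.sqrt Xh ≤ E r := by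
        have e : Xh = ∑' k, freqNormSq k ^ s *
            ‖mFourierCoeff (EuclideanSpace.complexify ∘ g r) k‖ ^ 2 := by
          refine tsum_congr fun k => ?_
          have hfun : (fun y => (0 : ℝ → UnitAddTorus d → EuclideanSpace ℝ d) r y - g r y) =
              fun y => -g r y := by
            funext y; simp
          rw [hfun, ci_mFourierCoeff_complexify_neg, norm_neg]
        rw [e]; exact hE r hrI
      have hZX : X r ≤ Z := ci_tsum_rpow_le_tsum_rpow_succ hs0
        (hwr.summable_freqNormSq_rpow_mul_norm_sq (by linarith))
      have hF₀0 : 0 ≤ F₀ := tsum_nonneg fun k => norm_nonneg _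
      have hF₁0 : 0 ≤ F₁ := tsum_nonneg fun k => mul_nonneg (Real.sqrt_nonneg _) (norm_nonneg _)
      have hF₁V0 : 0 ≤ F₁V := tsum_nonneg fun k => mul_nonneg (Real.sqrt_nonneg _) (norm_nonneg _)
      have hD₀r := hD₀nn r hrI
      have hD₁r := hD₁nn r hrI
      -- the four terms
      have hk1 : 0 ≤ 4 * Real.pi * nn * (s * (2 : ℝ) ^ s) := by positivity
      have hk2 : 0 ≤ 4 * Real.pi * nn * (2 : ℝ) ^ (s - 1) := by positivity
      have hk3 : 0 ≤ 8 * Real.pi * nn * (s * (2 : ℝ) ^ s) := by positivity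
      have hDle' : D ≤ -(8 * Real.pi ^ 2 * ν) * Z +
          4 * Real.pi * nn * (s * (2 : ℝ) ^ s) * (Real.sqrt XV * F₁ + F₁V * x) * x +
          8 * Real.pi * nn * (s * (2 : ℝ) ^ s) * F₁ * X r +
          4 * Real.pi * nn * (2 : ℝ) ^ (s - 1) * (F₀ * Real.sqrt ZV + F₁V * x) * x +
          2 * Real.sqrt Xh * x := hDle
      have hT1 : Real.sqrt XV * F₁ + F₁V * x ≤ D₀ r * (C₁ * x) + C₁ * D₀ r * x := by gcongr
      have hT3 : F₀ * Real.sqrt ZV + F₁V * x ≤ C₀ * x * D₁ r + C₁ * D₀ r * x := by gcongr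
      have hT2 : F₁ * X r ≤ C₁ * x * X r := mul_le_mul_of_nonneg_right hF₁le (hX0 r hrt)
      have hT4 : Real.sqrt Xh * x ≤ E r * x := mul_le_mul_of_nonneg_right hXhE hx0
      have hT0 : -(8 * Real.pi ^ 2 * ν) * Z ≤ -(8 * Real.pi ^ 2 * ν) * X r := by
        have hpos : 0 < 8 * Real.pi ^ 2 * ν := by positivity
        exact mul_le_mul_of_nonpos_left hZX (by linarith)
      have a1 := mul_le_mul_of_nonneg_left hT1 hk1
      have b1 := mul_le_mul_of_nonneg_right a1 hx0
      have a3 := mul_le_mul_of_nonneg_left hT3 hk2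
      have b3 := mul_le_mul_of_nonneg_right a3 hx0
      have a2 := mul_le_mul_of_nonneg_left hT2 hk3
      calc D ≤ _ := hDle'
        _ ≤ -(8 * Real.pi ^ 2 * ν) * X r +
              4 * Real.pi * nn * (s * (2 : ℝ) ^ s) * (D₀ r * (C₁ * x) + C₁ * D₀ r * x) * x +
              8 * Real.pi * nn * (s * (2 : ℝ) ^ s) * (C₁ * x * X r) +
              4 * Real.pi * nn * (2 : ℝ) ^ (s - 1) * (C₀ * x * D₁ r + C₁ * D₀ r * x) * x +
              2 * (E r * x) := by linarith [hT0, b1, a2, b3, hT4]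
        _ = 2 * x * (-(4 * Real.pi ^ 2 * ν) * x + γ r * x + G * X r + E r) := by
            simp only [hγ, hG, hXx]
            ring
    exact sqrt_le_of_control_inequality (X := X) (X' := deriv X) (R := R) (R' := R')
      (γ := γ) (ε := E) (lam := 4 * Real.pi ^ 2 * ν) (G := G) ht0 hG0 hXc hXd hX0 hXle
      (hRc.mono hsub) (fun r hr => hRd r ⟨hr.1, lt_of_lt_of_le hr.2 htT⟩)
      (fun r hr => hRge r ⟨hr.1, lt_of_lt_of_le hr.2 htT⟩)
      (fun r hr => hEnn r ⟨hr.1, hr.2.le.trans htT⟩) ⟨Γ, fun r hr => hΓ r ⟨hr.1, hr.2.le.trans htT⟩⟩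
      (by
        show Real.sqrt (∑' k : d → ℤ, freqNormSq k ^ s *
          ‖mFourierCoeff (EuclideanSpace.complexify ∘ (fun y => u 0 y - v 0 y)) k‖ ^ 2) ≤ R 0
        rw [hu0]; exact hR0)
  -- ### a uniform bound for `‖∇v‖₂²` on `[0, T]`
  obtain ⟨Gv, hGv⟩ : ∃ Gv : ℝ, ∀ r ∈ Icc 0 T, Torus.gradNormSq (v r) ≤ Gv := by
    have hcont : ContinuousOn (fun r => Torus.gradNormSq (v r)) (Icc 0 T) := by
      intro r hr
      have h := (hv.hasDerivWithinAt_half_gradNormSq hT hr).continuousWithinAt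
      have h2 : ContinuousWithinAt (fun s => (2 : ℝ) * (2⁻¹ * Torus.gradNormSq (v s))) (Icc 0 T) r :=
        continuousWithinAt_const.mul h
      exact h2.congr (fun s _ => by ring) (by ring)
    obtain ⟨r₀, -, hmax⟩ := isCompact_Icc.exists_isMaxOn (nonempty_Icc.2 hT.le) hcont
    exact ⟨Torus.gradNormSq (v r₀), fun r hr => (isMaxOn_iff.1 hmax) r hr⟩
  -- ### the maximal solution from `u₀`
  obtain ⟨u, p, hu0, hcases⟩ := Torus.exists_maximal_classicalNS hd hν hu₀ hdiv hmean
  have finish : Torus.IsClassicalNSSolutionOn (Icc 0 T) ν 0 u p →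
      (∀ t ∈ Icc 0 T, Torus.HasZeroMean (u t)) →
      ∃ (u : ℝ → UnitAddTorus d → EuclideanSpace ℝ d) (p : ℝ → UnitAddTorus d → ℝ),
        Torus.IsClassicalNSSolutionOn (Icc 0 T) ν 0 u p ∧ u 0 = u₀ ∧
        (∀ t ∈ Icc 0 T, Torus.HasZeroMean (u t)) ∧
        ∀ t ∈ Icc 0 T, Real.sqrt (∑' k : d → ℤ, freqNormSq k ^ s *
          ‖mFourierCoeff (EuclideanSpace.complexify ∘ (fun y => u t y - v t y)) k‖ ^ 2) ≤ R t :=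
    fun hvT hmvT => ⟨u, p, hvT, hu0, hmvT, hwindow hT le_rfl hvT hmvT hu0⟩
  rcases hcases with ⟨hU, hmU, -⟩ | ⟨Tu, hTu, hU, hmU, hunb, -⟩
  · -- global
    exact finish (hU.mono (fun r hr => mem_Ici.2 hr.1) (uniqueDiffOn_Icc hT))
      (fun t ht => hmU t ht.1)
  · rcases lt_or_ge T Tu with hTlt | hTge
    · -- the blow-up time is beyond `T`
      exact finish (hU.mono (fun r hr => ⟨hr.1, lt_of_le_of_lt hr.2 hTlt⟩) (uniqueDiffOn_Icc hT))
        (fun t ht => hmU t ⟨ht.1, lt_of_le_of_lt ht.2 hTlt⟩)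
    · -- blow-up at `Tu ≤ T` is impossible: `‖∇u‖₂²` stays bounded on `[0, Tu)`
      exfalso
      refine hunb ⟨2 * Gv + 2 * (4 * Real.pi ^ 2 * (2 * (|MR| ^ 2 + |R 0| ^ 2))) +
        2 * Torus.gradNormSq u₀, ?_⟩
      rintro _ ⟨r, hr, rfl⟩
      have hrI : r ∈ Icc 0 T := ⟨hr.1, (le_of_lt hr.2).trans hTge⟩
      have hur : Torus.IsSmooth (u r) := hU.smooth_velocity.isSmooth_slice hr
      have hvr : Torus.IsSmooth (v r) := hv.smooth_velocity.isSmooth_slice hrI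
      have hwr : Torus.IsSmooth (fun y => u r y - v r y) := hur.sub hvr
      -- `√X_w(r) ≤ R r` on the window `[0, r]` (or `r = 0`)
      have hXR : Real.sqrt (∑' k : d → ℤ, freqNormSq k ^ s *
          ‖mFourierCoeff (EuclideanSpace.complexify ∘ (fun y => u r y - v r y)) k‖ ^ 2) ≤ |MR| + |R 0| := by
        rcases eq_or_lt_of_le hr.1 with h0r | h0r
        · rw [← h0r, hu0]
          exact hR0.trans ((le_abs_self _).trans (by linarith [abs_nonneg MR]))
        · have hUr : Torus.IsClassicalNSSolutionOn (Icc 0 r) ν 0 u p :=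
            hU.mono (fun x hx => ⟨hx.1, lt_of_le_of_lt hx.2 hr.2⟩) (uniqueDiffOn_Icc h0r)
          have h1 := hwindow h0r hrI.2 hUr (fun x hx => hmU x ⟨hx.1, lt_of_le_of_lt hx.2 hr.2⟩) hu0
            r (right_mem_Icc.2 h0r.le)
          exact h1.trans ((hMR r hrI).trans ((le_abs_self _).trans (by linarith [abs_nonneg (R 0)])))
      have hgw : Torus.gradNormSq (fun y => u r y - v r y) ≤
          4 * Real.pi ^ 2 * (2 * (|MR| ^ 2 + |R 0| ^ 2)) := by
        have h1 := ci_gradNormSq_le_tsum_rpow hwr hs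
        set Xr : ℝ := ∑' k : d → ℤ, freqNormSq k ^ s *
          ‖mFourierCoeff (EuclideanSpace.complexify ∘ (fun y => u r y - v r y)) k‖ ^ 2 with hXr
        have hXr0 : 0 ≤ Xr := tsum_nonneg fun k =>
          mul_nonneg (Real.rpow_nonneg (freqNormSq_nonneg k) _) (sq_nonneg _)
        have h2 : Xr ≤ (|MR| + |R 0|) ^ 2 := by
          calc Xr = Real.sqrt Xr ^ 2 := (Real.sq_sqrt hXr0).symm
            _ ≤ (|MR| + |R 0|) ^ 2 := pow_le_pow_left₀ (Real.sqrt_nonneg _) hXR 2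
        have h3 : (|MR| + |R 0|) ^ 2 ≤ 2 * (|MR| ^ 2 + |R 0| ^ 2) := by
          nlinarith [sq_nonneg (|MR| - |R 0|)]
        have hpi : 0 ≤ 4 * Real.pi ^ 2 := by positivity
        exact h1.trans (mul_le_mul_of_nonneg_left (h2.trans h3) hpi)
      have hsplit : u r = v r + fun y => u r y - v r y := by
        funext y; simp
      show Torus.gradNormSq (u r) ≤ 2 * Gv + 2 * (4 * Real.pi ^ 2 * (2 * (|MR| ^ 2 + |R 0| ^ 2))) +
        2 * Torus.gradNormSq u₀
      rw [hsplit]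
      refine (Torus.gradNormSq_add_le hvr hwr).trans ?_
      have h1 := hGv r hrI
      have h3 : 0 ≤ Torus.gradNormSq u₀ := Torus.gradNormSq_nonneg _
      linarith

/-! ### §6 The case `d = 3`, `s > 5/2`: the lattice embedding constants -/

/-- **Morosi–Pizzocchero's Prop. 4.4 (i) on `T³` for `s > 5/2`, with the lattice constants**
`C₀ = (∑_{k≠0}|k|^{-2s})^{1/2}`, `C₁ = (∑_{k≠0}|k|^{2−2s})^{1/2}` of
`NSSobolev.tsum_rpow_mul_norm_le_latticeConst_mul_sqrt` (`n > d/2 + 1` in MP; here `s > 5/2`):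
the hypotheses and conclusion of `Torus.classicalNS_regular_of_sobolev_control` with these
constants — if `R` is continuous on `[0, T]` with right derivatives
`R' ≥ −4π²νR + (4πn s2^sC₁D₀ + 2πn2^{s−1}(C₀D₁ + C₁D₀))R + 4πn s2^s C₁R² + E` on `[0, T)`
(`n = 3`) and `R(0) ≥ ‖u₀ − v(0)‖_s`, then the classical solution from `u₀` exists on `[0, T]`
with `‖u(t) − v(t)‖_s ≤ R(t)`. [cite: MorosiPizzocchero2015, Prop. 4.4 (i); MorosiPizzocchero2012Kato, §2 (finiteness of `K_n`, `G_n` for `n > d/2 + 1`)] -/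
theorem Torus.classicalNS_regular_of_sobolev_control_of_gt (hd : Fintype.card d = 3) {ν : ℝ}
    (hν : 0 < ν) {T : ℝ} (hT : 0 < T) {s : ℝ} (hs : 5 / 2 < s)
    {v g : ℝ → UnitAddTorus d → EuclideanSpace ℝ d} {q : ℝ → UnitAddTorus d → ℝ}
    (hv : Torus.IsClassicalNSSolutionOn (Icc 0 T) ν g v q)
    (hmv : ∀ t ∈ Icc 0 T, Torus.HasZeroMean (v t))
    {D₀ D₁ E : ℝ → ℝ} (hD₀c : ContinuousOn D₀ (Icc 0 T)) (hD₁c : ContinuousOn D₁ (Icc 0 T))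
    (hD₀ : ∀ t ∈ Icc 0 T, Real.sqrt (∑' k : d → ℤ, freqNormSq k ^ s *
      ‖mFourierCoeff (EuclideanSpace.complexify ∘ v t) k‖ ^ 2) ≤ D₀ t)
    (hD₁ : ∀ t ∈ Icc 0 T, Real.sqrt (∑' k : d → ℤ, freqNormSq k ^ (s + 1) *
      ‖mFourierCoeff (EuclideanSpace.complexify ∘ v t) k‖ ^ 2) ≤ D₁ t)
    (hE : ∀ t ∈ Icc 0 T, Real.sqrt (∑' k : d → ℤ, freqNormSq k ^ s *
      ‖mFourierCoeff (EuclideanSpace.complexify ∘ g t) k‖ ^ 2) ≤ E t)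
    {u₀ : UnitAddTorus d → EuclideanSpace ℝ d} (hu₀ : Torus.IsSmooth u₀)
    (hdiv : Torus.IsDivFree u₀) (hmean : Torus.HasZeroMean u₀)
    {R R' : ℝ → ℝ} (hRc : ContinuousOn R (Icc 0 T))
    (hRd : ∀ t ∈ Ico 0 T, HasDerivWithinAt R (R' t) (Ici t) t)
    (hRge : ∀ t ∈ Ico 0 T,
      -(4 * Real.pi ^ 2 * ν) * R t +
        (4 * Real.pi * (Fintype.card d : ℝ) * (s * (2 : ℝ) ^ s) *
            Real.sqrt (∑' k : d → ℤ, if k = 0 then (0 : ℝ) else freqNormSq k ^ (-(s - 1))) * D₀ t +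
          2 * Real.pi * (Fintype.card d : ℝ) * (2 : ℝ) ^ (s - 1) *
            (Real.sqrt (∑' k : d → ℤ, if k = 0 then (0 : ℝ) else freqNormSq k ^ (-s)) * D₁ t +
              Real.sqrt (∑' k : d → ℤ, if k = 0 then (0 : ℝ) else freqNormSq k ^ (-(s - 1))) *
                D₀ t)) * R t +
        4 * Real.pi * (Fintype.card d : ℝ) * (s * (2 : ℝ) ^ s) *
          Real.sqrt (∑' k : d → ℤ, if k = 0 then (0 : ℝ) else freqNormSq k ^ (-(s - 1))) * R t ^ 2 +
        E t ≤ R' t)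
    (hR0 : Real.sqrt (∑' k : d → ℤ, freqNormSq k ^ s *
      ‖mFourierCoeff (EuclideanSpace.complexify ∘ (fun y => u₀ y - v 0 y)) k‖ ^ 2) ≤ R 0) :
    ∃ (u : ℝ → UnitAddTorus d → EuclideanSpace ℝ d) (p : ℝ → UnitAddTorus d → ℝ),
      Torus.IsClassicalNSSolutionOn (Icc 0 T) ν 0 u p ∧ u 0 = u₀ ∧
      (∀ t ∈ Icc 0 T, Torus.HasZeroMean (u t)) ∧
      ∀ t ∈ Icc 0 T, Real.sqrt (∑' k : d → ℤ, freqNormSq k ^ s *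
        ‖mFourierCoeff (EuclideanSpace.complexify ∘ (fun y => u t y - v t y)) k‖ ^ 2) ≤ R t := by
  classical
  have hn : (Fintype.card d : ℝ) = 3 := by rw [hd]; norm_num
  have hC₀ : ∀ w : UnitAddTorus d → EuclideanSpace ℝ d, Torus.IsSmooth w → Torus.HasZeroMean w →
      ∑' k : d → ℤ, ‖mFourierCoeff (EuclideanSpace.complexify ∘ w) k‖ ≤
        Real.sqrt (∑' k : d → ℤ, if k = 0 then (0 : ℝ) else freqNormSq k ^ (-s)) *
          Real.sqrt (∑' k : d → ℤ, freqNormSq k ^ s *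
            ‖mFourierCoeff (EuclideanSpace.complexify ∘ w) k‖ ^ 2) := by
    intro w hw h0
    have h := tsum_rpow_mul_norm_le_latticeConst_mul_sqrt hw h0 (r := 0) (s := s) le_rfl
      (by rw [hn]; linarith)
    simp only [Real.rpow_zero, one_mul, mul_zero, sub_zero] at h
    exact h
  have hC₁ : ∀ w : UnitAddTorus d → EuclideanSpace ℝ d, Torus.IsSmooth w → Torus.HasZeroMean w →
      ∑' k : d → ℤ, Real.sqrt (freqNormSq k) * ‖mFourierCoeff (EuclideanSpace.complexify ∘ w) k‖ ≤
        Real.sqrt (∑' k : d → ℤ, if k = 0 then (0 : ℝ) else freqNormSq k ^ (-(s - 1))) *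
          Real.sqrt (∑' k : d → ℤ, freqNormSq k ^ s *
            ‖mFourierCoeff (EuclideanSpace.complexify ∘ w) k‖ ^ 2) := by
    intro w hw h0
    have h := tsum_rpow_mul_norm_le_latticeConst_mul_sqrt hw h0 (r := 1 / 2) (s := s)
      (by norm_num) (by rw [hn]; linarith)
    have e : (2 : ℝ) * (1 / 2) = 1 := by norm_num
    simp only [← Real.sqrt_eq_rpow, e] at h
    exact h
  exact Torus.classicalNS_regular_of_sobolev_control hd hν hT (by linarith) (Real.sqrt_nonneg _)
    (Real.sqrt_nonneg _) hC₀ hC₁ hv hmv hD₀c hD₁c hD₀ hD₁ hE hu₀ hdiv hmean hRc hRd hRge hR0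

/-! ### §7 Raw data: any smooth divergence-free reconstruction and its residual -/

/-- **A posteriori existence in `Ḣ^s` from raw numerical data (Morosi–Pizzocchero 2015,
Prop. 4.4 (i) with Def. 4.1: "An approximate solution of the problem is any map
`u_a ∈ C¹([0,T_a), H^∞_{Σ0})` … the differential error of `u_a` is
`e(u_a) := du_a/dt − νΔu_a − 𝒫(u_a,u_a) − f`").** `Torus.classicalNS_regular_of_sobolev_control_of_gt`
for raw data: `v` ANY jointly smooth field on `[0, T] × T³` with divergence-free mean-zero slices
and `q` ANY jointly smooth scalar (e.g. polynomial-in-time trigonometric-polynomial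
reconstructions of a computation), the estimator `E` bounding the `Ḣ^s` norm of the RESIDUAL
`∂ₜv + (v·∇)v − νΔv + ∇q` (`IsSmoothSpaceTimeOn.isClassicalNSSolutionOn_residual`: `(v, q)`
solves the equations with this force); conclusion as there: the classical solution from `u₀`
exists on `[0, T]` with `‖u(t) − v(t)‖_s ≤ R(t)`. All hypotheses are inequalities between
computable functions of the data (`s > 5/2`, lattice constants `C₀, C₁`).
[cite: MorosiPizzocchero2015, Prop. 4.4 (i) with Def. 4.1] -/
theorem Torus.classicalNS_regular_of_sobolev_control_residual (hd : Fintype.card d = 3) {ν : ℝ}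
    (hν : 0 < ν) {T : ℝ} (hT : 0 < T) {s : ℝ} (hs : 5 / 2 < s)
    {v : ℝ → UnitAddTorus d → EuclideanSpace ℝ d} {q : ℝ → UnitAddTorus d → ℝ}
    (hvs : Torus.IsSmoothSpaceTimeOn (Icc 0 T) v) (hqs : Torus.IsSmoothSpaceTimeOn (Icc 0 T) q)
    (hdivv : ∀ t ∈ Icc 0 T, Torus.IsDivFree (v t)) (hmv : ∀ t ∈ Icc 0 T, Torus.HasZeroMean (v t))
    {D₀ D₁ E : ℝ → ℝ} (hD₀c : ContinuousOn D₀ (Icc 0 T)) (hD₁c : ContinuousOn D₁ (Icc 0 T))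
    (hD₀ : ∀ t ∈ Icc 0 T, Real.sqrt (∑' k : d → ℤ, freqNormSq k ^ s *
      ‖mFourierCoeff (EuclideanSpace.complexify ∘ v t) k‖ ^ 2) ≤ D₀ t)
    (hD₁ : ∀ t ∈ Icc 0 T, Real.sqrt (∑' k : d → ℤ, freqNormSq k ^ (s + 1) *
      ‖mFourierCoeff (EuclideanSpace.complexify ∘ v t) k‖ ^ 2) ≤ D₁ t)
    (hE : ∀ t ∈ Icc 0 T, Real.sqrt (∑' k : d → ℤ, freqNormSq k ^ s *
      ‖mFourierCoeff (EuclideanSpace.complexify ∘ (fun x =>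
        Torus.timeDerivWithin (Icc 0 T) v t x + Torus.convect (v t) (v t) x -
          ν • Torus.laplacian (v t) x + Torus.gradient (q t) x)) k‖ ^ 2) ≤ E t)
    {u₀ : UnitAddTorus d → EuclideanSpace ℝ d} (hu₀ : Torus.IsSmooth u₀)
    (hdiv : Torus.IsDivFree u₀) (hmean : Torus.HasZeroMean u₀)
    {R R' : ℝ → ℝ} (hRc : ContinuousOn R (Icc 0 T))
    (hRd : ∀ t ∈ Ico 0 T, HasDerivWithinAt R (R' t) (Ici t) t)
    (hRge : ∀ t ∈ Ico 0 T,
      -(4 * Real.pi ^ 2 * ν) * R t +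
        (4 * Real.pi * (Fintype.card d : ℝ) * (s * (2 : ℝ) ^ s) *
            Real.sqrt (∑' k : d → ℤ, if k = 0 then (0 : ℝ) else freqNormSq k ^ (-(s - 1))) * D₀ t +
          2 * Real.pi * (Fintype.card d : ℝ) * (2 : ℝ) ^ (s - 1) *
            (Real.sqrt (∑' k : d → ℤ, if k = 0 then (0 : ℝ) else freqNormSq k ^ (-s)) * D₁ t +
              Real.sqrt (∑' k : d → ℤ, if k = 0 then (0 : ℝ) else freqNormSq k ^ (-(s - 1))) *
                D₀ t)) * R t +
        4 * Real.pi * (Fintype.card d : ℝ) * (s * (2 : ℝ) ^ s) *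
          Real.sqrt (∑' k : d → ℤ, if k = 0 then (0 : ℝ) else freqNormSq k ^ (-(s - 1))) * R t ^ 2 +
        E t ≤ R' t)
    (hR0 : Real.sqrt (∑' k : d → ℤ, freqNormSq k ^ s *
      ‖mFourierCoeff (EuclideanSpace.complexify ∘ (fun y => u₀ y - v 0 y)) k‖ ^ 2) ≤ R 0) :
    ∃ (u : ℝ → UnitAddTorus d → EuclideanSpace ℝ d) (p : ℝ → UnitAddTorus d → ℝ),
      Torus.IsClassicalNSSolutionOn (Icc 0 T) ν 0 u p ∧ u 0 = u₀ ∧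
      (∀ t ∈ Icc 0 T, Torus.HasZeroMean (u t)) ∧
      ∀ t ∈ Icc 0 T, Real.sqrt (∑' k : d → ℤ, freqNormSq k ^ s *
        ‖mFourierCoeff (EuclideanSpace.complexify ∘ (fun y => u t y - v t y)) k‖ ^ 2) ≤ R t :=
  Torus.classicalNS_regular_of_sobolev_control_of_gt hd hν hT hs
    (hvs.isClassicalNSSolutionOn_residual ν hqs hdivv) hmv hD₀c hD₁c hD₀ hD₁ hE hu₀ hdiv hmean
    hRc hRd hRge hR0

/-! ### §8 Higher norms: the linear control inequality for `p ≥ s` (MP Prop. 4.4 (ii)) -/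

/-- **Control of higher Sobolev norms of the error (Morosi–Pizzocchero 2015, Lemma 4.2 for
`p ≥ n` and Prop. 4.4 (ii)).** MP: "Consider any real `p > n`, and let `R_p ∈ C([0,T_c),ℝ)` be a
solution of the linear control inequalities
`d⁺R_p/dt ≥ −νR_p + (G_p𝒟_p + K_p𝒟_{p+1} + G_{pn}R_n)R_p + ε_p`, `R_p(0) ≥ δ_p`. Then
`‖u(t) − u_a(t)‖_p ≤ R_p(t)` for `t ∈ [0,T_c)`" (Lemma 4.2, `p ≥ n`:
`d⁺‖w‖_p/dt ≤ −ν‖w‖_p + (G_p𝒟_p + K_p𝒟_{p+1})‖w‖_p + G_{pn}‖w‖_n‖w‖_p + ε_p`, from the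
tame Kato inequality (2.4) `|⟨𝒫(v,w)|w⟩_p| ≤ ½G_{pn}(‖v‖_p‖w‖_n + ‖v‖_n‖w‖_p)‖w‖_p`). Classical
torus form: `(u, p_u)` unforced and `(v, q)` with force `g`, classical on `[0, T] × T^d` with
mean-zero slices, levels `1 ≤ s ≤ p`; embedding constants `C₀', C₁'` at level `p` and `C₁` at
level `s` (hypotheses, as in `Torus.classicalNS_regular_of_sobolev_control`); continuous
estimators `‖v‖_p ≤ D₀`, `‖v‖_{p+1} ≤ D₁`, `‖g‖_p ≤ E`, and a continuous bound
`‖u(t) − v(t)‖_s ≤ R_s(t)` (e.g. the conclusion of part (i)). If `R` is continuous on `[0, T]`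
with right derivatives
`R' ≥ −4π²νR + (4πn p2^pC₁'D₀ + 2πn2^{p−1}(C₀'D₁ + C₁'D₀) + 4πn p2^p C₁R_s)R + E` on `[0, T)` and
`R(0) ≥ ‖u(0) − v(0)‖_p`, then `‖u(t) − v(t)‖_p ≤ R(t)` on `[0, T]` (the `(w·∇)w` term is
bounded by (3.6) with `F₁(w) ≤ C₁‖w‖_s ≤ C₁R_s`, which makes the inequality LINEAR).
[cite: MorosiPizzocchero2015, Prop. 4.4 (ii) with Lemma 4.2 (p ≥ n) and (2.4)] -/
theorem Torus.classicalNS_sobolev_control_higher {ν : ℝ} (hν : 0 < ν) {T : ℝ} (hT : 0 < T)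
    {s p : ℝ} (hs : 1 ≤ s) (hsp : s ≤ p) {C₀' C₁' C₁ : ℝ} (hC₀'0 : 0 ≤ C₀') (hC₁'0 : 0 ≤ C₁')
    (hC₁0 : 0 ≤ C₁)
    (hC₀' : ∀ w : UnitAddTorus d → EuclideanSpace ℝ d, Torus.IsSmooth w → Torus.HasZeroMean w →
      ∑' k : d → ℤ, ‖mFourierCoeff (EuclideanSpace.complexify ∘ w) k‖ ≤
        C₀' * Real.sqrt (∑' k : d → ℤ, freqNormSq k ^ p *
          ‖mFourierCoeff (EuclideanSpace.complexify ∘ w) k‖ ^ 2))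
    (hC₁' : ∀ w : UnitAddTorus d → EuclideanSpace ℝ d, Torus.IsSmooth w → Torus.HasZeroMean w →
      ∑' k : d → ℤ, Real.sqrt (freqNormSq k) * ‖mFourierCoeff (EuclideanSpace.complexify ∘ w) k‖ ≤
        C₁' * Real.sqrt (∑' k : d → ℤ, freqNormSq k ^ p *
          ‖mFourierCoeff (EuclideanSpace.complexify ∘ w) k‖ ^ 2))
    (hC₁ : ∀ w : UnitAddTorus d → EuclideanSpace ℝ d, Torus.IsSmooth w → Torus.HasZeroMean w →
      ∑' k : d → ℤ, Real.sqrt (freqNormSq k) * ‖mFourierCoeff (EuclideanSpace.complexify ∘ w) k‖ ≤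
        C₁ * Real.sqrt (∑' k : d → ℤ, freqNormSq k ^ s *
          ‖mFourierCoeff (EuclideanSpace.complexify ∘ w) k‖ ^ 2))
    {u v g : ℝ → UnitAddTorus d → EuclideanSpace ℝ d} {pu q : ℝ → UnitAddTorus d → ℝ}
    (hu : Torus.IsClassicalNSSolutionOn (Icc 0 T) ν 0 u pu)
    (hmu : ∀ t ∈ Icc 0 T, Torus.HasZeroMean (u t))
    (hv : Torus.IsClassicalNSSolutionOn (Icc 0 T) ν g v q)
    (hmv : ∀ t ∈ Icc 0 T, Torus.HasZeroMean (v t))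
    {D₀ D₁ E Rs : ℝ → ℝ} (hD₀c : ContinuousOn D₀ (Icc 0 T)) (hD₁c : ContinuousOn D₁ (Icc 0 T))
    (hRsc : ContinuousOn Rs (Icc 0 T))
    (hD₀ : ∀ t ∈ Icc 0 T, Real.sqrt (∑' k : d → ℤ, freqNormSq k ^ p *
      ‖mFourierCoeff (EuclideanSpace.complexify ∘ v t) k‖ ^ 2) ≤ D₀ t)
    (hD₁ : ∀ t ∈ Icc 0 T, Real.sqrt (∑' k : d → ℤ, freqNormSq k ^ (p + 1) *
      ‖mFourierCoeff (EuclideanSpace.complexify ∘ v t) k‖ ^ 2) ≤ D₁ t)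
    (hE : ∀ t ∈ Icc 0 T, Real.sqrt (∑' k : d → ℤ, freqNormSq k ^ p *
      ‖mFourierCoeff (EuclideanSpace.complexify ∘ g t) k‖ ^ 2) ≤ E t)
    (hRs : ∀ t ∈ Icc 0 T, Real.sqrt (∑' k : d → ℤ, freqNormSq k ^ s *
      ‖mFourierCoeff (EuclideanSpace.complexify ∘ (fun y => u t y - v t y)) k‖ ^ 2) ≤ Rs t)
    {R R' : ℝ → ℝ} (hRc : ContinuousOn R (Icc 0 T))
    (hRd : ∀ t ∈ Ico 0 T, HasDerivWithinAt R (R' t) (Ici t) t)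
    (hRge : ∀ t ∈ Ico 0 T,
      -(4 * Real.pi ^ 2 * ν) * R t +
        (4 * Real.pi * (Fintype.card d : ℝ) * (p * (2 : ℝ) ^ p) * C₁' * D₀ t +
          2 * Real.pi * (Fintype.card d : ℝ) * (2 : ℝ) ^ (p - 1) * (C₀' * D₁ t + C₁' * D₀ t) +
          4 * Real.pi * (Fintype.card d : ℝ) * (p * (2 : ℝ) ^ p) * C₁ * Rs t) * R t + E t ≤ R' t)
    (hR0 : Real.sqrt (∑' k : d → ℤ, freqNormSq k ^ p *
      ‖mFourierCoeff (EuclideanSpace.complexify ∘ (fun y => u 0 y - v 0 y)) k‖ ^ 2) ≤ R 0) :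
    ∀ t ∈ Icc 0 T, Real.sqrt (∑' k : d → ℤ, freqNormSq k ^ p *
      ‖mFourierCoeff (EuclideanSpace.complexify ∘ (fun y => u t y - v t y)) k‖ ^ 2) ≤ R t := by
  classical
  have hp1 : (1 : ℝ) ≤ p := hs.trans hsp
  have hp0 : (0 : ℝ) < p := by linarith
  set nn : ℝ := (Fintype.card d : ℝ) with hnn
  set γ : ℝ → ℝ := fun t => 4 * Real.pi * nn * (p * (2 : ℝ) ^ p) * C₁' * D₀ t +
    2 * Real.pi * nn * (2 : ℝ) ^ (p - 1) * (C₀' * D₁ t + C₁' * D₀ t) +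
    4 * Real.pi * nn * (p * (2 : ℝ) ^ p) * C₁ * Rs t with hγ
  have hD₀nn : ∀ t ∈ Icc 0 T, 0 ≤ D₀ t := fun t ht => (Real.sqrt_nonneg _).trans (hD₀ t ht)
  have hD₁nn : ∀ t ∈ Icc 0 T, 0 ≤ D₁ t := fun t ht => (Real.sqrt_nonneg _).trans (hD₁ t ht)
  have hEnn : ∀ t ∈ Icc 0 T, 0 ≤ E t := fun t ht => (Real.sqrt_nonneg _).trans (hE t ht)
  have hRsnn : ∀ t ∈ Icc 0 T, 0 ≤ Rs t := fun t ht => (Real.sqrt_nonneg _).trans (hRs t ht)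
  obtain ⟨Γ, hΓ⟩ : ∃ Γ, ∀ t ∈ Icc 0 T, γ t ≤ Γ := by
    have hγc : ContinuousOn γ (Icc 0 T) :=
      ((continuousOn_const.mul hD₀c).add (continuousOn_const.mul
        ((continuousOn_const.mul hD₁c).add (continuousOn_const.mul hD₀c)))).add
        (continuousOn_const.mul hRsc)
    obtain ⟨M, hM⟩ := isCompact_Icc.bddAbove_image hγc
    exact ⟨M, fun t ht => hM (mem_image_of_mem γ ht)⟩
  have hw : Torus.IsSmoothSpaceTimeOn (Icc 0 T) (fun τ y => u τ y - v τ y) :=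
    hu.smooth_velocity.sub hv.smooth_velocity
  set X : ℝ → ℝ := fun r => ∑' k : d → ℤ, freqNormSq k ^ p *
    ‖mFourierCoeff (EuclideanSpace.complexify ∘ (fun y => u r y - v r y)) k‖ ^ 2 with hX
  have hX0 : ∀ r ∈ Icc 0 T, 0 ≤ X r := fun r _ =>
    tsum_nonneg fun k => mul_nonneg (Real.rpow_nonneg (freqNormSq_nonneg k) _) (sq_nonneg _)
  obtain ⟨n, hn⟩ := exists_nat_gt (p + (Fintype.card d : ℝ))
  have hXc : ContinuousOn X (Icc 0 T) :=
    continuousOn_tsum_rpow_mul_norm_sq_of_lt n hT hw hp0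
      (by nlinarith [Nat.cast_nonneg (α := ℝ) (Fintype.card d), hp0])
  have hXd : ∀ r ∈ Ioo 0 T, HasDerivAt X (deriv X r) r := by
    intro r hr
    obtain ⟨D, hD, -⟩ := exists_hasDerivAt_tsum_rpow_mul_norm_sq_sub_le hu hv hT hp1 hr
    exact hD.differentiableAt.hasDerivAt
  have hXle : ∀ r ∈ Ioo 0 T, deriv X r ≤ 2 * Real.sqrt (X r) *
      (-(4 * Real.pi ^ 2 * ν) * Real.sqrt (X r) + γ r * Real.sqrt (X r) + 0 * X r + E r) := by
    intro r hr
    have hrI : r ∈ Icc 0 T := Ioo_subset_Icc_self hr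
    obtain ⟨D, hD, hDle⟩ := exists_hasDerivAt_tsum_rpow_mul_norm_sq_sub_le hu hv hT hp1 hr
    rw [hD.deriv]
    have hur : Torus.IsSmooth (u r) := hu.smooth_velocity.isSmooth_slice hrI
    have hvr : Torus.IsSmooth (v r) := hv.smooth_velocity.isSmooth_slice hrI
    have hwr : Torus.IsSmooth (fun y => u r y - v r y) := hur.sub hvr
    have hmw : Torus.HasZeroMean (fun y => u r y - v r y) := by
      have h1 := hmu r hrI
      have h2 := hmv r hrI
      unfold Torus.HasZeroMean at h1 h2 ⊢
      rw [integral_sub hur.integrable hvr.integrable, h1, h2, sub_zero]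
    set c : (d → ℤ) → EuclideanSpace ℂ d :=
      fun k => mFourierCoeff (EuclideanSpace.complexify ∘ (fun y => u r y - v r y)) k with hc
    set cV : (d → ℤ) → EuclideanSpace ℂ d :=
      fun k => mFourierCoeff (EuclideanSpace.complexify ∘ v r) k with hcV
    set Z : ℝ := ∑' k, freqNormSq k ^ (p + 1) * ‖c k‖ ^ 2 with hZ
    set Xs : ℝ := ∑' k, freqNormSq k ^ s * ‖c k‖ ^ 2 with hXs
    set XV : ℝ := ∑' k, freqNormSq k ^ p * ‖cV k‖ ^ 2 with hXV
    set ZV : ℝ := ∑' k, freqNormSq k ^ (p + 1) * ‖cV k‖ ^ 2 with hZV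
    set F₀ : ℝ := ∑' k, ‖c k‖ with hF₀
    set F₁ : ℝ := ∑' k, Real.sqrt (freqNormSq k) * ‖c k‖ with hF₁
    set F₁V : ℝ := ∑' k, Real.sqrt (freqNormSq k) * ‖cV k‖ with hF₁V
    set Xh : ℝ := ∑' k, freqNormSq k ^ p *
      ‖mFourierCoeff (EuclideanSpace.complexify ∘
        (fun y => (0 : ℝ → UnitAddTorus d → EuclideanSpace ℝ d) r y - g r y)) k‖ ^ 2 with hXh
    set x : ℝ := Real.sqrt (X r) with hx
    have hx0 : 0 ≤ x := Real.sqrt_nonneg _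
    have hXx : X r = x ^ 2 := (Real.sq_sqrt (hX0 r hrI)).symm
    have hF₁le : F₁ ≤ C₁' * x := hC₁' _ hwr hmw
    have hF₀le : F₀ ≤ C₀' * x := hC₀' _ hwr hmw
    have hF₁s : F₁ ≤ C₁ * Rs r :=
      (hC₁ _ hwr hmw).trans (mul_le_mul_of_nonneg_left (hRs r hrI) hC₁0)
    have hXVle : Real.sqrt XV ≤ D₀ r := hD₀ r hrI
    have hZVle : Real.sqrt ZV ≤ D₁ r := hD₁ r hrI
    have hF₁Vle : F₁V ≤ C₁' * D₀ r :=
      (hC₁' _ hvr (hmv r hrI)).trans (mul_le_mul_of_nonneg_left hXVle hC₁'0)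
    have hXhE : Real.sqrt Xh ≤ E r := by
      have e : Xh = ∑' k, freqNormSq k ^ p *
          ‖mFourierCoeff (EuclideanSpace.complexify ∘ g r) k‖ ^ 2 := by
        refine tsum_congr fun k => ?_
        have hfun : (fun y => (0 : ℝ → UnitAddTorus d → EuclideanSpace ℝ d) r y - g r y) =
            fun y => -g r y := by
          funext y; simp
        rw [hfun, ci_mFourierCoeff_complexify_neg, norm_neg]
      rw [e]; exact hE r hrI
    have hZX : X r ≤ Z := ci_tsum_rpow_le_tsum_rpow_succ hp0
      (hwr.summable_freqNormSq_rpow_mul_norm_sq (by linarith))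
    have hF₁0 : 0 ≤ F₁ := tsum_nonneg fun k => mul_nonneg (Real.sqrt_nonneg _) (norm_nonneg _)
    have hF₁V0 : 0 ≤ F₁V := tsum_nonneg fun k => mul_nonneg (Real.sqrt_nonneg _) (norm_nonneg _)
    have hD₀r := hD₀nn r hrI
    have hD₁r := hD₁nn r hrI
    have hk1 : 0 ≤ 4 * Real.pi * nn * (p * (2 : ℝ) ^ p) := by positivity
    have hk2 : 0 ≤ 4 * Real.pi * nn * (2 : ℝ) ^ (p - 1) := by positivity
    have hk3 : 0 ≤ 8 * Real.pi * nn * (p * (2 : ℝ) ^ p) := by positivity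
    have hDle' : D ≤ -(8 * Real.pi ^ 2 * ν) * Z +
        4 * Real.pi * nn * (p * (2 : ℝ) ^ p) * (Real.sqrt XV * F₁ + F₁V * x) * x +
        8 * Real.pi * nn * (p * (2 : ℝ) ^ p) * F₁ * X r +
        4 * Real.pi * nn * (2 : ℝ) ^ (p - 1) * (F₀ * Real.sqrt ZV + F₁V * x) * x +
        2 * Real.sqrt Xh * x := hDle
    have hT1 : Real.sqrt XV * F₁ + F₁V * x ≤ D₀ r * (C₁' * x) + C₁' * D₀ r * x := by gcongr
    have hT3 : F₀ * Real.sqrt ZV + F₁V * x ≤ C₀' * x * D₁ r + C₁' * D₀ r * x := by gcongr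
    have hT2 : F₁ * X r ≤ C₁ * Rs r * X r := mul_le_mul_of_nonneg_right hF₁s (hX0 r hrI)
    have hT4 : Real.sqrt Xh * x ≤ E r * x := mul_le_mul_of_nonneg_right hXhE hx0
    have hT0 : -(8 * Real.pi ^ 2 * ν) * Z ≤ -(8 * Real.pi ^ 2 * ν) * X r := by
      have hpos : 0 < 8 * Real.pi ^ 2 * ν := by positivity
      exact mul_le_mul_of_nonpos_left hZX (by linarith)
    have a1 := mul_le_mul_of_nonneg_left hT1 hk1
    have b1 := mul_le_mul_of_nonneg_right a1 hx0
    have a3 := mul_le_mul_of_nonneg_left hT3 hk2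
    have b3 := mul_le_mul_of_nonneg_right a3 hx0
    have a2 := mul_le_mul_of_nonneg_left hT2 hk3
    calc D ≤ _ := hDle'
      _ ≤ -(8 * Real.pi ^ 2 * ν) * X r +
            4 * Real.pi * nn * (p * (2 : ℝ) ^ p) * (D₀ r * (C₁' * x) + C₁' * D₀ r * x) * x +
            8 * Real.pi * nn * (p * (2 : ℝ) ^ p) * (C₁ * Rs r * X r) +
            4 * Real.pi * nn * (2 : ℝ) ^ (p - 1) * (C₀' * x * D₁ r + C₁' * D₀ r * x) * x +
            2 * (E r * x) := by linarith [hT0, b1, a2, b3, hT4]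
      _ = 2 * x * (-(4 * Real.pi ^ 2 * ν) * x + γ r * x + 0 * X r + E r) := by
          simp only [hγ, hXx]
          ring
  exact sqrt_le_of_control_inequality (X := X) (X' := deriv X) (R := R) (R' := R')
    (γ := γ) (ε := E) (lam := 4 * Real.pi ^ 2 * ν) (G := 0) hT le_rfl hXc hXd hX0 hXle hRc hRd
    (fun r hr => by
      have h := hRge r hr
      rw [zero_mul, add_zero]
      exact h)
    (fun r hr => hEnn r (Ico_subset_Icc_self hr)) ⟨Γ, fun r hr => hΓ r (Ico_subset_Icc_self hr)⟩
    hR0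

/-! ### §9 An explicit supersolution: a closed-form certificate under constant envelopes -/

/-- **A closed-form instance of the control inequality (explicit supersolution).** In
`Torus.classicalNS_regular_of_sobolev_control` take constant envelopes `‖v(t)‖_s ≤ M₀`,
`‖v(t)‖_{s+1} ≤ M₁`, `‖g(t)‖_s ≤ ε₀` on `[0, T]` and datum error `‖u₀ − v(0)‖_s ≤ δ`; put
`Γ = 4πn s2^sC₁M₀ + 2πn2^{s−1}(C₀M₁ + C₁M₀)`, `G = 4πn s2^sC₁`, `a = max(Γ − 4π²ν, 0)`,
`ρ = 2(δ + ε₀T)e^{aT}`. If `2GT(δ + ε₀T)e^{aT} ≤ log 2`, then `R(t) = (δ + ε₀t)e^{(a + Gρ)t}`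
satisfies the control inequality on `[0, T]` (`R ≤ ρ` there, so `GR² ≤ GρR`), hence the
classical solution from `u₀` exists on `[0, T] × T³` with
`‖u(t) − v(t)‖_s ≤ (δ + ε₀t)e^{(a + Gρ)t} (≤ ρ)`. (A corollary making MP's Prop. 4.4 (i) a
single checkable inequality between numbers; MP integrate the control equation instead.)
[cite: MorosiPizzocchero2015, Prop. 4.4 (i) (with the explicit supersolution `R = (δ + ε₀t)e^{(a+Gρ)t}`)] -/
theorem Torus.classicalNS_regular_of_sobolev_control_explicit (hd : Fintype.card d = 3) {ν : ℝ}
    (hν : 0 < ν) {T : ℝ} (hT : 0 < T) {s : ℝ} (hs : 1 ≤ s) {C₀ C₁ : ℝ} (hC₀0 : 0 ≤ C₀)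
    (hC₁0 : 0 ≤ C₁)
    (hC₀ : ∀ w : UnitAddTorus d → EuclideanSpace ℝ d, Torus.IsSmooth w → Torus.HasZeroMean w →
      ∑' k : d → ℤ, ‖mFourierCoeff (EuclideanSpace.complexify ∘ w) k‖ ≤
        C₀ * Real.sqrt (∑' k : d → ℤ, freqNormSq k ^ s *
          ‖mFourierCoeff (EuclideanSpace.complexify ∘ w) k‖ ^ 2))
    (hC₁ : ∀ w : UnitAddTorus d → EuclideanSpace ℝ d, Torus.IsSmooth w → Torus.HasZeroMean w →
      ∑' k : d → ℤ, Real.sqrt (freqNormSq k) * ‖mFourierCoeff (EuclideanSpace.complexify ∘ w) k‖ ≤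
        C₁ * Real.sqrt (∑' k : d → ℤ, freqNormSq k ^ s *
          ‖mFourierCoeff (EuclideanSpace.complexify ∘ w) k‖ ^ 2))
    {v g : ℝ → UnitAddTorus d → EuclideanSpace ℝ d} {q : ℝ → UnitAddTorus d → ℝ}
    (hv : Torus.IsClassicalNSSolutionOn (Icc 0 T) ν g v q)
    (hmv : ∀ t ∈ Icc 0 T, Torus.HasZeroMean (v t)) {M₀ M₁ ε₀ δ : ℝ}
    (hM₀ : ∀ t ∈ Icc 0 T, Real.sqrt (∑' k : d → ℤ, freqNormSq k ^ s *
      ‖mFourierCoeff (EuclideanSpace.complexify ∘ v t) k‖ ^ 2) ≤ M₀)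
    (hM₁ : ∀ t ∈ Icc 0 T, Real.sqrt (∑' k : d → ℤ, freqNormSq k ^ (s + 1) *
      ‖mFourierCoeff (EuclideanSpace.complexify ∘ v t) k‖ ^ 2) ≤ M₁)
    (hε : ∀ t ∈ Icc 0 T, Real.sqrt (∑' k : d → ℤ, freqNormSq k ^ s *
      ‖mFourierCoeff (EuclideanSpace.complexify ∘ g t) k‖ ^ 2) ≤ ε₀)
    {u₀ : UnitAddTorus d → EuclideanSpace ℝ d} (hu₀ : Torus.IsSmooth u₀)
    (hdiv : Torus.IsDivFree u₀) (hmean : Torus.HasZeroMean u₀)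
    (hδ : Real.sqrt (∑' k : d → ℤ, freqNormSq k ^ s *
      ‖mFourierCoeff (EuclideanSpace.complexify ∘ (fun y => u₀ y - v 0 y)) k‖ ^ 2) ≤ δ)
    (hsmall : 2 * (4 * Real.pi * (Fintype.card d : ℝ) * (s * (2 : ℝ) ^ s) * C₁) * T * (δ + ε₀ * T) *
      Real.exp (max (4 * Real.pi * (Fintype.card d : ℝ) * (s * (2 : ℝ) ^ s) * C₁ * M₀ +
        2 * Real.pi * (Fintype.card d : ℝ) * (2 : ℝ) ^ (s - 1) * (C₀ * M₁ + C₁ * M₀) -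
        4 * Real.pi ^ 2 * ν) 0 * T) ≤ Real.log 2) :
    ∃ (u : ℝ → UnitAddTorus d → EuclideanSpace ℝ d) (p : ℝ → UnitAddTorus d → ℝ),
      Torus.IsClassicalNSSolutionOn (Icc 0 T) ν 0 u p ∧ u 0 = u₀ ∧
      (∀ t ∈ Icc 0 T, Torus.HasZeroMean (u t)) ∧
      ∀ t ∈ Icc 0 T, Real.sqrt (∑' k : d → ℤ, freqNormSq k ^ s *
        ‖mFourierCoeff (EuclideanSpace.complexify ∘ (fun y => u t y - v t y)) k‖ ^ 2) ≤
        (δ + ε₀ * t) * Real.exp ((max (4 * Real.pi * (Fintype.card d : ℝ) * (s * (2 : ℝ) ^ s) * C₁ * M₀ +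
            2 * Real.pi * (Fintype.card d : ℝ) * (2 : ℝ) ^ (s - 1) * (C₀ * M₁ + C₁ * M₀) -
            4 * Real.pi ^ 2 * ν) 0 +
          4 * Real.pi * (Fintype.card d : ℝ) * (s * (2 : ℝ) ^ s) * C₁ *
            (2 * (δ + ε₀ * T) * Real.exp (max (4 * Real.pi * (Fintype.card d : ℝ) *
              (s * (2 : ℝ) ^ s) * C₁ * M₀ + 2 * Real.pi * (Fintype.card d : ℝ) * (2 : ℝ) ^ (s - 1) *
              (C₀ * M₁ + C₁ * M₀) - 4 * Real.pi ^ 2 * ν) 0 * T))) * t) := by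
  set nn : ℝ := (Fintype.card d : ℝ) with hnn
  set G : ℝ := 4 * Real.pi * nn * (s * (2 : ℝ) ^ s) * C₁ with hG
  set Γ : ℝ := 4 * Real.pi * nn * (s * (2 : ℝ) ^ s) * C₁ * M₀ +
    2 * Real.pi * nn * (2 : ℝ) ^ (s - 1) * (C₀ * M₁ + C₁ * M₀) with hΓ
  set a : ℝ := max (Γ - 4 * Real.pi ^ 2 * ν) 0 with ha
  set ρ : ℝ := 2 * (δ + ε₀ * T) * Real.exp (a * T) with hρ
  set b : ℝ := a + G * ρ with hb
  have h0T : (0 : ℝ) ∈ Icc 0 T := left_mem_Icc.2 hT.le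
  have hδ0 : 0 ≤ δ := (Real.sqrt_nonneg _).trans hδ
  have hε0 : 0 ≤ ε₀ := (Real.sqrt_nonneg _).trans (hε 0 h0T)
  have hM₀0 : 0 ≤ M₀ := (Real.sqrt_nonneg _).trans (hM₀ 0 h0T)
  have hM₁0 : 0 ≤ M₁ := (Real.sqrt_nonneg _).trans (hM₁ 0 h0T)
  have hs0 : 0 < s := by linarith
  have hG0 : 0 ≤ G := by rw [hG]; positivity
  have ha0 : 0 ≤ a := le_max_right _ _
  have hρ0 : 0 ≤ ρ := by rw [hρ]; positivity
  have hb0 : 0 ≤ b := add_nonneg ha0 (mul_nonneg hG0 hρ0)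
  have hsmall' : G * ρ * T ≤ Real.log 2 := by
    have e : G * ρ * T = 2 * G * T * (δ + ε₀ * T) * Real.exp (a * T) := by rw [hρ]; ring
    rw [e]; exact hsmall
  -- the explicit supersolution
  set R : ℝ → ℝ := fun t => (δ + ε₀ * t) * Real.exp (b * t) with hR
  set R' : ℝ → ℝ := fun t => ε₀ * Real.exp (b * t) + b * R t with hR'
  have hRd_at : ∀ t, HasDerivAt R (R' t) t := by
    intro t
    have h1 : HasDerivAt (fun t => δ + ε₀ * t) ε₀ t := by
      simpa using ((hasDerivAt_id t).const_mul ε₀).const_add δ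
    have h2 : HasDerivAt (fun t => Real.exp (b * t)) (b * Real.exp (b * t)) t := by
      have h := ((hasDerivAt_id t).const_mul b).exp
      simp only [mul_one, id] at h
      convert h using 1; ring
    have h := h1.mul h2
    refine h.congr_deriv ?_
    simp only [hR', hR]
    ring
  have hRc : ContinuousOn R (Icc 0 T) := fun t _ => (hRd_at t).continuousAt.continuousWithinAt
  have hRnn : ∀ t, 0 ≤ t → 0 ≤ R t := fun t ht => by
    show 0 ≤ (δ + ε₀ * t) * Real.exp (b * t); positivity
  have hRle : ∀ t ∈ Icc 0 T, R t ≤ ρ := by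
    intro t ht
    have h1 : δ + ε₀ * t ≤ δ + ε₀ * T := by nlinarith [ht.2]
    have h2 : Real.exp (b * t) ≤ Real.exp (b * T) :=
      Real.exp_le_exp.2 (mul_le_mul_of_nonneg_left ht.2 hb0)
    have h3 : Real.exp (b * T) = Real.exp (a * T) * Real.exp (G * ρ * T) := by
      rw [← Real.exp_add, hb]; ring_nf
    have h4 : Real.exp (G * ρ * T) ≤ 2 := by
      calc Real.exp (G * ρ * T) ≤ Real.exp (Real.log 2) := Real.exp_le_exp.2 hsmall'
        _ = 2 := Real.exp_log (by norm_num)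
    have h5 : 0 ≤ δ + ε₀ * t := by nlinarith [ht.1]
    calc R t = (δ + ε₀ * t) * Real.exp (b * t) := rfl
      _ ≤ (δ + ε₀ * T) * Real.exp (b * T) :=
          mul_le_mul h1 h2 (Real.exp_pos _).le (by linarith)
      _ = (δ + ε₀ * T) * (Real.exp (a * T) * Real.exp (G * ρ * T)) := by rw [h3]
      _ ≤ (δ + ε₀ * T) * (Real.exp (a * T) * 2) := by
          gcongr
      _ = ρ := by rw [hρ]; ring
  -- the control inequality for `R`
  have hRge : ∀ t ∈ Ico 0 T,
      -(4 * Real.pi ^ 2 * ν) * R t +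
        (4 * Real.pi * nn * (s * (2 : ℝ) ^ s) * C₁ * M₀ +
          2 * Real.pi * nn * (2 : ℝ) ^ (s - 1) * (C₀ * M₁ + C₁ * M₀)) * R t +
        4 * Real.pi * nn * (s * (2 : ℝ) ^ s) * C₁ * R t ^ 2 + ε₀ ≤ R' t := by
    intro t ht
    have hRt := hRnn t ht.1
    have hRρ := hRle t (Ico_subset_Icc_self ht)
    have h1 : -(4 * Real.pi ^ 2 * ν) * R t + Γ * R t ≤ a * R t := by
      have : Γ - 4 * Real.pi ^ 2 * ν ≤ a := le_max_left _ _
      nlinarith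
    have h2 : G * R t ^ 2 ≤ G * ρ * R t := by
      rw [sq, ← mul_assoc]
      exact mul_le_mul_of_nonneg_right (mul_le_mul_of_nonneg_left hRρ hG0) hRt
    have h3 : ε₀ ≤ ε₀ * Real.exp (b * t) :=
      le_mul_of_one_le_right hε0 (Real.one_le_exp (mul_nonneg hb0 ht.1))
    show -(4 * Real.pi ^ 2 * ν) * R t + Γ * R t + G * R t ^ 2 + ε₀ ≤
      ε₀ * Real.exp (b * t) + b * R t
    rw [hb]
    nlinarith
  obtain ⟨u, p, hu, hu0, hmu, hbound⟩ := Torus.classicalNS_regular_of_sobolev_control hd hν hT hs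
    hC₀0 hC₁0 hC₀ hC₁ hv hmv (D₀ := fun _ => M₀) (D₁ := fun _ => M₁) (E := fun _ => ε₀)
    continuousOn_const continuousOn_const hM₀ hM₁ hε hu₀ hdiv hmean (R := R) (R' := R') hRc
    (fun t _ => (hRd_at t).hasDerivWithinAt) hRge
    (by show _ ≤ (δ + ε₀ * 0) * Real.exp (b * 0); rw [mul_zero, add_zero, mul_zero, Real.exp_zero,
      mul_one]; exact hδ)
  exact ⟨u, p, hu, hu0, hmu, fun t ht => hbound t ht⟩

/-! ### §10 Global control functions give global solutions -/

/-- **Global existence from a global control function (Morosi–Pizzocchero 2015, Prop. 4.4 (i):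
"In particular, if `R_n` is global (`T_c = +∞`) then `u` is global as well (`T = +∞`)").**
The hypotheses of `Torus.classicalNS_regular_of_sobolev_control` on the half-line: `(v, q)` a
classical mean-zero solution with force `g` on `[0, ∞) × T³`, estimators `D₀, D₁, E` continuous
on `[0, ∞)`, `R` continuous on `[0, ∞)` with right derivatives satisfying the control inequality
at every `t ≥ 0`, `R(0) ≥ ‖u₀ − v(0)‖_s`. Then the classical mean-zero solution of the
unforced equations from `u₀` is GLOBAL (`Torus.IsClassicalNSSolutionOn (Ici 0)`) and
`‖u(t) − v(t)‖_s ≤ R(t)` for all `t ≥ 0` (the closed-window theorem on every `[0, t]`, the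
maximal solution `Torus.exists_maximal_classicalNS` and its uniqueness clause).
[cite: MorosiPizzocchero2015, Prop. 4.4 (i) (global case `T_c = +∞`)] -/
theorem Torus.classicalNS_global_of_sobolev_control (hd : Fintype.card d = 3) {ν : ℝ}
    (hν : 0 < ν) {s : ℝ} (hs : 1 ≤ s) {C₀ C₁ : ℝ} (hC₀0 : 0 ≤ C₀) (hC₁0 : 0 ≤ C₁)
    (hC₀ : ∀ w : UnitAddTorus d → EuclideanSpace ℝ d, Torus.IsSmooth w → Torus.HasZeroMean w →
      ∑' k : d → ℤ, ‖mFourierCoeff (EuclideanSpace.complexify ∘ w) k‖ ≤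
        C₀ * Real.sqrt (∑' k : d → ℤ, freqNormSq k ^ s *
          ‖mFourierCoeff (EuclideanSpace.complexify ∘ w) k‖ ^ 2))
    (hC₁ : ∀ w : UnitAddTorus d → EuclideanSpace ℝ d, Torus.IsSmooth w → Torus.HasZeroMean w →
      ∑' k : d → ℤ, Real.sqrt (freqNormSq k) * ‖mFourierCoeff (EuclideanSpace.complexify ∘ w) k‖ ≤
        C₁ * Real.sqrt (∑' k : d → ℤ, freqNormSq k ^ s *
          ‖mFourierCoeff (EuclideanSpace.complexify ∘ w) k‖ ^ 2))
    {v g : ℝ → UnitAddTorus d → EuclideanSpace ℝ d} {q : ℝ → UnitAddTorus d → ℝ}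
    (hv : Torus.IsClassicalNSSolutionOn (Ici 0) ν g v q)
    (hmv : ∀ t ∈ Ici (0 : ℝ), Torus.HasZeroMean (v t))
    {D₀ D₁ E : ℝ → ℝ} (hD₀c : ContinuousOn D₀ (Ici 0)) (hD₁c : ContinuousOn D₁ (Ici 0))
    (hD₀ : ∀ t ∈ Ici (0 : ℝ), Real.sqrt (∑' k : d → ℤ, freqNormSq k ^ s *
      ‖mFourierCoeff (EuclideanSpace.complexify ∘ v t) k‖ ^ 2) ≤ D₀ t)
    (hD₁ : ∀ t ∈ Ici (0 : ℝ), Real.sqrt (∑' k : d → ℤ, freqNormSq k ^ (s + 1) *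
      ‖mFourierCoeff (EuclideanSpace.complexify ∘ v t) k‖ ^ 2) ≤ D₁ t)
    (hE : ∀ t ∈ Ici (0 : ℝ), Real.sqrt (∑' k : d → ℤ, freqNormSq k ^ s *
      ‖mFourierCoeff (EuclideanSpace.complexify ∘ g t) k‖ ^ 2) ≤ E t)
    {u₀ : UnitAddTorus d → EuclideanSpace ℝ d} (hu₀ : Torus.IsSmooth u₀)
    (hdiv : Torus.IsDivFree u₀) (hmean : Torus.HasZeroMean u₀)
    {R R' : ℝ → ℝ} (hRc : ContinuousOn R (Ici 0))
    (hRd : ∀ t ∈ Ici (0 : ℝ), HasDerivWithinAt R (R' t) (Ici t) t)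
    (hRge : ∀ t ∈ Ici (0 : ℝ),
      -(4 * Real.pi ^ 2 * ν) * R t +
        (4 * Real.pi * (Fintype.card d : ℝ) * (s * (2 : ℝ) ^ s) * C₁ * D₀ t +
          2 * Real.pi * (Fintype.card d : ℝ) * (2 : ℝ) ^ (s - 1) * (C₀ * D₁ t + C₁ * D₀ t)) * R t +
        4 * Real.pi * (Fintype.card d : ℝ) * (s * (2 : ℝ) ^ s) * C₁ * R t ^ 2 + E t ≤ R' t)
    (hR0 : Real.sqrt (∑' k : d → ℤ, freqNormSq k ^ s *
      ‖mFourierCoeff (EuclideanSpace.complexify ∘ (fun y => u₀ y - v 0 y)) k‖ ^ 2) ≤ R 0) :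
    ∃ (u : ℝ → UnitAddTorus d → EuclideanSpace ℝ d) (p : ℝ → UnitAddTorus d → ℝ),
      Torus.IsClassicalNSSolutionOn (Ici 0) ν 0 u p ∧ u 0 = u₀ ∧
      (∀ t ∈ Ici (0 : ℝ), Torus.HasZeroMean (u t)) ∧
      ∀ t ∈ Ici (0 : ℝ), Real.sqrt (∑' k : d → ℤ, freqNormSq k ^ s *
        ‖mFourierCoeff (EuclideanSpace.complexify ∘ (fun y => u t y - v t y)) k‖ ^ 2) ≤ R t := by
  -- the closed-window theorem on `[0, T]` for every `T > 0`
  have hwin : ∀ {T : ℝ}, 0 < T →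
      ∃ (u : ℝ → UnitAddTorus d → EuclideanSpace ℝ d) (p : ℝ → UnitAddTorus d → ℝ),
        Torus.IsClassicalNSSolutionOn (Icc 0 T) ν 0 u p ∧ u 0 = u₀ ∧
        (∀ t ∈ Icc 0 T, Torus.HasZeroMean (u t)) ∧
        ∀ t ∈ Icc 0 T, Real.sqrt (∑' k : d → ℤ, freqNormSq k ^ s *
          ‖mFourierCoeff (EuclideanSpace.complexify ∘ (fun y => u t y - v t y)) k‖ ^ 2) ≤ R t := by
    intro T hT
    have hsub : Icc 0 T ⊆ Ici 0 := fun t ht => mem_Ici.2 ht.1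
    exact Torus.classicalNS_regular_of_sobolev_control hd hν hT hs hC₀0 hC₁0 hC₀ hC₁
      (hv.mono hsub (uniqueDiffOn_Icc hT)) (fun t ht => hmv t (hsub ht)) (hD₀c.mono hsub)
      (hD₁c.mono hsub) (fun t ht => hD₀ t (hsub ht)) (fun t ht => hD₁ t (hsub ht))
      (fun t ht => hE t (hsub ht)) hu₀ hdiv hmean (hRc.mono hsub)
      (fun t ht => hRd t (mem_Ici.2 ht.1)) (fun t ht => hRge t (mem_Ici.2 ht.1)) hR0
  obtain ⟨u, p, hu0, hcases⟩ := Torus.exists_maximal_classicalNS hd hν hu₀ hdiv hmean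
  rcases hcases with ⟨hU, hmU, huniq⟩ | ⟨Tu, hTu, -, -, -, huniq⟩
  · refine ⟨u, p, hU, hu0, fun t ht => hmU t (mem_Ici.1 ht), fun t ht => ?_⟩
    rcases eq_or_lt_of_le (mem_Ici.1 ht) with h0t | h0t
    · rw [← h0t, hu0]; exact hR0
    · obtain ⟨u', p', hu', hu'0, -, hb'⟩ := hwin h0t
      have heq : u' t = u t := huniq t u' p' hu' hu'0 t (right_mem_Icc.2 h0t.le)
      have h := hb' t (right_mem_Icc.2 h0t.le)
      rwa [heq] at h
  · -- a finite blow-up time contradicts the closed-window theorem on `[0, Tu]`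
    exfalso
    obtain ⟨u', p', hu', hu'0, -, -⟩ := hwin hTu
    exact (lt_irrefl Tu) (huniq Tu u' p' hu' hu'0).1

/-! ### §11 The sharp-Kato variants (Morosi–Pizzocchero's functional `𝒢_s`) -/

section Sharp

variable {ν a b : ℝ} {f₁ f₂ u₁ u₂ : ℝ → UnitAddTorus d → EuclideanSpace ℝ d}
  {p₁ p₂ : ℝ → UnitAddTorus d → ℝ}

/-- **The `Ḣ^s` differential inequality for the difference, sharp-Kato variant** (MP 2015
Lemma 4.2 with the Kato terms bounded through Morosi–Pizzocchero's functional `𝒢_s`,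
`NSSobolev.abs_tsum_rpow_mul_re_inner_convect_pair_le_of_kernel_le`, instead of the Wiener
route): with `Gsq` bounding the partial sums of `𝒢_s(k)` for every `k`,
`D ≤ −8π²ν Z_w + 4π√Gsq X_{u₂}^{1/2} X_w + 4π√Gsq X_w^{3/2}
   + 4πn 2^{s−1} (F₀(w) Z_{u₂}^{1/2} + F₁(u₂) X_w^{1/2}) X_w^{1/2} + 2 X_h^{1/2} X_w^{1/2}`.
[cite: MorosiPizzocchero2015, Lemma 4.2 (4.4)–(4.8); MorosiPizzocchero2012Kato, Prop. 3.5] -/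
theorem NSSobolev.exists_hasDerivAt_tsum_rpow_mul_norm_sq_sub_le_of_kernel_le
    (h₁ : Torus.IsClassicalNSSolutionOn (Icc a b) ν f₁ u₁ p₁)
    (h₂ : Torus.IsClassicalNSSolutionOn (Icc a b) ν f₂ u₂ p₂) (hab : a < b) {s : ℝ} (hs : 1 ≤ s)
    {Gsq : ℝ} (hGker : ∀ (k : d → ℤ) (H : Finset (d → ℤ)), ∑ h ∈ H,
      (freqNormSq h * freqNormSq k - (∑ j, (h j : ℝ) * (k j : ℝ)) ^ 2) *
        (freqNormSq k ^ (s / 2) - freqNormSq (k - h) ^ (s / 2)) ^ 2 /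
        (freqNormSq h ^ (s + 1) * freqNormSq (k - h) ^ s) ≤ Gsq)
    {t : ℝ} (ht : t ∈ Ioo a b) :
    ∃ D : ℝ, HasDerivAt (fun τ => ∑' k : d → ℤ, freqNormSq k ^ s *
        ‖mFourierCoeff (EuclideanSpace.complexify ∘ (fun y => u₁ τ y - u₂ τ y)) k‖ ^ 2) D t ∧
      D ≤ -(8 * Real.pi ^ 2 * ν) * (∑' k : d → ℤ, freqNormSq k ^ (s + 1) *
            ‖mFourierCoeff (EuclideanSpace.complexify ∘ (fun y => u₁ t y - u₂ t y)) k‖ ^ 2) +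
        4 * Real.pi * Real.sqrt Gsq *
          Real.sqrt (∑' k : d → ℤ, freqNormSq k ^ s *
              ‖mFourierCoeff (EuclideanSpace.complexify ∘ u₂ t) k‖ ^ 2) *
          (∑' k : d → ℤ, freqNormSq k ^ s *
              ‖mFourierCoeff (EuclideanSpace.complexify ∘ (fun y => u₁ t y - u₂ t y)) k‖ ^ 2) +
        4 * Real.pi * Real.sqrt Gsq *
          Real.sqrt (∑' k : d → ℤ, freqNormSq k ^ s *
              ‖mFourierCoeff (EuclideanSpace.complexify ∘ (fun y => u₁ t y - u₂ t y)) k‖ ^ 2) *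
          (∑' k : d → ℤ, freqNormSq k ^ s *
              ‖mFourierCoeff (EuclideanSpace.complexify ∘ (fun y => u₁ t y - u₂ t y)) k‖ ^ 2) +
        4 * Real.pi * (Fintype.card d : ℝ) * (2 : ℝ) ^ (s - 1) *
          ((∑' k : d → ℤ, ‖mFourierCoeff (EuclideanSpace.complexify ∘ (fun y => u₁ t y - u₂ t y)) k‖) *
            Real.sqrt (∑' k : d → ℤ, freqNormSq k ^ (s + 1) *
              ‖mFourierCoeff (EuclideanSpace.complexify ∘ u₂ t) k‖ ^ 2) +
            (∑' k : d → ℤ, Real.sqrt (freqNormSq k) *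
              ‖mFourierCoeff (EuclideanSpace.complexify ∘ u₂ t) k‖) *
            Real.sqrt (∑' k : d → ℤ, freqNormSq k ^ s *
              ‖mFourierCoeff (EuclideanSpace.complexify ∘ (fun y => u₁ t y - u₂ t y)) k‖ ^ 2)) *
          Real.sqrt (∑' k : d → ℤ, freqNormSq k ^ s *
              ‖mFourierCoeff (EuclideanSpace.complexify ∘ (fun y => u₁ t y - u₂ t y)) k‖ ^ 2) +
        2 * Real.sqrt (∑' k : d → ℤ, freqNormSq k ^ s *
              ‖mFourierCoeff (EuclideanSpace.complexify ∘ (fun y => f₁ t y - f₂ t y)) k‖ ^ 2) *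
          Real.sqrt (∑' k : d → ℤ, freqNormSq k ^ s *
              ‖mFourierCoeff (EuclideanSpace.complexify ∘ (fun y => u₁ t y - u₂ t y)) k‖ ^ 2) := by
  classical
  have hs0 : (0 : ℝ) < s := by linarith
  have htS : t ∈ Icc a b := Ioo_subset_Icc_self ht
  have hu₁t : IsSmooth (u₁ t) := h₁.smooth_velocity.isSmooth_slice htS
  have hu₂t : IsSmooth (u₂ t) := h₂.smooth_velocity.isSmooth_slice htS
  have hwt : IsSmooth (fun y => u₁ t y - u₂ t y) := hu₁t.sub hu₂t
  have hft : IsSmooth (fun y => f₁ t y - f₂ t y) :=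
    (h₁.isSmooth_force_slice hab htS).sub (h₂.isSmooth_force_slice hab htS)
  have hc1 : IsSmooth (Torus.convect (u₁ t) (fun y => u₁ t y - u₂ t y)) := hu₁t.convect hwt
  have hc2 : IsSmooth (Torus.convect (fun y => u₁ t y - u₂ t y) (u₂ t)) := hwt.convect hu₂t
  have hc3 : IsSmooth (Torus.convect (u₂ t) (fun y => u₁ t y - u₂ t y)) := hu₂t.convect hwt
  have hc4 : IsSmooth (Torus.convect (fun y => u₁ t y - u₂ t y) (fun y => u₁ t y - u₂ t y)) :=
    hwt.convect hwt
  have hdivw : IsDivFree (fun y => u₁ t y - u₂ t y) := by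
    intro x
    have hw' : (fun y => u₁ t y - u₂ t y) = u₁ t - u₂ t := rfl
    rw [hw', Torus.divergence_sub (hu₁t.isContDiff (by simp)) (hu₂t.isContDiff (by simp)),
      h₁.divFree t htS x, h₂.divFree t htS x, sub_zero]
  refine ⟨_, hasDerivAt_tsum_rpow_mul_norm_sq_sub_two_forces h₁ h₂ hab hs0 ht, ?_⟩
  -- notation
  set c : (d → ℤ) → EuclideanSpace ℂ d :=
    fun k => mFourierCoeff (EuclideanSpace.complexify ∘ (fun y => u₁ t y - u₂ t y)) k with hc
  set cV : (d → ℤ) → EuclideanSpace ℂ d :=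
    fun k => mFourierCoeff (EuclideanSpace.complexify ∘ u₂ t) k with hcV
  set X : ℝ := ∑' k, freqNormSq k ^ s * ‖c k‖ ^ 2 with hX
  set Z : ℝ := ∑' k, freqNormSq k ^ (s + 1) * ‖c k‖ ^ 2 with hZ
  set XV : ℝ := ∑' k, freqNormSq k ^ s * ‖cV k‖ ^ 2 with hXV
  set ZV : ℝ := ∑' k, freqNormSq k ^ (s + 1) * ‖cV k‖ ^ 2 with hZV
  set F₀ : ℝ := ∑' k, ‖c k‖ with hF₀
  set F₁ : ℝ := ∑' k, Real.sqrt (freqNormSq k) * ‖c k‖ with hF₁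
  set F₁V : ℝ := ∑' k, Real.sqrt (freqNormSq k) * ‖cV k‖ with hF₁V
  set Xh : ℝ := ∑' k, freqNormSq k ^ s *
    ‖mFourierCoeff (EuclideanSpace.complexify ∘ (fun y => f₁ t y - f₂ t y)) k‖ ^ 2 with hXh
  set Q₁ : (d → ℤ) → ℝ := fun k => freqNormSq k ^ s *
    (inner ℂ (mFourierCoeff (EuclideanSpace.complexify ∘
      Torus.convect (u₁ t) (fun y => u₁ t y - u₂ t y)) k) (c k)).re with hQ₁
  set Q₂ : (d → ℤ) → ℝ := fun k => freqNormSq k ^ s *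
    (inner ℂ (mFourierCoeff (EuclideanSpace.complexify ∘
      Torus.convect (fun y => u₁ t y - u₂ t y) (u₂ t)) k) (c k)).re with hQ₂
  set Q₃ : (d → ℤ) → ℝ := fun k => freqNormSq k ^ s *
    (inner ℂ (mFourierCoeff (EuclideanSpace.complexify ∘ (fun y => f₁ t y - f₂ t y)) k) (c k)).re
    with hQ₃
  set Qa : (d → ℤ) → ℝ := fun k => freqNormSq k ^ s *
    (inner ℂ (mFourierCoeff (EuclideanSpace.complexify ∘
      Torus.convect (u₂ t) (fun y => u₁ t y - u₂ t y)) k) (c k)).re with hQa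
  set Qb : (d → ℤ) → ℝ := fun k => freqNormSq k ^ s *
    (inner ℂ (mFourierCoeff (EuclideanSpace.complexify ∘
      Torus.convect (fun y => u₁ t y - u₂ t y) (fun y => u₁ t y - u₂ t y)) k) (c k)).re with hQb
  show -(8 * Real.pi ^ 2 * ν) * Z - 2 * (∑' k, Q₁ k) - 2 * (∑' k, Q₂ k) + 2 * (∑' k, Q₃ k) ≤
    -(8 * Real.pi ^ 2 * ν) * Z +
      4 * Real.pi * Real.sqrt Gsq * Real.sqrt XV * X +
      4 * Real.pi * Real.sqrt Gsq * Real.sqrt X * X +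
      4 * Real.pi * (Fintype.card d : ℝ) * (2 : ℝ) ^ (s - 1) * (F₀ * Real.sqrt ZV + F₁V * Real.sqrt X) *
        Real.sqrt X +
      2 * Real.sqrt Xh * Real.sqrt X
  -- ### the advection split `(u₁·∇)w = (u₂·∇)w + (w·∇)w`
  have hQas : Summable Qa := (summable_and_abs_tsum_rpow_mul_re_inner_le hc3 hwt hs0.le).1
  have hQbs : Summable Qb := (summable_and_abs_tsum_rpow_mul_re_inner_le hc4 hwt hs0.le).1
  have hsplit_fun : Torus.convect (u₁ t) (fun y => u₁ t y - u₂ t y) =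
      fun x => Torus.convect (u₂ t) (fun y => u₁ t y - u₂ t y) x +
        Torus.convect (fun y => u₁ t y - u₂ t y) (fun y => u₁ t y - u₂ t y) x := by
    funext x
    have hu : u₁ t = fun y => u₂ t y + (u₁ t y - u₂ t y) := by
      funext y; simp
    conv_lhs => rw [hu]
    simp [Torus.convect]
  have hQ₁eq : ∀ k, Q₁ k = Qa k + Qb k := by
    intro k
    simp only [hQ₁, hQa, hQb]
    rw [hsplit_fun]
    have hi3 : Integrable (EuclideanSpace.complexify ∘
        Torus.convect (u₂ t) (fun y => u₁ t y - u₂ t y)) volume :=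
      integrable_complexify_comp hc3.integrable
    have hi4 : Integrable (EuclideanSpace.complexify ∘
        Torus.convect (fun y => u₁ t y - u₂ t y) (fun y => u₁ t y - u₂ t y)) volume :=
      integrable_complexify_comp hc4.integrable
    have hcomp : (EuclideanSpace.complexify ∘ fun x =>
        Torus.convect (u₂ t) (fun y => u₁ t y - u₂ t y) x +
          Torus.convect (fun y => u₁ t y - u₂ t y) (fun y => u₁ t y - u₂ t y) x) =
        (EuclideanSpace.complexify ∘ Torus.convect (u₂ t) (fun y => u₁ t y - u₂ t y)) +
          (EuclideanSpace.complexify ∘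
            Torus.convect (fun y => u₁ t y - u₂ t y) (fun y => u₁ t y - u₂ t y)) := by
      funext x
      simp only [Function.comp_apply, Pi.add_apply, map_add]
    rw [hcomp, mFourierCoeff_add hi3 hi4, inner_add_left, Complex.add_re, mul_add]
  have hQ₁sum : ∑' k, Q₁ k = ∑' k, Qa k + ∑' k, Qb k := by
    rw [tsum_congr hQ₁eq, hQas.tsum_add hQbs]
  -- ### the four estimates
  have hKato : |∑' k, Qa k| ≤ 2 * Real.pi * Real.sqrt Gsq * Real.sqrt XV * X :=
    abs_tsum_rpow_mul_re_inner_convect_pair_le_of_kernel_le hu₂t (h₂.divFree t htS) hwt hs hGker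
  have h36 : |∑' k, Qb k| ≤ 2 * Real.pi * Real.sqrt Gsq * Real.sqrt X * X :=
    abs_tsum_rpow_mul_re_inner_convect_pair_le_of_kernel_le hwt hdivw hwt hs hGker
  have hTr : |∑' k, Q₂ k| ≤ 2 * Real.pi * (Fintype.card d : ℝ) * (2 : ℝ) ^ (s - 1) *
      (F₀ * Real.sqrt ZV + F₁V * Real.sqrt X) * Real.sqrt X :=
    abs_tsum_rpow_mul_re_inner_convect_transport_le hwt hu₂t hs
  have hFo : |∑' k, Q₃ k| ≤ Real.sqrt Xh * Real.sqrt X :=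
    (summable_and_abs_tsum_rpow_mul_re_inner_le hft hwt hs0.le).2
  rw [hQ₁sum]
  have e1 := neg_abs_le (∑' k, Qa k)
  have e2 := neg_abs_le (∑' k, Qb k)
  have e3 := neg_abs_le (∑' k, Q₂ k)
  have e4 := le_abs_self (∑' k, Q₃ k)
  nlinarith [hKato, h36, hTr, hFo, e1, e2, e3, e4]


end Sharp

/-- **MP Prop. 4.4 (i), sharp-Kato variant**: `Torus.classicalNS_regular_of_sobolev_control`
with the two Kato-type terms bounded through Morosi–Pizzocchero's functional `𝒢_s` (hypothesis
`hGker`: all finite partial sums of `𝒢_s(k)` are `≤ Gsq`; for `s = 3` on `ℤ³` MP certify a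
value with `2π√Gsq ≈ 43`), the transport term through the embedding constants `C₀, C₁` as
before: the control inequality becomes
`R' ≥ −4π²νR + (2π√Gsq·D₀ + 2πn2^{s−1}(C₀D₁ + C₁D₀))R + 2π√Gsq·R² + E`.
[cite: MorosiPizzocchero2015, Prop. 4.4 (i) with Lemma 4.2; MorosiPizzocchero2012Kato, Prop. 3.5] -/
theorem Torus.classicalNS_regular_of_sobolev_control_sharp (hd : Fintype.card d = 3) {ν : ℝ}
    (hν : 0 < ν) {T : ℝ} (hT : 0 < T) {s : ℝ} (hs : 1 ≤ s) {C₀ C₁ : ℝ} (hC₀0 : 0 ≤ C₀)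
    (hC₁0 : 0 ≤ C₁)
    {Gsq : ℝ} (hGker : ∀ (k : d → ℤ) (H : Finset (d → ℤ)), ∑ h ∈ H,
      (freqNormSq h * freqNormSq k - (∑ j, (h j : ℝ) * (k j : ℝ)) ^ 2) *
        (freqNormSq k ^ (s / 2) - freqNormSq (k - h) ^ (s / 2)) ^ 2 /
        (freqNormSq h ^ (s + 1) * freqNormSq (k - h) ^ s) ≤ Gsq)
    (hC₀ : ∀ w : UnitAddTorus d → EuclideanSpace ℝ d, Torus.IsSmooth w → Torus.HasZeroMean w →
      ∑' k : d → ℤ, ‖mFourierCoeff (EuclideanSpace.complexify ∘ w) k‖ ≤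
        C₀ * Real.sqrt (∑' k : d → ℤ, freqNormSq k ^ s *
          ‖mFourierCoeff (EuclideanSpace.complexify ∘ w) k‖ ^ 2))
    (hC₁ : ∀ w : UnitAddTorus d → EuclideanSpace ℝ d, Torus.IsSmooth w → Torus.HasZeroMean w →
      ∑' k : d → ℤ, Real.sqrt (freqNormSq k) * ‖mFourierCoeff (EuclideanSpace.complexify ∘ w) k‖ ≤
        C₁ * Real.sqrt (∑' k : d → ℤ, freqNormSq k ^ s *
          ‖mFourierCoeff (EuclideanSpace.complexify ∘ w) k‖ ^ 2))
    {v g : ℝ → UnitAddTorus d → EuclideanSpace ℝ d} {q : ℝ → UnitAddTorus d → ℝ}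
    (hv : Torus.IsClassicalNSSolutionOn (Icc 0 T) ν g v q)
    (hmv : ∀ t ∈ Icc 0 T, Torus.HasZeroMean (v t))
    {D₀ D₁ E : ℝ → ℝ} (hD₀c : ContinuousOn D₀ (Icc 0 T)) (hD₁c : ContinuousOn D₁ (Icc 0 T))
    (hD₀ : ∀ t ∈ Icc 0 T, Real.sqrt (∑' k : d → ℤ, freqNormSq k ^ s *
      ‖mFourierCoeff (EuclideanSpace.complexify ∘ v t) k‖ ^ 2) ≤ D₀ t)
    (hD₁ : ∀ t ∈ Icc 0 T, Real.sqrt (∑' k : d → ℤ, freqNormSq k ^ (s + 1) *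
      ‖mFourierCoeff (EuclideanSpace.complexify ∘ v t) k‖ ^ 2) ≤ D₁ t)
    (hE : ∀ t ∈ Icc 0 T, Real.sqrt (∑' k : d → ℤ, freqNormSq k ^ s *
      ‖mFourierCoeff (EuclideanSpace.complexify ∘ g t) k‖ ^ 2) ≤ E t)
    {u₀ : UnitAddTorus d → EuclideanSpace ℝ d} (hu₀ : Torus.IsSmooth u₀)
    (hdiv : Torus.IsDivFree u₀) (hmean : Torus.HasZeroMean u₀)
    {R R' : ℝ → ℝ} (hRc : ContinuousOn R (Icc 0 T))
    (hRd : ∀ t ∈ Ico 0 T, HasDerivWithinAt R (R' t) (Ici t) t)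
    (hRge : ∀ t ∈ Ico 0 T,
      -(4 * Real.pi ^ 2 * ν) * R t +
        (2 * Real.pi * Real.sqrt Gsq * D₀ t +
          2 * Real.pi * (Fintype.card d : ℝ) * (2 : ℝ) ^ (s - 1) * (C₀ * D₁ t + C₁ * D₀ t)) * R t +
        2 * Real.pi * Real.sqrt Gsq * R t ^ 2 + E t ≤ R' t)
    (hR0 : Real.sqrt (∑' k : d → ℤ, freqNormSq k ^ s *
      ‖mFourierCoeff (EuclideanSpace.complexify ∘ (fun y => u₀ y - v 0 y)) k‖ ^ 2) ≤ R 0) :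
    ∃ (u : ℝ → UnitAddTorus d → EuclideanSpace ℝ d) (p : ℝ → UnitAddTorus d → ℝ),
      Torus.IsClassicalNSSolutionOn (Icc 0 T) ν 0 u p ∧ u 0 = u₀ ∧
      (∀ t ∈ Icc 0 T, Torus.HasZeroMean (u t)) ∧
      ∀ t ∈ Icc 0 T, Real.sqrt (∑' k : d → ℤ, freqNormSq k ^ s *
        ‖mFourierCoeff (EuclideanSpace.complexify ∘ (fun y => u t y - v t y)) k‖ ^ 2) ≤ R t := by
  classical
  have hs0 : (0 : ℝ) < s := by linarith
  set nn : ℝ := (Fintype.card d : ℝ) with hnn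
  set G : ℝ := 2 * Real.pi * Real.sqrt Gsq with hG
  have hG0 : 0 ≤ G := by rw [hG]; positivity
  set γ : ℝ → ℝ := fun t => 2 * Real.pi * Real.sqrt Gsq * D₀ t +
    2 * Real.pi * nn * (2 : ℝ) ^ (s - 1) * (C₀ * D₁ t + C₁ * D₀ t) with hγ
  have h0T : (0 : ℝ) ∈ Icc 0 T := left_mem_Icc.2 hT.le
  -- bounds for the estimators on `[0, T]`
  have hD₀nn : ∀ t ∈ Icc 0 T, 0 ≤ D₀ t := fun t ht => (Real.sqrt_nonneg _).trans (hD₀ t ht)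
  have hD₁nn : ∀ t ∈ Icc 0 T, 0 ≤ D₁ t := fun t ht => (Real.sqrt_nonneg _).trans (hD₁ t ht)
  have hEnn : ∀ t ∈ Icc 0 T, 0 ≤ E t := fun t ht => (Real.sqrt_nonneg _).trans (hE t ht)
  obtain ⟨Γ, hΓ⟩ : ∃ Γ, ∀ t ∈ Icc 0 T, γ t ≤ Γ := by
    have hγc : ContinuousOn γ (Icc 0 T) :=
      (continuousOn_const.mul hD₀c).add (continuousOn_const.mul
        ((continuousOn_const.mul hD₁c).add (continuousOn_const.mul hD₀c)))
    obtain ⟨M, hM⟩ := isCompact_Icc.bddAbove_image hγc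
    exact ⟨M, fun t ht => hM (mem_image_of_mem γ ht)⟩
  obtain ⟨MR, hMR⟩ : ∃ M, ∀ t ∈ Icc 0 T, R t ≤ M := by
    obtain ⟨M, hM⟩ := isCompact_Icc.bddAbove_image hRc
    exact ⟨M, fun t ht => hM (mem_image_of_mem R ht)⟩
  -- ### the window step: the comparison along any classical solution from `u₀` on `[0, t]`
  have hwindow : ∀ {t : ℝ}, 0 < t → t ≤ T →
      ∀ {u : ℝ → UnitAddTorus d → EuclideanSpace ℝ d} {p : ℝ → UnitAddTorus d → ℝ},
      Torus.IsClassicalNSSolutionOn (Icc 0 t) ν 0 u p → (∀ r ∈ Icc 0 t, Torus.HasZeroMean (u r)) →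
      u 0 = u₀ → ∀ r ∈ Icc 0 t, Real.sqrt (∑' k : d → ℤ, freqNormSq k ^ s *
        ‖mFourierCoeff (EuclideanSpace.complexify ∘ (fun y => u r y - v r y)) k‖ ^ 2) ≤ R r := by
    intro t ht0 htT u p hu hmu hu0
    have hsub : Icc 0 t ⊆ Icc 0 T := Icc_subset_Icc_right htT
    have hvt : Torus.IsClassicalNSSolutionOn (Icc 0 t) ν g v q := hv.mono hsub (uniqueDiffOn_Icc ht0)
    have hw : Torus.IsSmoothSpaceTimeOn (Icc 0 t) (fun τ y => u τ y - v τ y) :=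
      hu.smooth_velocity.sub hvt.smooth_velocity
    set X : ℝ → ℝ := fun r => ∑' k : d → ℤ, freqNormSq k ^ s *
      ‖mFourierCoeff (EuclideanSpace.complexify ∘ (fun y => u r y - v r y)) k‖ ^ 2 with hX
    have hX0 : ∀ r ∈ Icc 0 t, 0 ≤ X r := fun r _ =>
      tsum_nonneg fun k => mul_nonneg (Real.rpow_nonneg (freqNormSq_nonneg k) _) (sq_nonneg _)
    obtain ⟨n, hn⟩ := exists_nat_gt (s + (Fintype.card d : ℝ))
    have hXc : ContinuousOn X (Icc 0 t) :=
      continuousOn_tsum_rpow_mul_norm_sq_of_lt n ht0 hw hs0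
        (by nlinarith [Nat.cast_nonneg (α := ℝ) (Fintype.card d), hs0])
    have hXd : ∀ r ∈ Ioo 0 t, HasDerivAt X (deriv X r) r := by
      intro r hr
      obtain ⟨D, hD, -⟩ := exists_hasDerivAt_tsum_rpow_mul_norm_sq_sub_le_of_kernel_le hu hvt ht0 hs hGker hr
      exact hD.differentiableAt.hasDerivAt
    have hXle : ∀ r ∈ Ioo 0 t, deriv X r ≤ 2 * Real.sqrt (X r) *
        (-(4 * Real.pi ^ 2 * ν) * Real.sqrt (X r) + γ r * Real.sqrt (X r) + G * X r + E r) := by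
      intro r hr
      have hrI : r ∈ Icc 0 T := hsub (Ioo_subset_Icc_self hr)
      have hrt : r ∈ Icc 0 t := Ioo_subset_Icc_self hr
      obtain ⟨D, hD, hDle⟩ := exists_hasDerivAt_tsum_rpow_mul_norm_sq_sub_le_of_kernel_le hu hvt ht0 hs hGker hr
      rw [hD.deriv]
      -- the slices
      have hur : Torus.IsSmooth (u r) := hu.smooth_velocity.isSmooth_slice hrt
      have hvr : Torus.IsSmooth (v r) := hv.smooth_velocity.isSmooth_slice hrI
      have hwr : Torus.IsSmooth (fun y => u r y - v r y) := hur.sub hvr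
      have hmw : Torus.HasZeroMean (fun y => u r y - v r y) := by
        have h1 := hmu r hrt
        have h2 := hmv r hrI
        unfold Torus.HasZeroMean at h1 h2 ⊢
        rw [integral_sub hur.integrable hvr.integrable, h1, h2, sub_zero]
      -- notation
      set c : (d → ℤ) → EuclideanSpace ℂ d :=
        fun k => mFourierCoeff (EuclideanSpace.complexify ∘ (fun y => u r y - v r y)) k with hc
      set cV : (d → ℤ) → EuclideanSpace ℂ d :=
        fun k => mFourierCoeff (EuclideanSpace.complexify ∘ v r) k with hcV
      have hXr : X r = ∑' k, freqNormSq k ^ s * ‖c k‖ ^ 2 := rfl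
      set Z : ℝ := ∑' k, freqNormSq k ^ (s + 1) * ‖c k‖ ^ 2 with hZ
      set XV : ℝ := ∑' k, freqNormSq k ^ s * ‖cV k‖ ^ 2 with hXV
      set ZV : ℝ := ∑' k, freqNormSq k ^ (s + 1) * ‖cV k‖ ^ 2 with hZV
      set F₀ : ℝ := ∑' k, ‖c k‖ with hF₀
      set F₁ : ℝ := ∑' k, Real.sqrt (freqNormSq k) * ‖c k‖ with hF₁
      set F₁V : ℝ := ∑' k, Real.sqrt (freqNormSq k) * ‖cV k‖ with hF₁V
      set Xh : ℝ := ∑' k, freqNormSq k ^ s *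
        ‖mFourierCoeff (EuclideanSpace.complexify ∘
          (fun y => (0 : ℝ → UnitAddTorus d → EuclideanSpace ℝ d) r y - g r y)) k‖ ^ 2 with hXh
      set x : ℝ := Real.sqrt (X r) with hx
      have hx0 : 0 ≤ x := Real.sqrt_nonneg _
      have hXx : X r = x ^ 2 := (Real.sq_sqrt (hX0 r hrt)).symm
      -- the embeddings and the estimators at `r`
      have hF₁le : F₁ ≤ C₁ * x := hC₁ _ hwr hmw
      have hF₀le : F₀ ≤ C₀ * x := hC₀ _ hwr hmw
      have hXVle : Real.sqrt XV ≤ D₀ r := hD₀ r hrI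
      have hZVle : Real.sqrt ZV ≤ D₁ r := hD₁ r hrI
      have hF₁Vle : F₁V ≤ C₁ * D₀ r :=
        (hC₁ _ hvr (hmv r hrI)).trans (mul_le_mul_of_nonneg_left hXVle hC₁0)
      have hXhE : Real.sqrt Xh ≤ E r := by
        have e : Xh = ∑' k, freqNormSq k ^ s *
            ‖mFourierCoeff (EuclideanSpace.complexify ∘ g r) k‖ ^ 2 := by
          refine tsum_congr fun k => ?_
          have hfun : (fun y => (0 : ℝ → UnitAddTorus d → EuclideanSpace ℝ d) r y - g r y) =
              fun y => -g r y := by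
            funext y; simp
          rw [hfun, ci_mFourierCoeff_complexify_neg, norm_neg]
        rw [e]; exact hE r hrI
      have hZX : X r ≤ Z := ci_tsum_rpow_le_tsum_rpow_succ hs0
        (hwr.summable_freqNormSq_rpow_mul_norm_sq (by linarith))
      have hF₀0 : 0 ≤ F₀ := tsum_nonneg fun k => norm_nonneg _
      have hF₁0 : 0 ≤ F₁ := tsum_nonneg fun k => mul_nonneg (Real.sqrt_nonneg _) (norm_nonneg _)
      have hF₁V0 : 0 ≤ F₁V := tsum_nonneg fun k => mul_nonneg (Real.sqrt_nonneg _) (norm_nonneg _)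
      have hD₀r := hD₀nn r hrI
      have hD₁r := hD₁nn r hrI
      -- the four terms
      have hk2 : 0 ≤ 4 * Real.pi * nn * (2 : ℝ) ^ (s - 1) := by positivity
      have hkG : 0 ≤ 4 * Real.pi * Real.sqrt Gsq := by positivity
      have hDle' : D ≤ -(8 * Real.pi ^ 2 * ν) * Z +
          4 * Real.pi * Real.sqrt Gsq * Real.sqrt XV * X r +
          4 * Real.pi * Real.sqrt Gsq * x * X r +
          4 * Real.pi * nn * (2 : ℝ) ^ (s - 1) * (F₀ * Real.sqrt ZV + F₁V * x) * x +
          2 * Real.sqrt Xh * x := hDle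
      have hT1 : Real.sqrt XV * X r ≤ D₀ r * X r := mul_le_mul_of_nonneg_right hXVle (hX0 r hrt)
      have hT3 : F₀ * Real.sqrt ZV + F₁V * x ≤ C₀ * x * D₁ r + C₁ * D₀ r * x := by gcongr
      have hT4 : Real.sqrt Xh * x ≤ E r * x := mul_le_mul_of_nonneg_right hXhE hx0
      have hT0 : -(8 * Real.pi ^ 2 * ν) * Z ≤ -(8 * Real.pi ^ 2 * ν) * X r := by
        have hpos : 0 < 8 * Real.pi ^ 2 * ν := by positivity
        exact mul_le_mul_of_nonpos_left hZX (by linarith)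
      have a1 := mul_le_mul_of_nonneg_left hT1 hkG
      have a3 := mul_le_mul_of_nonneg_left hT3 hk2
      have b3 := mul_le_mul_of_nonneg_right a3 hx0
      calc D ≤ _ := hDle'
        _ ≤ -(8 * Real.pi ^ 2 * ν) * X r +
              4 * Real.pi * Real.sqrt Gsq * (D₀ r * X r) +
              4 * Real.pi * Real.sqrt Gsq * x * X r +
              4 * Real.pi * nn * (2 : ℝ) ^ (s - 1) * (C₀ * x * D₁ r + C₁ * D₀ r * x) * x +
              2 * (E r * x) := by linarith [hT0, a1, b3, hT4]
        _ = 2 * x * (-(4 * Real.pi ^ 2 * ν) * x + γ r * x + G * X r + E r) := by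
            simp only [hγ, hG, hXx]
            ring
    exact sqrt_le_of_control_inequality (X := X) (X' := deriv X) (R := R) (R' := R')
      (γ := γ) (ε := E) (lam := 4 * Real.pi ^ 2 * ν) (G := G) ht0 hG0 hXc hXd hX0 hXle
      (hRc.mono hsub) (fun r hr => hRd r ⟨hr.1, lt_of_lt_of_le hr.2 htT⟩)
      (fun r hr => hRge r ⟨hr.1, lt_of_lt_of_le hr.2 htT⟩)
      (fun r hr => hEnn r ⟨hr.1, hr.2.le.trans htT⟩) ⟨Γ, fun r hr => hΓ r ⟨hr.1, hr.2.le.trans htT⟩⟩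
      (by
        show Real.sqrt (∑' k : d → ℤ, freqNormSq k ^ s *
          ‖mFourierCoeff (EuclideanSpace.complexify ∘ (fun y => u 0 y - v 0 y)) k‖ ^ 2) ≤ R 0
        rw [hu0]; exact hR0)
  -- ### a uniform bound for `‖∇v‖₂²` on `[0, T]`
  obtain ⟨Gv, hGv⟩ : ∃ Gv : ℝ, ∀ r ∈ Icc 0 T, Torus.gradNormSq (v r) ≤ Gv := by
    have hcont : ContinuousOn (fun r => Torus.gradNormSq (v r)) (Icc 0 T) := by
      intro r hr
      have h := (hv.hasDerivWithinAt_half_gradNormSq hT hr).continuousWithinAt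
      have h2 : ContinuousWithinAt (fun s => (2 : ℝ) * (2⁻¹ * Torus.gradNormSq (v s))) (Icc 0 T) r :=
        continuousWithinAt_const.mul h
      exact h2.congr (fun s _ => by ring) (by ring)
    obtain ⟨r₀, -, hmax⟩ := isCompact_Icc.exists_isMaxOn (nonempty_Icc.2 hT.le) hcont
    exact ⟨Torus.gradNormSq (v r₀), fun r hr => (isMaxOn_iff.1 hmax) r hr⟩
  -- ### the maximal solution from `u₀`
  obtain ⟨u, p, hu0, hcases⟩ := Torus.exists_maximal_classicalNS hd hν hu₀ hdiv hmean
  have finish : Torus.IsClassicalNSSolutionOn (Icc 0 T) ν 0 u p →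
      (∀ t ∈ Icc 0 T, Torus.HasZeroMean (u t)) →
      ∃ (u : ℝ → UnitAddTorus d → EuclideanSpace ℝ d) (p : ℝ → UnitAddTorus d → ℝ),
        Torus.IsClassicalNSSolutionOn (Icc 0 T) ν 0 u p ∧ u 0 = u₀ ∧
        (∀ t ∈ Icc 0 T, Torus.HasZeroMean (u t)) ∧
        ∀ t ∈ Icc 0 T, Real.sqrt (∑' k : d → ℤ, freqNormSq k ^ s *
          ‖mFourierCoeff (EuclideanSpace.complexify ∘ (fun y => u t y - v t y)) k‖ ^ 2) ≤ R t :=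
    fun hvT hmvT => ⟨u, p, hvT, hu0, hmvT, hwindow hT le_rfl hvT hmvT hu0⟩
  rcases hcases with ⟨hU, hmU, -⟩ | ⟨Tu, hTu, hU, hmU, hunb, -⟩
  · -- global
    exact finish (hU.mono (fun r hr => mem_Ici.2 hr.1) (uniqueDiffOn_Icc hT))
      (fun t ht => hmU t ht.1)
  · rcases lt_or_ge T Tu with hTlt | hTge
    · -- the blow-up time is beyond `T`
      exact finish (hU.mono (fun r hr => ⟨hr.1, lt_of_le_of_lt hr.2 hTlt⟩) (uniqueDiffOn_Icc hT))
        (fun t ht => hmU t ⟨ht.1, lt_of_le_of_lt ht.2 hTlt⟩)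
    · -- blow-up at `Tu ≤ T` is impossible: `‖∇u‖₂²` stays bounded on `[0, Tu)`
      exfalso
      refine hunb ⟨2 * Gv + 2 * (4 * Real.pi ^ 2 * (2 * (|MR| ^ 2 + |R 0| ^ 2))) +
        2 * Torus.gradNormSq u₀, ?_⟩
      rintro _ ⟨r, hr, rfl⟩
      have hrI : r ∈ Icc 0 T := ⟨hr.1, (le_of_lt hr.2).trans hTge⟩
      have hur : Torus.IsSmooth (u r) := hU.smooth_velocity.isSmooth_slice hr
      have hvr : Torus.IsSmooth (v r) := hv.smooth_velocity.isSmooth_slice hrI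
      have hwr : Torus.IsSmooth (fun y => u r y - v r y) := hur.sub hvr
      -- `√X_w(r) ≤ R r` on the window `[0, r]` (or `r = 0`)
      have hXR : Real.sqrt (∑' k : d → ℤ, freqNormSq k ^ s *
          ‖mFourierCoeff (EuclideanSpace.complexify ∘ (fun y => u r y - v r y)) k‖ ^ 2) ≤ |MR| + |R 0| := by
        rcases eq_or_lt_of_le hr.1 with h0r | h0r
        · rw [← h0r, hu0]
          exact hR0.trans ((le_abs_self _).trans (by linarith [abs_nonneg MR]))
        · have hUr : Torus.IsClassicalNSSolutionOn (Icc 0 r) ν 0 u p :=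
            hU.mono (fun x hx => ⟨hx.1, lt_of_le_of_lt hx.2 hr.2⟩) (uniqueDiffOn_Icc h0r)
          have h1 := hwindow h0r hrI.2 hUr (fun x hx => hmU x ⟨hx.1, lt_of_le_of_lt hx.2 hr.2⟩) hu0
            r (right_mem_Icc.2 h0r.le)
          exact h1.trans ((hMR r hrI).trans ((le_abs_self _).trans (by linarith [abs_nonneg (R 0)])))
      have hgw : Torus.gradNormSq (fun y => u r y - v r y) ≤
          4 * Real.pi ^ 2 * (2 * (|MR| ^ 2 + |R 0| ^ 2)) := by
        have h1 := ci_gradNormSq_le_tsum_rpow hwr hs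
        set Xr : ℝ := ∑' k : d → ℤ, freqNormSq k ^ s *
          ‖mFourierCoeff (EuclideanSpace.complexify ∘ (fun y => u r y - v r y)) k‖ ^ 2 with hXr
        have hXr0 : 0 ≤ Xr := tsum_nonneg fun k =>
          mul_nonneg (Real.rpow_nonneg (freqNormSq_nonneg k) _) (sq_nonneg _)
        have h2 : Xr ≤ (|MR| + |R 0|) ^ 2 := by
          calc Xr = Real.sqrt Xr ^ 2 := (Real.sq_sqrt hXr0).symm
            _ ≤ (|MR| + |R 0|) ^ 2 := pow_le_pow_left₀ (Real.sqrt_nonneg _) hXR 2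
        have h3 : (|MR| + |R 0|) ^ 2 ≤ 2 * (|MR| ^ 2 + |R 0| ^ 2) := by
          nlinarith [sq_nonneg (|MR| - |R 0|)]
        have hpi : 0 ≤ 4 * Real.pi ^ 2 := by positivity
        exact h1.trans (mul_le_mul_of_nonneg_left (h2.trans h3) hpi)
      have hsplit : u r = v r + fun y => u r y - v r y := by
        funext y; simp
      show Torus.gradNormSq (u r) ≤ 2 * Gv + 2 * (4 * Real.pi ^ 2 * (2 * (|MR| ^ 2 + |R 0| ^ 2))) +
        2 * Torus.gradNormSq u₀
      rw [hsplit]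
      refine (Torus.gradNormSq_add_le hvr hwr).trans ?_
      have h1 := hGv r hrI
      have h3 : 0 ≤ Torus.gradNormSq u₀ := Torus.gradNormSq_nonneg _
      linarith

/-! ### §12 Morosi–Pizzocchero's own shape `γ = G_n 𝒟_n + K_n 𝒟_{n+1}`: both sharp functionals,
and their elementary evaluation -/

section Kernels

variable {ν a b : ℝ} {f₁ f₂ u₁ u₂ : ℝ → UnitAddTorus d → EuclideanSpace ℝ d}
  {p₁ p₂ : ℝ → UnitAddTorus d → ℝ}

/-- **The `Ḣ^s` differential inequality for the difference, in Morosi–Pizzocchero's shape** (MP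
2015 Lemma 4.2 (4.4)–(4.8) — "`d⁺/dt ‖u − u_a‖_n ≤ −ν‖u − u_a‖_n + (G_n‖u_a‖_n +
K_n‖u_a‖_{n+1})‖u − u_a‖_n + G_n‖u − u_a‖_n² + ε_n`" — with the two Kato terms bounded through
MP's functional `𝒢_s` and the transport term through MP's functional `𝒦_s`,
`NSSobolev.abs_tsum_rpow_mul_re_inner_convect_transport_le_of_kernel_le`): for two classical
mean-zero solutions with `Gsq`, `Ksq` bounding the partial sums of `𝒢_s(k)`, `𝒦_s(k)` for every `k`,
`D ≤ −8π²ν Z_w + 4π√Gsq X_{u₂}^{1/2} X_w + 4π√Gsq X_w^{3/2} + 4π√Ksq Z_{u₂}^{1/2} X_w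
   + 2 X_h^{1/2} X_w^{1/2}` (`Z = ‖·‖²_{Ḣ^{s+1}}`, `X = ‖·‖²_{Ḣ^s}`, `h = f₁ − f₂`).
[cite: MorosiPizzocchero2015, Lemma 4.2 (4.4)–(4.8); MorosiPizzocchero2012Approx, Lemma 4.2; MorosiPizzocchero2012Kato, Prop. 3.5; MorosiPizzocchero2013Basic, Prop. 3.7] -/
theorem NSSobolev.exists_hasDerivAt_tsum_rpow_mul_norm_sq_sub_le_of_kernels_le
    (h₁ : Torus.IsClassicalNSSolutionOn (Icc a b) ν f₁ u₁ p₁)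
    (h₂ : Torus.IsClassicalNSSolutionOn (Icc a b) ν f₂ u₂ p₂) (hab : a < b)
    (hm₁ : ∀ τ ∈ Icc a b, Torus.HasZeroMean (u₁ τ)) (hm₂ : ∀ τ ∈ Icc a b, Torus.HasZeroMean (u₂ τ))
    {s : ℝ} (hs : 1 ≤ s)
    {Gsq : ℝ} (hGker : ∀ (k : d → ℤ) (H : Finset (d → ℤ)), ∑ h ∈ H,
      (freqNormSq h * freqNormSq k - (∑ j, (h j : ℝ) * (k j : ℝ)) ^ 2) *
        (freqNormSq k ^ (s / 2) - freqNormSq (k - h) ^ (s / 2)) ^ 2 /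
        (freqNormSq h ^ (s + 1) * freqNormSq (k - h) ^ s) ≤ Gsq)
    {Ksq : ℝ} (hKker : ∀ (k : d → ℤ) (H : Finset (d → ℤ)), ∑ h ∈ H,
      freqNormSq k ^ s * (freqNormSq h * freqNormSq k - (∑ j, (h j : ℝ) * (k j : ℝ)) ^ 2) /
        (freqNormSq h ^ (s + 1) * freqNormSq (k - h) ^ (s + 1)) ≤ Ksq)
    {t : ℝ} (ht : t ∈ Ioo a b) :
    ∃ D : ℝ, HasDerivAt (fun τ => ∑' k : d → ℤ, freqNormSq k ^ s *
        ‖mFourierCoeff (EuclideanSpace.complexify ∘ (fun y => u₁ τ y - u₂ τ y)) k‖ ^ 2) D t ∧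
      D ≤ -(8 * Real.pi ^ 2 * ν) * (∑' k : d → ℤ, freqNormSq k ^ (s + 1) *
            ‖mFourierCoeff (EuclideanSpace.complexify ∘ (fun y => u₁ t y - u₂ t y)) k‖ ^ 2) +
        4 * Real.pi * Real.sqrt Gsq *
          Real.sqrt (∑' k : d → ℤ, freqNormSq k ^ s *
              ‖mFourierCoeff (EuclideanSpace.complexify ∘ u₂ t) k‖ ^ 2) *
          (∑' k : d → ℤ, freqNormSq k ^ s *
              ‖mFourierCoeff (EuclideanSpace.complexify ∘ (fun y => u₁ t y - u₂ t y)) k‖ ^ 2) +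
        4 * Real.pi * Real.sqrt Gsq *
          Real.sqrt (∑' k : d → ℤ, freqNormSq k ^ s *
              ‖mFourierCoeff (EuclideanSpace.complexify ∘ (fun y => u₁ t y - u₂ t y)) k‖ ^ 2) *
          (∑' k : d → ℤ, freqNormSq k ^ s *
              ‖mFourierCoeff (EuclideanSpace.complexify ∘ (fun y => u₁ t y - u₂ t y)) k‖ ^ 2) +
        4 * Real.pi * Real.sqrt Ksq *
          (∑' k : d → ℤ, freqNormSq k ^ s *
              ‖mFourierCoeff (EuclideanSpace.complexify ∘ (fun y => u₁ t y - u₂ t y)) k‖ ^ 2) *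
          Real.sqrt (∑' k : d → ℤ, freqNormSq k ^ (s + 1) *
              ‖mFourierCoeff (EuclideanSpace.complexify ∘ u₂ t) k‖ ^ 2) +
        2 * Real.sqrt (∑' k : d → ℤ, freqNormSq k ^ s *
              ‖mFourierCoeff (EuclideanSpace.complexify ∘ (fun y => f₁ t y - f₂ t y)) k‖ ^ 2) *
          Real.sqrt (∑' k : d → ℤ, freqNormSq k ^ s *
              ‖mFourierCoeff (EuclideanSpace.complexify ∘ (fun y => u₁ t y - u₂ t y)) k‖ ^ 2) := by
  classical
  have hs0 : (0 : ℝ) < s := by linarith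
  have htS : t ∈ Icc a b := Ioo_subset_Icc_self ht
  have hu₁t : IsSmooth (u₁ t) := h₁.smooth_velocity.isSmooth_slice htS
  have hu₂t : IsSmooth (u₂ t) := h₂.smooth_velocity.isSmooth_slice htS
  have hwt : IsSmooth (fun y => u₁ t y - u₂ t y) := hu₁t.sub hu₂t
  have hft : IsSmooth (fun y => f₁ t y - f₂ t y) :=
    (h₁.isSmooth_force_slice hab htS).sub (h₂.isSmooth_force_slice hab htS)
  have hc1 : IsSmooth (Torus.convect (u₁ t) (fun y => u₁ t y - u₂ t y)) := hu₁t.convect hwt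
  have hc2 : IsSmooth (Torus.convect (fun y => u₁ t y - u₂ t y) (u₂ t)) := hwt.convect hu₂t
  have hc3 : IsSmooth (Torus.convect (u₂ t) (fun y => u₁ t y - u₂ t y)) := hu₂t.convect hwt
  have hc4 : IsSmooth (Torus.convect (fun y => u₁ t y - u₂ t y) (fun y => u₁ t y - u₂ t y)) :=
    hwt.convect hwt
  have hdivw : IsDivFree (fun y => u₁ t y - u₂ t y) := by
    intro x
    have hw' : (fun y => u₁ t y - u₂ t y) = u₁ t - u₂ t := rfl
    rw [hw', Torus.divergence_sub (hu₁t.isContDiff (by simp)) (hu₂t.isContDiff (by simp)),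
      h₁.divFree t htS x, h₂.divFree t htS x, sub_zero]
  have hmw : Torus.HasZeroMean (fun y => u₁ t y - u₂ t y) := by
    have e1 := hm₁ t htS
    have e2 := hm₂ t htS
    unfold Torus.HasZeroMean at e1 e2 ⊢
    rw [integral_sub hu₁t.integrable hu₂t.integrable, e1, e2, sub_zero]
  refine ⟨_, hasDerivAt_tsum_rpow_mul_norm_sq_sub_two_forces h₁ h₂ hab hs0 ht, ?_⟩
  -- notation
  set c : (d → ℤ) → EuclideanSpace ℂ d :=
    fun k => mFourierCoeff (EuclideanSpace.complexify ∘ (fun y => u₁ t y - u₂ t y)) k with hc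
  set cV : (d → ℤ) → EuclideanSpace ℂ d :=
    fun k => mFourierCoeff (EuclideanSpace.complexify ∘ u₂ t) k with hcV
  set X : ℝ := ∑' k, freqNormSq k ^ s * ‖c k‖ ^ 2 with hX
  set Z : ℝ := ∑' k, freqNormSq k ^ (s + 1) * ‖c k‖ ^ 2 with hZ
  set XV : ℝ := ∑' k, freqNormSq k ^ s * ‖cV k‖ ^ 2 with hXV
  set ZV : ℝ := ∑' k, freqNormSq k ^ (s + 1) * ‖cV k‖ ^ 2 with hZV
  set Xh : ℝ := ∑' k, freqNormSq k ^ s *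
    ‖mFourierCoeff (EuclideanSpace.complexify ∘ (fun y => f₁ t y - f₂ t y)) k‖ ^ 2 with hXh
  set Q₁ : (d → ℤ) → ℝ := fun k => freqNormSq k ^ s *
    (inner ℂ (mFourierCoeff (EuclideanSpace.complexify ∘
      Torus.convect (u₁ t) (fun y => u₁ t y - u₂ t y)) k) (c k)).re with hQ₁
  set Q₂ : (d → ℤ) → ℝ := fun k => freqNormSq k ^ s *
    (inner ℂ (mFourierCoeff (EuclideanSpace.complexify ∘
      Torus.convect (fun y => u₁ t y - u₂ t y) (u₂ t)) k) (c k)).re with hQ₂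
  set Q₃ : (d → ℤ) → ℝ := fun k => freqNormSq k ^ s *
    (inner ℂ (mFourierCoeff (EuclideanSpace.complexify ∘ (fun y => f₁ t y - f₂ t y)) k) (c k)).re
    with hQ₃
  set Qa : (d → ℤ) → ℝ := fun k => freqNormSq k ^ s *
    (inner ℂ (mFourierCoeff (EuclideanSpace.complexify ∘
      Torus.convect (u₂ t) (fun y => u₁ t y - u₂ t y)) k) (c k)).re with hQa
  set Qb : (d → ℤ) → ℝ := fun k => freqNormSq k ^ s *
    (inner ℂ (mFourierCoeff (EuclideanSpace.complexify ∘
      Torus.convect (fun y => u₁ t y - u₂ t y) (fun y => u₁ t y - u₂ t y)) k) (c k)).re with hQb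
  show -(8 * Real.pi ^ 2 * ν) * Z - 2 * (∑' k, Q₁ k) - 2 * (∑' k, Q₂ k) + 2 * (∑' k, Q₃ k) ≤
    -(8 * Real.pi ^ 2 * ν) * Z +
      4 * Real.pi * Real.sqrt Gsq * Real.sqrt XV * X +
      4 * Real.pi * Real.sqrt Gsq * Real.sqrt X * X +
      4 * Real.pi * Real.sqrt Ksq * X * Real.sqrt ZV +
      2 * Real.sqrt Xh * Real.sqrt X
  -- ### the advection split `(u₁·∇)w = (u₂·∇)w + (w·∇)w`
  have hQas : Summable Qa := (summable_and_abs_tsum_rpow_mul_re_inner_le hc3 hwt hs0.le).1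
  have hQbs : Summable Qb := (summable_and_abs_tsum_rpow_mul_re_inner_le hc4 hwt hs0.le).1
  have hsplit_fun : Torus.convect (u₁ t) (fun y => u₁ t y - u₂ t y) =
      fun x => Torus.convect (u₂ t) (fun y => u₁ t y - u₂ t y) x +
        Torus.convect (fun y => u₁ t y - u₂ t y) (fun y => u₁ t y - u₂ t y) x := by
    funext x
    have hu : u₁ t = fun y => u₂ t y + (u₁ t y - u₂ t y) := by
      funext y; simp
    conv_lhs => rw [hu]
    simp [Torus.convect]
  have hQ₁eq : ∀ k, Q₁ k = Qa k + Qb k := by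
    intro k
    simp only [hQ₁, hQa, hQb]
    rw [hsplit_fun]
    have hi3 : Integrable (EuclideanSpace.complexify ∘
        Torus.convect (u₂ t) (fun y => u₁ t y - u₂ t y)) volume :=
      integrable_complexify_comp hc3.integrable
    have hi4 : Integrable (EuclideanSpace.complexify ∘
        Torus.convect (fun y => u₁ t y - u₂ t y) (fun y => u₁ t y - u₂ t y)) volume :=
      integrable_complexify_comp hc4.integrable
    have hcomp : (EuclideanSpace.complexify ∘ fun x =>
        Torus.convect (u₂ t) (fun y => u₁ t y - u₂ t y) x +
          Torus.convect (fun y => u₁ t y - u₂ t y) (fun y => u₁ t y - u₂ t y) x) =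
        (EuclideanSpace.complexify ∘ Torus.convect (u₂ t) (fun y => u₁ t y - u₂ t y)) +
          (EuclideanSpace.complexify ∘
            Torus.convect (fun y => u₁ t y - u₂ t y) (fun y => u₁ t y - u₂ t y)) := by
      funext x
      simp only [Function.comp_apply, Pi.add_apply, map_add]
    rw [hcomp, mFourierCoeff_add hi3 hi4, inner_add_left, Complex.add_re, mul_add]
  have hQ₁sum : ∑' k, Q₁ k = ∑' k, Qa k + ∑' k, Qb k := by
    rw [tsum_congr hQ₁eq, hQas.tsum_add hQbs]
  -- ### the four estimates
  have hKato : |∑' k, Qa k| ≤ 2 * Real.pi * Real.sqrt Gsq * Real.sqrt XV * X :=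
    abs_tsum_rpow_mul_re_inner_convect_pair_le_of_kernel_le hu₂t (h₂.divFree t htS) hwt hs hGker
  have h36 : |∑' k, Qb k| ≤ 2 * Real.pi * Real.sqrt Gsq * Real.sqrt X * X :=
    abs_tsum_rpow_mul_re_inner_convect_pair_le_of_kernel_le hwt hdivw hwt hs hGker
  have hTr : |∑' k, Q₂ k| ≤ 2 * Real.pi * Real.sqrt Ksq * X * Real.sqrt ZV :=
    abs_tsum_rpow_mul_re_inner_convect_transport_le_of_kernel_le hwt hdivw hmw hu₂t hs hKker
  have hFo : |∑' k, Q₃ k| ≤ Real.sqrt Xh * Real.sqrt X :=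
    (summable_and_abs_tsum_rpow_mul_re_inner_le hft hwt hs0.le).2
  rw [hQ₁sum]
  have e1 := neg_abs_le (∑' k, Qa k)
  have e2 := neg_abs_le (∑' k, Qb k)
  have e3 := neg_abs_le (∑' k, Q₂ k)
  have e4 := le_abs_self (∑' k, Q₃ k)
  nlinarith [hKato, h36, hTr, hFo, e1, e2, e3, e4]

end Kernels

/-- **MP Prop. 4.4 (i) in Morosi–Pizzocchero's own shape**: the control inequality
`R' ≥ −4π²νR + (G·D₀ + K·D₁)R + G·R² + E` with `G = 2π√Gsq`, `K = 2π√Ksq`, `Gsq` and `Ksq` bounding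
the partial sums of MP's functionals `𝒢_s(k)` (Kato, CPAA 2012 Prop. 3.5) and `𝒦_s(k)` (basic
inequality, Appl. Math. Lett. 2013 Prop. 3.7) — exactly "`Ṙ_n ≥ −νR_n + (G_n𝒟_n + K_n𝒟_{n+1})R_n +
G_nR_n² + ε_n`" of MP 2015 Prop. 4.4 (i), for classical mean-zero solutions on the unit torus
(`card d = 3`, `ν > 0`, `s ≥ 1`, window `[0, T]`): if `R` is continuous on `[0, T]` with such right
derivatives on `[0, T)` and `R(0) ≥ ‖u₀ − v(0)‖_s`, the classical solution from `u₀` exists on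
`[0, T]` and `‖u(t) − v(t)‖_s ≤ R(t)`. No Wiener–Sobolev embedding constant enters. (With MP's
certified values on `(ℝ/2πℤ)³`, `n = 3`: `G = (2π)^{5/2}·0.438`, `K = (2π)^{5/2}·0.323` in this
normalisation; the evaluation of the two suprema is the pair of hypotheses `hGker`, `hKker`.)
[cite: MorosiPizzocchero2015, Prop. 4.4 (i) with Lemma 4.2; MorosiPizzocchero2012Approx, Prop. 4.3; MorosiPizzocchero2012Kato, Prop. 3.5; MorosiPizzocchero2013Basic, Prop. 3.7] -/
theorem Torus.classicalNS_regular_of_sobolev_control_kernels (hd : Fintype.card d = 3) {ν : ℝ}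
    (hν : 0 < ν) {T : ℝ} (hT : 0 < T) {s : ℝ} (hs : 1 ≤ s)
    {Gsq : ℝ} (hGker : ∀ (k : d → ℤ) (H : Finset (d → ℤ)), ∑ h ∈ H,
      (freqNormSq h * freqNormSq k - (∑ j, (h j : ℝ) * (k j : ℝ)) ^ 2) *
        (freqNormSq k ^ (s / 2) - freqNormSq (k - h) ^ (s / 2)) ^ 2 /
        (freqNormSq h ^ (s + 1) * freqNormSq (k - h) ^ s) ≤ Gsq)
    {Ksq : ℝ} (hKker : ∀ (k : d → ℤ) (H : Finset (d → ℤ)), ∑ h ∈ H,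
      freqNormSq k ^ s * (freqNormSq h * freqNormSq k - (∑ j, (h j : ℝ) * (k j : ℝ)) ^ 2) /
        (freqNormSq h ^ (s + 1) * freqNormSq (k - h) ^ (s + 1)) ≤ Ksq)
    {v g : ℝ → UnitAddTorus d → EuclideanSpace ℝ d} {q : ℝ → UnitAddTorus d → ℝ}
    (hv : Torus.IsClassicalNSSolutionOn (Icc 0 T) ν g v q)
    (hmv : ∀ t ∈ Icc 0 T, Torus.HasZeroMean (v t))
    {D₀ D₁ E : ℝ → ℝ} (hD₀c : ContinuousOn D₀ (Icc 0 T)) (hD₁c : ContinuousOn D₁ (Icc 0 T))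
    (hD₀ : ∀ t ∈ Icc 0 T, Real.sqrt (∑' k : d → ℤ, freqNormSq k ^ s *
      ‖mFourierCoeff (EuclideanSpace.complexify ∘ v t) k‖ ^ 2) ≤ D₀ t)
    (hD₁ : ∀ t ∈ Icc 0 T, Real.sqrt (∑' k : d → ℤ, freqNormSq k ^ (s + 1) *
      ‖mFourierCoeff (EuclideanSpace.complexify ∘ v t) k‖ ^ 2) ≤ D₁ t)
    (hE : ∀ t ∈ Icc 0 T, Real.sqrt (∑' k : d → ℤ, freqNormSq k ^ s *
      ‖mFourierCoeff (EuclideanSpace.complexify ∘ g t) k‖ ^ 2) ≤ E t)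
    {u₀ : UnitAddTorus d → EuclideanSpace ℝ d} (hu₀ : Torus.IsSmooth u₀)
    (hdiv : Torus.IsDivFree u₀) (hmean : Torus.HasZeroMean u₀)
    {R R' : ℝ → ℝ} (hRc : ContinuousOn R (Icc 0 T))
    (hRd : ∀ t ∈ Ico 0 T, HasDerivWithinAt R (R' t) (Ici t) t)
    (hRge : ∀ t ∈ Ico 0 T,
      -(4 * Real.pi ^ 2 * ν) * R t +
        (2 * Real.pi * Real.sqrt Gsq * D₀ t + 2 * Real.pi * Real.sqrt Ksq * D₁ t) * R t +
        2 * Real.pi * Real.sqrt Gsq * R t ^ 2 + E t ≤ R' t)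
    (hR0 : Real.sqrt (∑' k : d → ℤ, freqNormSq k ^ s *
      ‖mFourierCoeff (EuclideanSpace.complexify ∘ (fun y => u₀ y - v 0 y)) k‖ ^ 2) ≤ R 0) :
    ∃ (u : ℝ → UnitAddTorus d → EuclideanSpace ℝ d) (p : ℝ → UnitAddTorus d → ℝ),
      Torus.IsClassicalNSSolutionOn (Icc 0 T) ν 0 u p ∧ u 0 = u₀ ∧
      (∀ t ∈ Icc 0 T, Torus.HasZeroMean (u t)) ∧
      ∀ t ∈ Icc 0 T, Real.sqrt (∑' k : d → ℤ, freqNormSq k ^ s *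
        ‖mFourierCoeff (EuclideanSpace.complexify ∘ (fun y => u t y - v t y)) k‖ ^ 2) ≤ R t := by
  classical
  have hs0 : (0 : ℝ) < s := by linarith
  set G : ℝ := 2 * Real.pi * Real.sqrt Gsq with hG
  have hG0 : 0 ≤ G := by rw [hG]; positivity
  set γ : ℝ → ℝ := fun t => 2 * Real.pi * Real.sqrt Gsq * D₀ t + 2 * Real.pi * Real.sqrt Ksq * D₁ t
    with hγ
  have h0T : (0 : ℝ) ∈ Icc 0 T := left_mem_Icc.2 hT.le
  -- bounds for the estimators on `[0, T]`
  have hD₀nn : ∀ t ∈ Icc 0 T, 0 ≤ D₀ t := fun t ht => (Real.sqrt_nonneg _).trans (hD₀ t ht)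
  have hD₁nn : ∀ t ∈ Icc 0 T, 0 ≤ D₁ t := fun t ht => (Real.sqrt_nonneg _).trans (hD₁ t ht)
  have hEnn : ∀ t ∈ Icc 0 T, 0 ≤ E t := fun t ht => (Real.sqrt_nonneg _).trans (hE t ht)
  obtain ⟨Γ, hΓ⟩ : ∃ Γ, ∀ t ∈ Icc 0 T, γ t ≤ Γ := by
    have hγc : ContinuousOn γ (Icc 0 T) :=
      (continuousOn_const.mul hD₀c).add (continuousOn_const.mul hD₁c)
    obtain ⟨M, hM⟩ := isCompact_Icc.bddAbove_image hγc
    exact ⟨M, fun t ht => hM (mem_image_of_mem γ ht)⟩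
  obtain ⟨MR, hMR⟩ : ∃ M, ∀ t ∈ Icc 0 T, R t ≤ M := by
    obtain ⟨M, hM⟩ := isCompact_Icc.bddAbove_image hRc
    exact ⟨M, fun t ht => hM (mem_image_of_mem R ht)⟩
  -- ### the window step: the comparison along any classical solution from `u₀` on `[0, t]`
  have hwindow : ∀ {t : ℝ}, 0 < t → t ≤ T →
      ∀ {u : ℝ → UnitAddTorus d → EuclideanSpace ℝ d} {p : ℝ → UnitAddTorus d → ℝ},
      Torus.IsClassicalNSSolutionOn (Icc 0 t) ν 0 u p → (∀ r ∈ Icc 0 t, Torus.HasZeroMean (u r)) →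
      u 0 = u₀ → ∀ r ∈ Icc 0 t, Real.sqrt (∑' k : d → ℤ, freqNormSq k ^ s *
        ‖mFourierCoeff (EuclideanSpace.complexify ∘ (fun y => u r y - v r y)) k‖ ^ 2) ≤ R r := by
    intro t ht0 htT u p hu hmu hu0
    have hsub : Icc 0 t ⊆ Icc 0 T := Icc_subset_Icc_right htT
    have hvt : Torus.IsClassicalNSSolutionOn (Icc 0 t) ν g v q := hv.mono hsub (uniqueDiffOn_Icc ht0)
    have hmvt : ∀ r ∈ Icc 0 t, Torus.HasZeroMean (v r) := fun r hr => hmv r (hsub hr)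
    have hw : Torus.IsSmoothSpaceTimeOn (Icc 0 t) (fun τ y => u τ y - v τ y) :=
      hu.smooth_velocity.sub hvt.smooth_velocity
    set X : ℝ → ℝ := fun r => ∑' k : d → ℤ, freqNormSq k ^ s *
      ‖mFourierCoeff (EuclideanSpace.complexify ∘ (fun y => u r y - v r y)) k‖ ^ 2 with hX
    have hX0 : ∀ r ∈ Icc 0 t, 0 ≤ X r := fun r _ =>
      tsum_nonneg fun k => mul_nonneg (Real.rpow_nonneg (freqNormSq_nonneg k) _) (sq_nonneg _)
    obtain ⟨n, hn⟩ := exists_nat_gt (s + (Fintype.card d : ℝ))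
    have hXc : ContinuousOn X (Icc 0 t) :=
      continuousOn_tsum_rpow_mul_norm_sq_of_lt n ht0 hw hs0
        (by nlinarith [Nat.cast_nonneg (α := ℝ) (Fintype.card d), hs0])
    have hXd : ∀ r ∈ Ioo 0 t, HasDerivAt X (deriv X r) r := by
      intro r hr
      obtain ⟨D, hD, -⟩ := exists_hasDerivAt_tsum_rpow_mul_norm_sq_sub_le_of_kernels_le hu hvt ht0
        hmu hmvt hs hGker hKker hr
      exact hD.differentiableAt.hasDerivAt
    have hXle : ∀ r ∈ Ioo 0 t, deriv X r ≤ 2 * Real.sqrt (X r) *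
        (-(4 * Real.pi ^ 2 * ν) * Real.sqrt (X r) + γ r * Real.sqrt (X r) + G * X r + E r) := by
      intro r hr
      have hrI : r ∈ Icc 0 T := hsub (Ioo_subset_Icc_self hr)
      have hrt : r ∈ Icc 0 t := Ioo_subset_Icc_self hr
      obtain ⟨D, hD, hDle⟩ := exists_hasDerivAt_tsum_rpow_mul_norm_sq_sub_le_of_kernels_le hu hvt
        ht0 hmu hmvt hs hGker hKker hr
      rw [hD.deriv]
      -- the slices
      have hur : Torus.IsSmooth (u r) := hu.smooth_velocity.isSmooth_slice hrt
      have hvr : Torus.IsSmooth (v r) := hv.smooth_velocity.isSmooth_slice hrI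
      have hwr : Torus.IsSmooth (fun y => u r y - v r y) := hur.sub hvr
      -- notation
      set c : (d → ℤ) → EuclideanSpace ℂ d :=
        fun k => mFourierCoeff (EuclideanSpace.complexify ∘ (fun y => u r y - v r y)) k with hc
      set cV : (d → ℤ) → EuclideanSpace ℂ d :=
        fun k => mFourierCoeff (EuclideanSpace.complexify ∘ v r) k with hcV
      have hXr : X r = ∑' k, freqNormSq k ^ s * ‖c k‖ ^ 2 := rfl
      set Z : ℝ := ∑' k, freqNormSq k ^ (s + 1) * ‖c k‖ ^ 2 with hZ
      set XV : ℝ := ∑' k, freqNormSq k ^ s * ‖cV k‖ ^ 2 with hXV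
      set ZV : ℝ := ∑' k, freqNormSq k ^ (s + 1) * ‖cV k‖ ^ 2 with hZV
      set Xh : ℝ := ∑' k, freqNormSq k ^ s *
        ‖mFourierCoeff (EuclideanSpace.complexify ∘
          (fun y => (0 : ℝ → UnitAddTorus d → EuclideanSpace ℝ d) r y - g r y)) k‖ ^ 2 with hXh
      set x : ℝ := Real.sqrt (X r) with hx
      have hx0 : 0 ≤ x := Real.sqrt_nonneg _
      have hXx : X r = x ^ 2 := (Real.sq_sqrt (hX0 r hrt)).symm
      -- the estimators at `r`
      have hXVle : Real.sqrt XV ≤ D₀ r := hD₀ r hrI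
      have hZVle : Real.sqrt ZV ≤ D₁ r := hD₁ r hrI
      have hXhE : Real.sqrt Xh ≤ E r := by
        have e : Xh = ∑' k, freqNormSq k ^ s *
            ‖mFourierCoeff (EuclideanSpace.complexify ∘ g r) k‖ ^ 2 := by
          refine tsum_congr fun k => ?_
          have hfun : (fun y => (0 : ℝ → UnitAddTorus d → EuclideanSpace ℝ d) r y - g r y) =
              fun y => -g r y := by
            funext y; simp
          rw [hfun, ci_mFourierCoeff_complexify_neg, norm_neg]
        rw [e]; exact hE r hrI
      have hZX : X r ≤ Z := ci_tsum_rpow_le_tsum_rpow_succ hs0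
        (hwr.summable_freqNormSq_rpow_mul_norm_sq (by linarith))
      have hD₀r := hD₀nn r hrI
      have hD₁r := hD₁nn r hrI
      -- the four terms
      have hkG : 0 ≤ 4 * Real.pi * Real.sqrt Gsq := by positivity
      have hkK : 0 ≤ 4 * Real.pi * Real.sqrt Ksq := by positivity
      have hDle' : D ≤ -(8 * Real.pi ^ 2 * ν) * Z +
          4 * Real.pi * Real.sqrt Gsq * Real.sqrt XV * X r +
          4 * Real.pi * Real.sqrt Gsq * x * X r +
          4 * Real.pi * Real.sqrt Ksq * X r * Real.sqrt ZV +
          2 * Real.sqrt Xh * x := hDle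
      have hT1 : Real.sqrt XV * X r ≤ D₀ r * X r := mul_le_mul_of_nonneg_right hXVle (hX0 r hrt)
      have hT3 : X r * Real.sqrt ZV ≤ X r * D₁ r := mul_le_mul_of_nonneg_left hZVle (hX0 r hrt)
      have hT4 : Real.sqrt Xh * x ≤ E r * x := mul_le_mul_of_nonneg_right hXhE hx0
      have hT0 : -(8 * Real.pi ^ 2 * ν) * Z ≤ -(8 * Real.pi ^ 2 * ν) * X r := by
        have hpos : 0 < 8 * Real.pi ^ 2 * ν := by positivity
        exact mul_le_mul_of_nonpos_left hZX (by linarith)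
      have a1 := mul_le_mul_of_nonneg_left hT1 hkG
      have a3 := mul_le_mul_of_nonneg_left hT3 hkK
      calc D ≤ _ := hDle'
        _ ≤ -(8 * Real.pi ^ 2 * ν) * X r +
              4 * Real.pi * Real.sqrt Gsq * (D₀ r * X r) +
              4 * Real.pi * Real.sqrt Gsq * x * X r +
              4 * Real.pi * Real.sqrt Ksq * (X r * D₁ r) +
              2 * (E r * x) := by linarith [hT0, a1, a3, hT4]
        _ = 2 * x * (-(4 * Real.pi ^ 2 * ν) * x + γ r * x + G * X r + E r) := by
            simp only [hγ, hG, hXx]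
            ring
    exact sqrt_le_of_control_inequality (X := X) (X' := deriv X) (R := R) (R' := R')
      (γ := γ) (ε := E) (lam := 4 * Real.pi ^ 2 * ν) (G := G) ht0 hG0 hXc hXd hX0 hXle
      (hRc.mono hsub) (fun r hr => hRd r ⟨hr.1, lt_of_lt_of_le hr.2 htT⟩)
      (fun r hr => hRge r ⟨hr.1, lt_of_lt_of_le hr.2 htT⟩)
      (fun r hr => hEnn r ⟨hr.1, hr.2.le.trans htT⟩) ⟨Γ, fun r hr => hΓ r ⟨hr.1, hr.2.le.trans htT⟩⟩
      (by
        show Real.sqrt (∑' k : d → ℤ, freqNormSq k ^ s *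
          ‖mFourierCoeff (EuclideanSpace.complexify ∘ (fun y => u 0 y - v 0 y)) k‖ ^ 2) ≤ R 0
        rw [hu0]; exact hR0)
  -- ### a uniform bound for `‖∇v‖₂²` on `[0, T]`
  obtain ⟨Gv, hGv⟩ : ∃ Gv : ℝ, ∀ r ∈ Icc 0 T, Torus.gradNormSq (v r) ≤ Gv := by
    have hcont : ContinuousOn (fun r => Torus.gradNormSq (v r)) (Icc 0 T) := by
      intro r hr
      have h := (hv.hasDerivWithinAt_half_gradNormSq hT hr).continuousWithinAt
      have h2 : ContinuousWithinAt (fun s => (2 : ℝ) * (2⁻¹ * Torus.gradNormSq (v s))) (Icc 0 T) r :=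
        continuousWithinAt_const.mul h
      exact h2.congr (fun s _ => by ring) (by ring)
    obtain ⟨r₀, -, hmax⟩ := isCompact_Icc.exists_isMaxOn (nonempty_Icc.2 hT.le) hcont
    exact ⟨Torus.gradNormSq (v r₀), fun r hr => (isMaxOn_iff.1 hmax) r hr⟩
  -- ### the maximal solution from `u₀`
  obtain ⟨u, p, hu0, hcases⟩ := Torus.exists_maximal_classicalNS hd hν hu₀ hdiv hmean
  have finish : Torus.IsClassicalNSSolutionOn (Icc 0 T) ν 0 u p →
      (∀ t ∈ Icc 0 T, Torus.HasZeroMean (u t)) →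
      ∃ (u : ℝ → UnitAddTorus d → EuclideanSpace ℝ d) (p : ℝ → UnitAddTorus d → ℝ),
        Torus.IsClassicalNSSolutionOn (Icc 0 T) ν 0 u p ∧ u 0 = u₀ ∧
        (∀ t ∈ Icc 0 T, Torus.HasZeroMean (u t)) ∧
        ∀ t ∈ Icc 0 T, Real.sqrt (∑' k : d → ℤ, freqNormSq k ^ s *
          ‖mFourierCoeff (EuclideanSpace.complexify ∘ (fun y => u t y - v t y)) k‖ ^ 2) ≤ R t :=
    fun hvT hmvT => ⟨u, p, hvT, hu0, hmvT, hwindow hT le_rfl hvT hmvT hu0⟩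
  rcases hcases with ⟨hU, hmU, -⟩ | ⟨Tu, hTu, hU, hmU, hunb, -⟩
  · -- global
    exact finish (hU.mono (fun r hr => mem_Ici.2 hr.1) (uniqueDiffOn_Icc hT))
      (fun t ht => hmU t ht.1)
  · rcases lt_or_ge T Tu with hTlt | hTge
    · -- the blow-up time is beyond `T`
      exact finish (hU.mono (fun r hr => ⟨hr.1, lt_of_le_of_lt hr.2 hTlt⟩) (uniqueDiffOn_Icc hT))
        (fun t ht => hmU t ⟨ht.1, lt_of_le_of_lt ht.2 hTlt⟩)
    · -- blow-up at `Tu ≤ T` is impossible: `‖∇u‖₂²` stays bounded on `[0, Tu)`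
      exfalso
      refine hunb ⟨2 * Gv + 2 * (4 * Real.pi ^ 2 * (2 * (|MR| ^ 2 + |R 0| ^ 2))) +
        2 * Torus.gradNormSq u₀, ?_⟩
      rintro _ ⟨r, hr, rfl⟩
      have hrI : r ∈ Icc 0 T := ⟨hr.1, (le_of_lt hr.2).trans hTge⟩
      have hur : Torus.IsSmooth (u r) := hU.smooth_velocity.isSmooth_slice hr
      have hvr : Torus.IsSmooth (v r) := hv.smooth_velocity.isSmooth_slice hrI
      have hwr : Torus.IsSmooth (fun y => u r y - v r y) := hur.sub hvr
      -- `√X_w(r) ≤ R r` on the window `[0, r]` (or `r = 0`)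
      have hXR : Real.sqrt (∑' k : d → ℤ, freqNormSq k ^ s *
          ‖mFourierCoeff (EuclideanSpace.complexify ∘ (fun y => u r y - v r y)) k‖ ^ 2) ≤ |MR| + |R 0| := by
        rcases eq_or_lt_of_le hr.1 with h0r | h0r
        · rw [← h0r, hu0]
          exact hR0.trans ((le_abs_self _).trans (by linarith [abs_nonneg MR]))
        · have hUr : Torus.IsClassicalNSSolutionOn (Icc 0 r) ν 0 u p :=
            hU.mono (fun x hx => ⟨hx.1, lt_of_le_of_lt hx.2 hr.2⟩) (uniqueDiffOn_Icc h0r)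
          have h1 := hwindow h0r hrI.2 hUr (fun x hx => hmU x ⟨hx.1, lt_of_le_of_lt hx.2 hr.2⟩) hu0
            r (right_mem_Icc.2 h0r.le)
          exact h1.trans ((hMR r hrI).trans ((le_abs_self _).trans (by linarith [abs_nonneg (R 0)])))
      have hgw : Torus.gradNormSq (fun y => u r y - v r y) ≤
          4 * Real.pi ^ 2 * (2 * (|MR| ^ 2 + |R 0| ^ 2)) := by
        have h1 := ci_gradNormSq_le_tsum_rpow hwr hs
        set Xr : ℝ := ∑' k : d → ℤ, freqNormSq k ^ s *
          ‖mFourierCoeff (EuclideanSpace.complexify ∘ (fun y => u r y - v r y)) k‖ ^ 2 with hXr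
        have hXr0 : 0 ≤ Xr := tsum_nonneg fun k =>
          mul_nonneg (Real.rpow_nonneg (freqNormSq_nonneg k) _) (sq_nonneg _)
        have h2 : Xr ≤ (|MR| + |R 0|) ^ 2 := by
          calc Xr = Real.sqrt Xr ^ 2 := (Real.sq_sqrt hXr0).symm
            _ ≤ (|MR| + |R 0|) ^ 2 := pow_le_pow_left₀ (Real.sqrt_nonneg _) hXR 2
        have h3 : (|MR| + |R 0|) ^ 2 ≤ 2 * (|MR| ^ 2 + |R 0| ^ 2) := by
          nlinarith [sq_nonneg (|MR| - |R 0|)]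
        have hpi : 0 ≤ 4 * Real.pi ^ 2 := by positivity
        exact h1.trans (mul_le_mul_of_nonneg_left (h2.trans h3) hpi)
      have hsplit : u r = v r + fun y => u r y - v r y := by
        funext y; simp
      show Torus.gradNormSq (u r) ≤ 2 * Gv + 2 * (4 * Real.pi ^ 2 * (2 * (|MR| ^ 2 + |R 0| ^ 2))) +
        2 * Torus.gradNormSq u₀
      rw [hsplit]
      refine (Torus.gradNormSq_add_le hvr hwr).trans ?_
      have h1 := hGv r hrI
      have h3 : 0 ≤ Torus.gradNormSq u₀ := Torus.gradNormSq_nonneg _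
      linarith

/-- **The closed-form certificate in MP's shape (explicit supersolution).** In
`Torus.classicalNS_regular_of_sobolev_control_kernels` take constant envelopes `‖v(t)‖_s ≤ M₀`,
`‖v(t)‖_{s+1} ≤ M₁`, `‖g(t)‖_s ≤ ε₀` on `[0, T]` and datum error `‖u₀ − v(0)‖_s ≤ δ`; put
`G = 2π√Gsq`, `K = 2π√Ksq`, `Γ = G M₀ + K M₁`, `a = max(Γ − 4π²ν, 0)`, `ρ = 2(δ + ε₀T)e^{aT}`.
If `2GT(δ + ε₀T)e^{aT} ≤ log 2`, then `R(t) = (δ + ε₀t)e^{(a + Gρ)t}` satisfies the control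
inequality on `[0, T]`, hence the classical solution from `u₀` exists on `[0, T] × T³` with
`‖u(t) − v(t)‖_s ≤ (δ + ε₀t)e^{(a + Gρ)t}` — MP's Prop. 4.4 (i) as ONE checkable inequality between
the numbers `(ν, T, M₀, M₁, ε₀, δ, Gsq, Ksq)` (MP integrate the control equation instead).
[cite: MorosiPizzocchero2015, Prop. 4.4 (i) (explicit supersolution `R = (δ + ε₀t)e^{(a+Gρ)t}`); MorosiPizzocchero2012Kato, Prop. 3.5; MorosiPizzocchero2013Basic, Prop. 3.7] -/
theorem Torus.classicalNS_regular_of_sobolev_control_kernels_explicit (hd : Fintype.card d = 3)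
    {ν : ℝ} (hν : 0 < ν) {T : ℝ} (hT : 0 < T) {s : ℝ} (hs : 1 ≤ s)
    {Gsq : ℝ} (hGker : ∀ (k : d → ℤ) (H : Finset (d → ℤ)), ∑ h ∈ H,
      (freqNormSq h * freqNormSq k - (∑ j, (h j : ℝ) * (k j : ℝ)) ^ 2) *
        (freqNormSq k ^ (s / 2) - freqNormSq (k - h) ^ (s / 2)) ^ 2 /
        (freqNormSq h ^ (s + 1) * freqNormSq (k - h) ^ s) ≤ Gsq)
    {Ksq : ℝ} (hKker : ∀ (k : d → ℤ) (H : Finset (d → ℤ)), ∑ h ∈ H,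
      freqNormSq k ^ s * (freqNormSq h * freqNormSq k - (∑ j, (h j : ℝ) * (k j : ℝ)) ^ 2) /
        (freqNormSq h ^ (s + 1) * freqNormSq (k - h) ^ (s + 1)) ≤ Ksq)
    {v g : ℝ → UnitAddTorus d → EuclideanSpace ℝ d} {q : ℝ → UnitAddTorus d → ℝ}
    (hv : Torus.IsClassicalNSSolutionOn (Icc 0 T) ν g v q)
    (hmv : ∀ t ∈ Icc 0 T, Torus.HasZeroMean (v t)) {M₀ M₁ ε₀ δ : ℝ}
    (hM₀ : ∀ t ∈ Icc 0 T, Real.sqrt (∑' k : d → ℤ, freqNormSq k ^ s *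
      ‖mFourierCoeff (EuclideanSpace.complexify ∘ v t) k‖ ^ 2) ≤ M₀)
    (hM₁ : ∀ t ∈ Icc 0 T, Real.sqrt (∑' k : d → ℤ, freqNormSq k ^ (s + 1) *
      ‖mFourierCoeff (EuclideanSpace.complexify ∘ v t) k‖ ^ 2) ≤ M₁)
    (hε : ∀ t ∈ Icc 0 T, Real.sqrt (∑' k : d → ℤ, freqNormSq k ^ s *
      ‖mFourierCoeff (EuclideanSpace.complexify ∘ g t) k‖ ^ 2) ≤ ε₀)
    {u₀ : UnitAddTorus d → EuclideanSpace ℝ d} (hu₀ : Torus.IsSmooth u₀)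
    (hdiv : Torus.IsDivFree u₀) (hmean : Torus.HasZeroMean u₀)
    (hδ : Real.sqrt (∑' k : d → ℤ, freqNormSq k ^ s *
      ‖mFourierCoeff (EuclideanSpace.complexify ∘ (fun y => u₀ y - v 0 y)) k‖ ^ 2) ≤ δ)
    (hsmall : 2 * (2 * Real.pi * Real.sqrt Gsq) * T * (δ + ε₀ * T) *
      Real.exp (max (2 * Real.pi * Real.sqrt Gsq * M₀ + 2 * Real.pi * Real.sqrt Ksq * M₁ -
        4 * Real.pi ^ 2 * ν) 0 * T) ≤ Real.log 2) :
    ∃ (u : ℝ → UnitAddTorus d → EuclideanSpace ℝ d) (p : ℝ → UnitAddTorus d → ℝ),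
      Torus.IsClassicalNSSolutionOn (Icc 0 T) ν 0 u p ∧ u 0 = u₀ ∧
      (∀ t ∈ Icc 0 T, Torus.HasZeroMean (u t)) ∧
      ∀ t ∈ Icc 0 T, Real.sqrt (∑' k : d → ℤ, freqNormSq k ^ s *
        ‖mFourierCoeff (EuclideanSpace.complexify ∘ (fun y => u t y - v t y)) k‖ ^ 2) ≤
        (δ + ε₀ * t) * Real.exp ((max (2 * Real.pi * Real.sqrt Gsq * M₀ +
            2 * Real.pi * Real.sqrt Ksq * M₁ - 4 * Real.pi ^ 2 * ν) 0 +
          2 * Real.pi * Real.sqrt Gsq *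
            (2 * (δ + ε₀ * T) * Real.exp (max (2 * Real.pi * Real.sqrt Gsq * M₀ +
              2 * Real.pi * Real.sqrt Ksq * M₁ - 4 * Real.pi ^ 2 * ν) 0 * T))) * t) := by
  set G : ℝ := 2 * Real.pi * Real.sqrt Gsq with hG
  set Γ : ℝ := 2 * Real.pi * Real.sqrt Gsq * M₀ + 2 * Real.pi * Real.sqrt Ksq * M₁ with hΓ
  set a : ℝ := max (Γ - 4 * Real.pi ^ 2 * ν) 0 with ha
  set ρ : ℝ := 2 * (δ + ε₀ * T) * Real.exp (a * T) with hρ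
  set b : ℝ := a + G * ρ with hb
  have h0T : (0 : ℝ) ∈ Icc 0 T := left_mem_Icc.2 hT.le
  have hδ0 : 0 ≤ δ := (Real.sqrt_nonneg _).trans hδ
  have hε0 : 0 ≤ ε₀ := (Real.sqrt_nonneg _).trans (hε 0 h0T)
  have hM₀0 : 0 ≤ M₀ := (Real.sqrt_nonneg _).trans (hM₀ 0 h0T)
  have hM₁0 : 0 ≤ M₁ := (Real.sqrt_nonneg _).trans (hM₁ 0 h0T)
  have hs0 : 0 < s := by linarith
  have hG0 : 0 ≤ G := by rw [hG]; positivity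
  have ha0 : 0 ≤ a := le_max_right _ _
  have hρ0 : 0 ≤ ρ := by rw [hρ]; positivity
  have hb0 : 0 ≤ b := add_nonneg ha0 (mul_nonneg hG0 hρ0)
  have hsmall' : G * ρ * T ≤ Real.log 2 := by
    have e : G * ρ * T = 2 * G * T * (δ + ε₀ * T) * Real.exp (a * T) := by rw [hρ]; ring
    rw [e]; exact hsmall
  -- the explicit supersolution
  set R : ℝ → ℝ := fun t => (δ + ε₀ * t) * Real.exp (b * t) with hR
  set R' : ℝ → ℝ := fun t => ε₀ * Real.exp (b * t) + b * R t with hR'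
  have hRd_at : ∀ t, HasDerivAt R (R' t) t := by
    intro t
    have h1 : HasDerivAt (fun t => δ + ε₀ * t) ε₀ t := by
      simpa using ((hasDerivAt_id t).const_mul ε₀).const_add δ
    have h2 : HasDerivAt (fun t => Real.exp (b * t)) (b * Real.exp (b * t)) t := by
      have h := ((hasDerivAt_id t).const_mul b).exp
      simp only [mul_one, id] at h
      convert h using 1; ring
    have h := h1.mul h2
    refine h.congr_deriv ?_
    simp only [hR', hR]
    ring
  have hRc : ContinuousOn R (Icc 0 T) := fun t _ => (hRd_at t).continuousAt.continuousWithinAt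
  have hRnn : ∀ t, 0 ≤ t → 0 ≤ R t := fun t ht => by
    show 0 ≤ (δ + ε₀ * t) * Real.exp (b * t); positivity
  have hRle : ∀ t ∈ Icc 0 T, R t ≤ ρ := by
    intro t ht
    have h1 : δ + ε₀ * t ≤ δ + ε₀ * T := by nlinarith [ht.2]
    have h2 : Real.exp (b * t) ≤ Real.exp (b * T) :=
      Real.exp_le_exp.2 (mul_le_mul_of_nonneg_left ht.2 hb0)
    have h3 : Real.exp (b * T) = Real.exp (a * T) * Real.exp (G * ρ * T) := by
      rw [← Real.exp_add, hb]; ring_nf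
    have h4 : Real.exp (G * ρ * T) ≤ 2 := by
      calc Real.exp (G * ρ * T) ≤ Real.exp (Real.log 2) := Real.exp_le_exp.2 hsmall'
        _ = 2 := Real.exp_log (by norm_num)
    have h5 : 0 ≤ δ + ε₀ * t := by nlinarith [ht.1]
    calc R t = (δ + ε₀ * t) * Real.exp (b * t) := rfl
      _ ≤ (δ + ε₀ * T) * Real.exp (b * T) :=
          mul_le_mul h1 h2 (Real.exp_pos _).le (by linarith)
      _ = (δ + ε₀ * T) * (Real.exp (a * T) * Real.exp (G * ρ * T)) := by rw [h3]
      _ ≤ (δ + ε₀ * T) * (Real.exp (a * T) * 2) := by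
          gcongr
      _ = ρ := by rw [hρ]; ring
  -- the control inequality for `R`
  have hRge : ∀ t ∈ Ico 0 T,
      -(4 * Real.pi ^ 2 * ν) * R t +
        (2 * Real.pi * Real.sqrt Gsq * M₀ + 2 * Real.pi * Real.sqrt Ksq * M₁) * R t +
        2 * Real.pi * Real.sqrt Gsq * R t ^ 2 + ε₀ ≤ R' t := by
    intro t ht
    have hRt := hRnn t ht.1
    have hRρ := hRle t (Ico_subset_Icc_self ht)
    have h1 : -(4 * Real.pi ^ 2 * ν) * R t + Γ * R t ≤ a * R t := by
      have : Γ - 4 * Real.pi ^ 2 * ν ≤ a := le_max_left _ _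
      nlinarith
    have h2 : G * R t ^ 2 ≤ G * ρ * R t := by
      rw [sq, ← mul_assoc]
      exact mul_le_mul_of_nonneg_right (mul_le_mul_of_nonneg_left hRρ hG0) hRt
    have h3 : ε₀ ≤ ε₀ * Real.exp (b * t) :=
      le_mul_of_one_le_right hε0 (Real.one_le_exp (mul_nonneg hb0 ht.1))
    show -(4 * Real.pi ^ 2 * ν) * R t + Γ * R t + G * R t ^ 2 + ε₀ ≤
      ε₀ * Real.exp (b * t) + b * R t
    rw [hb]
    nlinarith
  obtain ⟨u, p, hu, hu0, hmu, hbound⟩ := Torus.classicalNS_regular_of_sobolev_control_kernels hd hν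
    hT hs hGker hKker hv hmv (D₀ := fun _ => M₀) (D₁ := fun _ => M₁) (E := fun _ => ε₀)
    continuousOn_const continuousOn_const hM₀ hM₁ hε hu₀ hdiv hmean (R := R) (R' := R') hRc
    (fun t _ => (hRd_at t).hasDerivWithinAt) hRge
    (by show _ ≤ (δ + ε₀ * 0) * Real.exp (b * 0); rw [mul_zero, add_zero, mul_zero, Real.exp_zero,
      mul_one]; exact hδ)
  exact ⟨u, p, hu, hu0, hmu, fun t ht => hbound t ht⟩

/-- **MP Prop. 4.4 (i) on `T³`, `s > 5/2`, with the two functionals evaluated elementarily**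
(Morosi–Pernici–Pizzocchero 2017, Prop. 4.2 / Prop. 3.1: `sup 𝒢_s ≤ s²2^{2s−2}ζ_{2s−2}`,
`sup 𝒦_s ≤ 2^{2s}ζ_{2s}`, `NSSobolev.sum_gramKernel_le` / `NSSobolev.sum_wedgeKernel_le`): the
hypotheses and conclusion of `Torus.classicalNS_regular_of_sobolev_control_kernels` with
`G = 2π s 2^{s−1} C₁`, `K = 2π 2^s C₀`, `C₁ = (∑_{k≠0}|k|^{2−2s})^{1/2}`, `C₀ = (∑_{k≠0}|k|^{−2s})^{1/2}`
— NO hypothesis on a lattice supremum is left. For `s = 3` on the unit `T³`: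
`G = 24π C₁ ≈ 3.1·10²`, `K = 16π C₀ ≈ 1.5·10²` (`C₁² ≈ 16.5`, `C₀² ≈ 8.40`), against
`γ ≈ 4.0·10³ D₀ + 2.2·10² D₁`, `G ≈ 3.7·10³` of `Torus.classicalNS_regular_of_sobolev_control_of_gt`
and MP's lattice-optimised `(2π)^{5/2}(0.438, 0.323) ≈ (43, 32)`.
[cite: MorosiPizzocchero2015, Prop. 4.4 (i); MorosiPerniciPizzocchero2017, Prop. 3.1, Prop. 4.2, Cor. 3.4, Cor. 4.5] -/
theorem Torus.classicalNS_regular_of_sobolev_control_zeta (hd : Fintype.card d = 3) {ν : ℝ}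
    (hν : 0 < ν) {T : ℝ} (hT : 0 < T) {s : ℝ} (hs : 5 / 2 < s)
    {v g : ℝ → UnitAddTorus d → EuclideanSpace ℝ d} {q : ℝ → UnitAddTorus d → ℝ}
    (hv : Torus.IsClassicalNSSolutionOn (Icc 0 T) ν g v q)
    (hmv : ∀ t ∈ Icc 0 T, Torus.HasZeroMean (v t))
    {D₀ D₁ E : ℝ → ℝ} (hD₀c : ContinuousOn D₀ (Icc 0 T)) (hD₁c : ContinuousOn D₁ (Icc 0 T))
    (hD₀ : ∀ t ∈ Icc 0 T, Real.sqrt (∑' k : d → ℤ, freqNormSq k ^ s *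
      ‖mFourierCoeff (EuclideanSpace.complexify ∘ v t) k‖ ^ 2) ≤ D₀ t)
    (hD₁ : ∀ t ∈ Icc 0 T, Real.sqrt (∑' k : d → ℤ, freqNormSq k ^ (s + 1) *
      ‖mFourierCoeff (EuclideanSpace.complexify ∘ v t) k‖ ^ 2) ≤ D₁ t)
    (hE : ∀ t ∈ Icc 0 T, Real.sqrt (∑' k : d → ℤ, freqNormSq k ^ s *
      ‖mFourierCoeff (EuclideanSpace.complexify ∘ g t) k‖ ^ 2) ≤ E t)
    {u₀ : UnitAddTorus d → EuclideanSpace ℝ d} (hu₀ : Torus.IsSmooth u₀)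
    (hdiv : Torus.IsDivFree u₀) (hmean : Torus.HasZeroMean u₀)
    {R R' : ℝ → ℝ} (hRc : ContinuousOn R (Icc 0 T))
    (hRd : ∀ t ∈ Ico 0 T, HasDerivWithinAt R (R' t) (Ici t) t)
    (hRge : ∀ t ∈ Ico 0 T,
      -(4 * Real.pi ^ 2 * ν) * R t +
        (2 * Real.pi * (s * (2 : ℝ) ^ (s - 1) *
            Real.sqrt (∑' k : d → ℤ, if k = 0 then (0 : ℝ) else freqNormSq k ^ (-(s - 1)))) * D₀ t +
          2 * Real.pi * ((2 : ℝ) ^ s *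
            Real.sqrt (∑' k : d → ℤ, if k = 0 then (0 : ℝ) else freqNormSq k ^ (-s))) * D₁ t) * R t +
        2 * Real.pi * (s * (2 : ℝ) ^ (s - 1) *
            Real.sqrt (∑' k : d → ℤ, if k = 0 then (0 : ℝ) else freqNormSq k ^ (-(s - 1)))) * R t ^ 2 +
        E t ≤ R' t)
    (hR0 : Real.sqrt (∑' k : d → ℤ, freqNormSq k ^ s *
      ‖mFourierCoeff (EuclideanSpace.complexify ∘ (fun y => u₀ y - v 0 y)) k‖ ^ 2) ≤ R 0) :
    ∃ (u : ℝ → UnitAddTorus d → EuclideanSpace ℝ d) (p : ℝ → UnitAddTorus d → ℝ),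
      Torus.IsClassicalNSSolutionOn (Icc 0 T) ν 0 u p ∧ u 0 = u₀ ∧
      (∀ t ∈ Icc 0 T, Torus.HasZeroMean (u t)) ∧
      ∀ t ∈ Icc 0 T, Real.sqrt (∑' k : d → ℤ, freqNormSq k ^ s *
        ‖mFourierCoeff (EuclideanSpace.complexify ∘ (fun y => u t y - v t y)) k‖ ^ 2) ≤ R t := by
  classical
  have hn : (Fintype.card d : ℝ) = 3 := by rw [hd]; norm_num
  have hs1 : (1 : ℝ) ≤ s := by linarith
  have hsdG : (Fintype.card d : ℝ) < 2 * (s - 1) := by rw [hn]; linarith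
  have hsdK : (Fintype.card d : ℝ) < 2 * s := by rw [hn]; linarith
  set ZG : ℝ := ∑' k : d → ℤ, (if k = 0 then (0 : ℝ) else freqNormSq k ^ (-(s - 1))) with hZG
  set ZK : ℝ := ∑' k : d → ℤ, (if k = 0 then (0 : ℝ) else freqNormSq k ^ (-s)) with hZK
  have hZG0 : 0 ≤ ZG := tsum_nonneg fun k => by
    split_ifs
    · exact le_rfl
    · exact Real.rpow_nonneg (freqNormSq_nonneg k) _
  have hZK0 : 0 ≤ ZK := tsum_nonneg fun k => by
    split_ifs
    · exact le_rfl
    · exact Real.rpow_nonneg (freqNormSq_nonneg k) _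
  -- `s² 2^{2s−2} ζ_{2s−2} = (s 2^{s−1} √ζ_{2s−2})²`, `2^{2s} ζ_{2s} = (2^s √ζ_{2s})²`
  have e2G : (2 : ℝ) ^ (2 * s - 2) = ((2 : ℝ) ^ (s - 1)) ^ 2 := by
    rw [← Real.rpow_natCast, ← Real.rpow_mul zero_le_two]
    congr 1
    push_cast
    ring
  have e2K : (2 : ℝ) ^ (2 * s) = ((2 : ℝ) ^ s) ^ 2 := by
    rw [← Real.rpow_natCast, ← Real.rpow_mul zero_le_two]
    congr 1
    push_cast
    ring
  have hA0 : 0 ≤ s * (2 : ℝ) ^ (s - 1) * Real.sqrt ZG := by positivity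
  have hB0 : 0 ≤ (2 : ℝ) ^ s * Real.sqrt ZK := by positivity
  have hGker : ∀ (k : d → ℤ) (H : Finset (d → ℤ)), ∑ h ∈ H,
      (freqNormSq h * freqNormSq k - (∑ j, (h j : ℝ) * (k j : ℝ)) ^ 2) *
        (freqNormSq k ^ (s / 2) - freqNormSq (k - h) ^ (s / 2)) ^ 2 /
        (freqNormSq h ^ (s + 1) * freqNormSq (k - h) ^ s) ≤
      (s * (2 : ℝ) ^ (s - 1) * Real.sqrt ZG) ^ 2 := fun k H =>
    (NSSobolev.sum_gramKernel_le (d := d) hsdG k H).trans (le_of_eq (by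
      rw [mul_pow, mul_pow, Real.sq_sqrt hZG0, ← e2G]))
  have hKker : ∀ (k : d → ℤ) (H : Finset (d → ℤ)), ∑ h ∈ H,
      freqNormSq k ^ s * (freqNormSq h * freqNormSq k - (∑ j, (h j : ℝ) * (k j : ℝ)) ^ 2) /
        (freqNormSq h ^ (s + 1) * freqNormSq (k - h) ^ (s + 1)) ≤
      ((2 : ℝ) ^ s * Real.sqrt ZK) ^ 2 := fun k H =>
    (NSSobolev.sum_wedgeKernel_le (d := d) hsdK k H).trans (le_of_eq (by
      rw [mul_pow, Real.sq_sqrt hZK0, ← e2K]))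
  refine Torus.classicalNS_regular_of_sobolev_control_kernels hd hν hT hs1 hGker hKker hv hmv
    hD₀c hD₁c hD₀ hD₁ hE hu₀ hdiv hmean hRc hRd (fun t ht => ?_) hR0
  rw [Real.sqrt_sq hA0, Real.sqrt_sq hB0]
  exact hRge t ht

/-- **MP Prop. 4.4 (i) on `T³`, `s > 5/2`, with `𝒢_s` evaluated elementarily and `𝒦_s` by MPP's
closed-form Lemma 5.3 constant** (`NSSobolev.sum_gramKernel_le`, `NSSobolev.sum_wedgeKernel_le_mpp`):
as `Torus.classicalNS_regular_of_sobolev_control_zeta` with the transport coefficient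
`K = 2π (B_s ζ_{2s})^{1/2}`, `B_s = 2^{2s+2}(s+1)^{s+1}/(s+2)^{s+2}`, in place of `2π 2^s ζ_{2s}^{1/2}`
(`s = 3`: `K ≈ 83` instead of `≈ 146`; `G = 24π C₁ ≈ 307` unchanged).
[cite: MorosiPizzocchero2015, Prop. 4.4 (i); MorosiPerniciPizzocchero2017, Prop. 4.2, Lemma 5.3 (ii), Remark 5.4 (5.9)] -/
theorem Torus.classicalNS_regular_of_sobolev_control_zeta_mpp (hd : Fintype.card d = 3) {ν : ℝ}
    (hν : 0 < ν) {T : ℝ} (hT : 0 < T) {s : ℝ} (hs : 5 / 2 < s)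
    {v g : ℝ → UnitAddTorus d → EuclideanSpace ℝ d} {q : ℝ → UnitAddTorus d → ℝ}
    (hv : Torus.IsClassicalNSSolutionOn (Icc 0 T) ν g v q)
    (hmv : ∀ t ∈ Icc 0 T, Torus.HasZeroMean (v t))
    {D₀ D₁ E : ℝ → ℝ} (hD₀c : ContinuousOn D₀ (Icc 0 T)) (hD₁c : ContinuousOn D₁ (Icc 0 T))
    (hD₀ : ∀ t ∈ Icc 0 T, Real.sqrt (∑' k : d → ℤ, freqNormSq k ^ s *
      ‖mFourierCoeff (EuclideanSpace.complexify ∘ v t) k‖ ^ 2) ≤ D₀ t)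
    (hD₁ : ∀ t ∈ Icc 0 T, Real.sqrt (∑' k : d → ℤ, freqNormSq k ^ (s + 1) *
      ‖mFourierCoeff (EuclideanSpace.complexify ∘ v t) k‖ ^ 2) ≤ D₁ t)
    (hE : ∀ t ∈ Icc 0 T, Real.sqrt (∑' k : d → ℤ, freqNormSq k ^ s *
      ‖mFourierCoeff (EuclideanSpace.complexify ∘ g t) k‖ ^ 2) ≤ E t)
    {u₀ : UnitAddTorus d → EuclideanSpace ℝ d} (hu₀ : Torus.IsSmooth u₀)
    (hdiv : Torus.IsDivFree u₀) (hmean : Torus.HasZeroMean u₀)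
    {R R' : ℝ → ℝ} (hRc : ContinuousOn R (Icc 0 T))
    (hRd : ∀ t ∈ Ico 0 T, HasDerivWithinAt R (R' t) (Ici t) t)
    (hRge : ∀ t ∈ Ico 0 T,
      -(4 * Real.pi ^ 2 * ν) * R t +
        (2 * Real.pi * (s * (2 : ℝ) ^ (s - 1) *
            Real.sqrt (∑' k : d → ℤ, if k = 0 then (0 : ℝ) else freqNormSq k ^ (-(s - 1)))) * D₀ t +
          2 * Real.pi * Real.sqrt (((2 : ℝ) ^ (2 * s + 2) * (s + 1) ^ (s + 1) / (s + 2) ^ (s + 2)) *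
            ∑' k : d → ℤ, (if k = 0 then (0 : ℝ) else freqNormSq k ^ (-s))) * D₁ t) * R t +
        2 * Real.pi * (s * (2 : ℝ) ^ (s - 1) *
            Real.sqrt (∑' k : d → ℤ, if k = 0 then (0 : ℝ) else freqNormSq k ^ (-(s - 1)))) * R t ^ 2 +
        E t ≤ R' t)
    (hR0 : Real.sqrt (∑' k : d → ℤ, freqNormSq k ^ s *
      ‖mFourierCoeff (EuclideanSpace.complexify ∘ (fun y => u₀ y - v 0 y)) k‖ ^ 2) ≤ R 0) :
    ∃ (u : ℝ → UnitAddTorus d → EuclideanSpace ℝ d) (p : ℝ → UnitAddTorus d → ℝ),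
      Torus.IsClassicalNSSolutionOn (Icc 0 T) ν 0 u p ∧ u 0 = u₀ ∧
      (∀ t ∈ Icc 0 T, Torus.HasZeroMean (u t)) ∧
      ∀ t ∈ Icc 0 T, Real.sqrt (∑' k : d → ℤ, freqNormSq k ^ s *
        ‖mFourierCoeff (EuclideanSpace.complexify ∘ (fun y => u t y - v t y)) k‖ ^ 2) ≤ R t := by
  classical
  have hn : (Fintype.card d : ℝ) = 3 := by rw [hd]; norm_num
  have hs1 : (1 : ℝ) ≤ s := by linarith
  have hsdG : (Fintype.card d : ℝ) < 2 * (s - 1) := by rw [hn]; linarith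
  have hsdK : (Fintype.card d : ℝ) < 2 * s := by rw [hn]; linarith
  set ZG : ℝ := ∑' k : d → ℤ, (if k = 0 then (0 : ℝ) else freqNormSq k ^ (-(s - 1))) with hZG
  have hZG0 : 0 ≤ ZG := tsum_nonneg fun k => by
    split_ifs
    · exact le_rfl
    · exact Real.rpow_nonneg (freqNormSq_nonneg k) _
  have e2G : (2 : ℝ) ^ (2 * s - 2) = ((2 : ℝ) ^ (s - 1)) ^ 2 := by
    rw [← Real.rpow_natCast, ← Real.rpow_mul zero_le_two]
    congr 1
    push_cast
    ring
  have hA0 : 0 ≤ s * (2 : ℝ) ^ (s - 1) * Real.sqrt ZG := by positivity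
  have hGker : ∀ (k : d → ℤ) (H : Finset (d → ℤ)), ∑ h ∈ H,
      (freqNormSq h * freqNormSq k - (∑ j, (h j : ℝ) * (k j : ℝ)) ^ 2) *
        (freqNormSq k ^ (s / 2) - freqNormSq (k - h) ^ (s / 2)) ^ 2 /
        (freqNormSq h ^ (s + 1) * freqNormSq (k - h) ^ s) ≤
      (s * (2 : ℝ) ^ (s - 1) * Real.sqrt ZG) ^ 2 := fun k H =>
    (NSSobolev.sum_gramKernel_le (d := d) hsdG k H).trans (le_of_eq (by
      rw [mul_pow, mul_pow, Real.sq_sqrt hZG0, ← e2G]))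
  have hKker := fun k H => NSSobolev.sum_wedgeKernel_le_mpp (d := d) hs1 hsdK k H
  refine Torus.classicalNS_regular_of_sobolev_control_kernels hd hν hT hs1 hGker hKker hv hmv
    hD₀c hD₁c hD₀ hD₁ hE hu₀ hdiv hmean hRc hRd (fun t ht => ?_) hR0
  rw [Real.sqrt_sq hA0]
  exact hRge t ht

/-- **MP Prop. 4.4 (i) on `T³` at `n = 3` with both lattice suprema bounded by hand**
(`NSSobolev.sum_gramKernel_le_three`: `sup 𝒢₃ ≤ 24ζ₄`; `NSSobolev.sum_wedgeKernel_le_mpp`: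
`sup 𝒦₃ ≤ B₃ζ₆`, `B₃ = 2⁸·4⁴/5⁵ = 65536/3125`): the control inequality
`R' ≥ −4π²νR + (G·D₀ + K·D₁)R + G·R² + E` with `G = 2π(24ζ₄)^{1/2} ≈ 125`,
`K = 2π(B₃ζ₆)^{1/2} ≈ 83` (unit torus; `ζ₄ = ∑_{k≠0}|k|^{−4} ≈ 16.5`, `ζ₆ ≈ 8.40`), and NO hypothesis
on a lattice supremum — against `(3.7·10³, 2.2·10² + 3.7·10³·)` of the Wiener route (§6) and
Morosi–Pizzocchero's certified `(43, 32)` on `(ℝ/2πℤ)³`.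
[cite: MorosiPizzocchero2015, Prop. 4.4 (i); MorosiPizzocchero2012Kato, Prop. 3.5, Lemma 5.3; MorosiPerniciPizzocchero2017, Lemma 5.3, Remark 5.4; MorosiPizzocchero2013Basic, Prop. 3.7] -/
theorem Torus.classicalNS_regular_of_sobolev_control_zeta_three (hd : Fintype.card d = 3) {ν : ℝ}
    (hν : 0 < ν) {T : ℝ} (hT : 0 < T) {s : ℝ} (hs3 : s = 3)
    {v g : ℝ → UnitAddTorus d → EuclideanSpace ℝ d} {q : ℝ → UnitAddTorus d → ℝ}
    (hv : Torus.IsClassicalNSSolutionOn (Icc 0 T) ν g v q)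
    (hmv : ∀ t ∈ Icc 0 T, Torus.HasZeroMean (v t))
    {D₀ D₁ E : ℝ → ℝ} (hD₀c : ContinuousOn D₀ (Icc 0 T)) (hD₁c : ContinuousOn D₁ (Icc 0 T))
    (hD₀ : ∀ t ∈ Icc 0 T, Real.sqrt (∑' k : d → ℤ, freqNormSq k ^ s *
      ‖mFourierCoeff (EuclideanSpace.complexify ∘ v t) k‖ ^ 2) ≤ D₀ t)
    (hD₁ : ∀ t ∈ Icc 0 T, Real.sqrt (∑' k : d → ℤ, freqNormSq k ^ (s + 1) *
      ‖mFourierCoeff (EuclideanSpace.complexify ∘ v t) k‖ ^ 2) ≤ D₁ t)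
    (hE : ∀ t ∈ Icc 0 T, Real.sqrt (∑' k : d → ℤ, freqNormSq k ^ s *
      ‖mFourierCoeff (EuclideanSpace.complexify ∘ g t) k‖ ^ 2) ≤ E t)
    {u₀ : UnitAddTorus d → EuclideanSpace ℝ d} (hu₀ : Torus.IsSmooth u₀)
    (hdiv : Torus.IsDivFree u₀) (hmean : Torus.HasZeroMean u₀)
    {R R' : ℝ → ℝ} (hRc : ContinuousOn R (Icc 0 T))
    (hRd : ∀ t ∈ Ico 0 T, HasDerivWithinAt R (R' t) (Ici t) t)
    (hRge : ∀ t ∈ Ico 0 T,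
      -(4 * Real.pi ^ 2 * ν) * R t +
        (2 * Real.pi * Real.sqrt (24 *
            ∑' k : d → ℤ, (if k = 0 then (0 : ℝ) else freqNormSq k ^ (-(s - 1)))) * D₀ t +
          2 * Real.pi * Real.sqrt (((2 : ℝ) ^ (2 * s + 2) * (s + 1) ^ (s + 1) / (s + 2) ^ (s + 2)) *
            ∑' k : d → ℤ, (if k = 0 then (0 : ℝ) else freqNormSq k ^ (-s))) * D₁ t) * R t +
        2 * Real.pi * Real.sqrt (24 *
            ∑' k : d → ℤ, (if k = 0 then (0 : ℝ) else freqNormSq k ^ (-(s - 1)))) * R t ^ 2 +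
        E t ≤ R' t)
    (hR0 : Real.sqrt (∑' k : d → ℤ, freqNormSq k ^ s *
      ‖mFourierCoeff (EuclideanSpace.complexify ∘ (fun y => u₀ y - v 0 y)) k‖ ^ 2) ≤ R 0) :
    ∃ (u : ℝ → UnitAddTorus d → EuclideanSpace ℝ d) (p : ℝ → UnitAddTorus d → ℝ),
      Torus.IsClassicalNSSolutionOn (Icc 0 T) ν 0 u p ∧ u 0 = u₀ ∧
      (∀ t ∈ Icc 0 T, Torus.HasZeroMean (u t)) ∧
      ∀ t ∈ Icc 0 T, Real.sqrt (∑' k : d → ℤ, freqNormSq k ^ s *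
        ‖mFourierCoeff (EuclideanSpace.complexify ∘ (fun y => u t y - v t y)) k‖ ^ 2) ≤ R t := by
  classical
  have hn : (Fintype.card d : ℝ) = 3 := by rw [hd]; norm_num
  have hs1 : (1 : ℝ) ≤ s := by rw [hs3]; norm_num
  have hsdG : (Fintype.card d : ℝ) < 2 * (s - 1) := by rw [hn, hs3]; norm_num
  have hsdK : (Fintype.card d : ℝ) < 2 * s := by rw [hn, hs3]; norm_num
  exact Torus.classicalNS_regular_of_sobolev_control_kernels hd hν hT hs1
    (fun k H => NSSobolev.sum_gramKernel_le_three (d := d) hs3 hsdG k H)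
    (fun k H => NSSobolev.sum_wedgeKernel_le_mpp (d := d) hs1 hsdK k H) hv hmv
    hD₀c hD₁c hD₀ hD₁ hE hu₀ hdiv hmean hRc hRd hRge hR0

end Main

end Literature.Analysis.FluidPDE
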